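/-
Literature/AlgebraicGeometry/Pohlmann1968/DegenerateCMTypesAbelianCMFieldExponentFourTimesTwoOddPrimes.lean — pub-hodgecm2 (COR-CM), KEPT
Literature lane lit-deligne-3 gen 65, file F65c.  THEOREMS ONLY (no `def`, no named fact, no `sorry`, no instance, no notation;
D-0026 net debt 0).  HC_CM is NOT proved.
-/
import Literature.AlgebraicGeometry.Pohlmann1968.DegenerateCMTypesAbelianCMFieldExponentTwoOddPrimes
import Literature.NumberTheory.ComplexMultiplication.DegenerateCMTypesAbelianKernelsIndexFourTwoOddPrimes
import HarnessLib

/-!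
# ABELIAN CM fields with Galois group of EXPONENT `4pq` (`(ℤ/2)^r × (ℤ/4)^s × (ℤ/p)^t × (ℤ/q)^u`, `p ≠ q` odd primes): the rank of every CM type is
# `[K:ℚ]/2 + 1 − b − 2e₄ − (p−1)(e_{2p} + 2e_{4p}) − (q−1)(e_{2q} + 2e_{4q}) − (p−1)(q−1)(s_{2pq} + 2s_{4pq})`; the nondegeneracy criterion; the
# Hodge conjecture for all powers off the eight lists; `ℚ(ζ₆₁)` and the «φ(N) = 120» levels `ℚ(ζ₁₄₃), ℚ(ζ₁₅₅), ℚ(ζ₁₇₅), ℚ(ζ₁₈₃), ℚ(ζ₂₂₅), ℚ(ζ₂₄₄)`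

Topic `Literature/AlgebraicGeometry/Pohlmann1968` (namespace `Literature.AlgebraicGeometry.Pohlmann1968.ExponentFourTimesTwoOddPrimes`); cell `pub-hodgecm2`
(COR-CM), KEPT Literature lane `lit-deligne-3` gen 65 (file F65c: the TWO-ODD-PRIMES programme with `2`-part of exponent `4` — g64 outlook item 1 — the
field file over the lane's kernel decisions F64i (index `2pq`) and F65b (index `4pq`, `NumberTheory/ComplexMultiplication/DegenerateCMTypesAbelianKernelsIndexFourTwoOddPrimes`);
with F65a = `ExponentTwoOddPrimes` it completes the «φ(N) = 60» band: `ℚ(ζ₆₁)` (`(ℤ/61)ˣ ≅ ℤ/60`) joins `77, 93, 99, 124` (F65a)).  KERNEL ONLY: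
theorems; no `def`, no named fact, no instance, no notation (D-0014 ∕ D-0026 net debt `0`).  HC_CM is NOT proved here or anywhere in the lane.

## Mathematics

T. Kubota [Kubota1965], §4 LEMMA 2: for a CM field `K` abelian over `ℚ` with group `G ∋ ρ`, the DEFECT `[K:ℚ]/2 + 1 − Rank(Φ)` of a CM type `Φ`
is the number of ODD characters `χ` of `G` with `χ(S) = 0`, `S = {g : σ_g ∈ Φ}`; grouped by KERNEL (White's proof of his Lemma 3 [White1993SporadicCycles];
tree `AbelianKernels.typeRank_add_sum_totient_eq`: `rank(S) + Σ_H φ([G:H]) = |G|/2 + 1` over the admissible kernels `H ∌ ρ`, `G/H` cyclic, whose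
characters vanish on `S`).  If `g^{4pq} = 1` on `G` (`p ≠ q` odd primes) an admissible kernel has index `2, 4, 2p, 4p, 2q, 4q, 2pq` or `4pq`
(`index_eq_of_isCyclic_quotient`: `[G:H]` is even and divides `4pq`); the subgroups of index `2, 2p, 2q, 2pq` not containing `ρ` automatically have
cyclic quotient (squarefree order), those of index `4, 4p, 4q, 4pq` carry the clause `G/H` cyclic.  Every index is DECIDED by the tree: `2` — `S`
splits evenly (Weil type over the imaginary quadratic `K^H`, [Dodson1984] §3.1.1); `4` — `S` meets every coset of `H` in `|H|/2` elements
(`AbelianKernelsIndexFour`, Yanai's criterion [Yanai2015IndexDegeneracy], [Gordon1999HodgeAVSurvey] 9.4.3); `2p, 4p, 2q, 4q` — `S` EQUIDISTRIBUTED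
along the `p`- (resp. `q`-) torsion of `G/H` (Hazama's Lemma 4.6.1 mechanism [Hazama2003CyclicCM]; index `4p` by the lane's F64b-1); `2pq, 4pq` — the
coset counts ADDITIVELY SEPARABLE along `ℤ/p × ℤ/q ⊂ G/H`: `#(S ∩ gH) + #(S ∩ gxyH) = #(S ∩ gxH) + #(S ∩ gyH)` for `x^p, y^q ∈ H` (F64i for `2pq`;
F65b `…separable_of_index_four_mul_odd_primes` for `4pq`: the `ℚ(i)`-relations among `pq`-th roots of unity, `i ∉ ℚ(ζ_{pq})`).  Hence, EXACTLY,

  `Rank(Φ) + b + 2·e₄ + (p − 1)·e_{2p} + 2(p − 1)·e_{4p} + (q − 1)·e_{2q} + 2(q − 1)·e_{4q} + (p − 1)(q − 1)·s_{2pq} + 2(p − 1)(q − 1)·s_{4pq} = [K:ℚ]/2 + 1`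

with — read on the lattice of subfields through the Galois correspondence [MilneFT2022] — `b` = the imaginary quadratic subfields over which `Φ` is of Weil
type, `e₄` = the CM subfields `F` of degree `4` with `Gal(F/ℚ)` CYCLIC every `τ : F → ℂ` of which has `[K:F]/2` extensions in `Φ`, `e_{2p}` (`e_{4p}`,
`e_{2q}`, `e_{4q}`) = the CM subfields `F` of degree `2p` (`4p` with `Gal(F/ℚ)` cyclic, `2q`, `4q` cyclic) over which `Φ` is LEVEL of exponent `p`
(resp. `p`, `q`, `q`): `#{φ ∈ Φ : φ|_F = τ ∘ σ} = #{φ ∈ Φ : φ|_F = τ}` for `σ^p = 1`, and `s_{2pq}` (`s_{4pq}`) = the CM subfields `F` of degree `2pq`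
(`4pq` with `Gal(F/ℚ)` cyclic) over which `Φ` is ADDITIVELY SEPARABLE: `n(τ) + n(τ ∘ σσ') = n(τ ∘ σ) + n(τ ∘ σ')` for all `τ : F → ℂ`, `σ^p = 1`,
`σ'^q = 1`, `n(τ') = #{φ ∈ Φ : φ|_F = τ'}`.  The one-odd-prime and `2`-part-`2` neighbours are `ExponentTwicePrime` (`2p`), `ExponentFourTimesPrime`
(`4p`), `ExponentTwoOddPrimes` (`2pq`) (lane gens 64–65).

* §0 ∕ §1 GROUP LEVEL (`G` commutative, `g^{4pq} = 1`, `ρ`, `T ⊔ ρT = G`): private arithmetic ∕ cyclicity helpers, **`index_eq_of_isCyclic_quotient`**,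
  **`typeRank_add_card_kernels_eq`** (`rank(T) + #B₂ + 2·#B₄ + (p−1)·#B_{2p} + 2(p−1)·#B_{4p} + (q−1)·#B_{2q} + 2(q−1)·#B_{4q} + (p−1)(q−1)·#S_{2pq} +
  2(p−1)(q−1)·#S_{4pq} = |G|/2 + 1`; Euler's `φ` on the admissible kernels as an indicator combination of the eight decided families),
  **`typeRank_eq_iff`** (nondegenerate iff all eight families are empty).
* §2 FIELD LEVEL (`K` CM, `IsAbelianGalois ℚ K`, `g^{4pq} = 1` on `Gal(K/ℚ)`): `cmTypeRank_add_card_kernels_eq` (on `Gal`); §2b THE READING ON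
  SUBFIELDS: **`card_index_isCyclic_eq_ncard_separable`** (the separable index-`n` kernels with cyclic quotient ARE the CM subfields of degree `n` with
  cyclic Galois group over which `Φ` is additively separable — F65a's `forall_card_filter_add_eq_iff_separable` plus the quotient ↔ `Gal(F/ℚ)`
  dictionary), **`cmTypeRank_add_ncard_subfields_eq`** (THE INTRINSIC RANK FORMULA; the other seven terms by the neighbours'
  `card_indexTwo_eq_ncard_weilQuadratic`, `card_indexFour_eq_ncard_weilQuartic`, `card_index_eq_ncard_level`, `card_index_isCyclic_eq_ncard_level`,
  `card_index_eq_ncard_separable`), **`isNondegenerate_iff_forall_intermediateField`** (NONDEGENERATE ⟺ off all eight lists),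
  `not_isNondegenerate_of_separable_of_isCyclic`.
* §3 ABELIAN VARIETIES: for every realisation `(A, ι, θ)` of a type off the eight lists, `B•(Aⁿ) ⊗ ℂ = D•(Aⁿ) ⊗ ℂ` and the Hodge conjecture for every
  power (`hodgeClassSpan_pow_eq_divisorClassesSpan_of_forall_intermediateField`, **`hodgeConjectureFor_pow_of_forall_intermediateField`**,
  `not_exists_exceptional_pow_of_forall_intermediateField`) — UNCONDITIONAL (Hazama's criterion ∕ Pohlmann [Shimura1998] §8, tree
  `IsNondegenerate.hodgeClassSpan_pow_eq_divisorClassesSpan`).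
* §4 CYCLOTOMIC FIELDS `ℚ(ζ_N)` with `u^{4pq} = 1` on `(ℤ/N)ˣ` (`cmTypeRank_add_ncard_subfields_eq_of_isCyclotomicExtension`,
  `isNondegenerate_iff_of_isCyclotomicExtension`, `hodgeConjectureFor_pow_of_forall_of_isCyclotomicExtension`); the levels of exponent `60 = 4·3·5`
  with `N ≢ 2 (mod 4)`: `61` (`(ℤ/61)ˣ ≅ ℤ/60`, `φ = 60`: `Rank + b + 2e₄ + 2e₆ + 4e₁₂ + 4e₁₀ + 8e₂₀ + 8s₃₀ + 16s₆₀ = 31`, CM `30`-folds) and ALL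
  the «φ(N) = 120» levels of exponent `60`: `143` (`ℤ/10 × ℤ/12`), `155` (`ℤ/4 × ℤ/30`), `175, 225` (`ℤ/6 × ℤ/20`), `183, 244` (`ℤ/2 × ℤ/60`)
  (`= 61`, CM `60`-folds): `units_pow_sixty_*` (`decide +kernel` on residues), **`cmTypeRank_add_ncard_subfields_*`**,
  **`hodgeConjectureFor_pow_of_forall_*`** (`σ³ = AlgEquiv.refl` spells `σ³ = 1`, keeping instance search off the cyclotomic tower).  The remaining
  «φ(N) = 120» levels `231, 248, 308, 372, 396` have exponent `30` and belong to F65a's theorem.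

PRESEARCH (lane rule): the displayed formula ∕ criterion was not found in print as such — corpus hybrid «rank of CM type abelian CM field Galois group
exponent 4pq degenerate characters kernel» (6 book hits, Galois-theory ∕ class-field-theory textbooks, none on CM types), galaxy «degenerate CM type |
rank of a CM-type | index of degeneracy» (all stars: 0 relevant) — it is Kubota's Lemma 2 regrouped by kernels (White) with Dodson's index-`2`, Yanai's
index-`4`, Hazama's level and the `pq`-relation criteria, read through the Galois correspondence; recorded as the lane's own elementary theorem with those
citations.

HONEST REGISTER.  Everything here is unconditional and elementary given the tree's Kubota ∕ Hazama ∕ Pohlmann theorems and the lane's F64i ∕ F65b.  Nothing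
is claimed for the DEGENERATE types (some list non-empty): for them `Bᵐ ⊋ Dᵐ` in some degree and the Hodge conjecture is OPEN in print beyond the known
Weil-type cases; no census numerics are asserted (`2⁶⁰` types per «φ = 120» level).  HC_CM is NOT proved and not used.

## References

* [Kubota1965] T. Kubota, *On the field extension by complex multiplication*, Trans. AMS 118 (1965), §4 Lemma 2.
* [White1993SporadicCycles] S. P. White, *Sporadic cycles on CM abelian varieties*, Compositio Math. 88 (1993), §4, proof of Lemma 3 (p. 131).
* [Dodson1984] B. Dodson, *The structure of Galois groups of CM-fields*, Trans. AMS 283 (1984), §3.1.1 Theorem, §3.2.1.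
* [Hazama2003CyclicCM] F. Hazama, *Hodge cycles on abelian varieties with complex multiplication by cyclic CM-fields*, J. Math. Sci. Univ. Tokyo 10
  (2003): (4.1), Prop. 4.1, Prop. 4.3, Lemma 4.6.1 with (4.6), Thm. 4.8.
* [Yanai2015IndexDegeneracy] H. Yanai, *On the index of degeneracy of a CM-type*, Thm. 4.1 (proof, p. 818).
* [Gordon1999HodgeAVSurvey] B. B. Gordon, *A survey of the Hodge conjecture for abelian varieties*, 5.13 (ii), Thm. 6.4, §9.3, 9.4.1, 9.4.3.
* [MilneFT2022] J. S. Milne, *Fields and Galois Theory*, Thm. 3.16–3.17 (Galois correspondence).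
* [Shimura1998] G. Shimura, *Abelian Varieties with Complex Multiplication and Modular Functions*, §8.1, §18.2.
* [Washington1997] L. C. Washington, *Introduction to Cyclotomic Fields*, Ch. 2, Thm. 2.5.
* [Deligne2000] P. Deligne, *The Hodge conjecture* (Clay, 2000), §1.

## Provenance

Cell `pub-hodgecm2` (COR-CM), KEPT Literature lane `lit-deligne-3` gen 65 (claim ABELIAN-EXPONENT-4PQ-RANK-FORMULA; count-neutral, own lane), file F65c;
neighbours cited by name, nothing restated: `DegenerateCMTypesAbelianKernels` (group level), `DegenerateCMTypesAbelianKernelsIndexFour`,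
`DegenerateCMTypesAbelianKernelsIndexFourMulPrime` (F64b-1), `DegenerateCMTypesAbelianKernelsIndexTwoOddPrimes` (F64i),
`DegenerateCMTypesAbelianKernelsIndexFourTwoOddPrimes` (F65b), `DegenerateCMTypesAbelianCMFieldCyclicSubfields` ∕ `…CyclicQuarticSubfields` (the kernel ↔
subfield dictionary), `DegenerateCMTypesAbelianCMFieldExponentTwicePrime` (F64a), `DegenerateCMTypesAbelianCMFieldExponentFourTimesPrime` (F64b-2),
`DegenerateCMTypesAbelianCMFieldExponentTwoOddPrimes` (F65a: `forall_card_filter_add_eq_iff_separable`, `card_index_eq_ncard_separable`),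
`NondegenerateCMTypeDivisorClasses` (`IsNondegenerate.hodgeClassSpan_pow_eq_divisorClassesSpan`).  The `[folklore]` helpers are private (suffix `_fpq`).
Theorems only; net Literature debt 0.
-/

noncomputable section

open scoped BigOperators NumberField IsMulCommutative Classical
open NumberField IntermediateField

namespace Literature.AlgebraicGeometry.Pohlmann1968

namespace ExponentFourTimesTwoOddPrimes

open Literature.NumberTheory.ComplexMultiplication
open Literature.NumberTheory.ComplexMultiplication.CMNumbers
open Literature.AlgebraicGeometry.Motives (CMType)
open Literature.AlgebraicGeometry.Pohlmann1968.CyclicTwoOddPrimes (isCMTypeWith_galType cmTypeRank_eq_typeRank_galType)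
open Literature.AlgebraicGeometry.Pohlmann1968.AbelianKernels
open Literature.AlgebraicGeometry.Pohlmann1968.ExponentTwicePrime (forall_card_filter_eq_iff_level card_index_eq_ncard_level)
open Literature.AlgebraicGeometry.Pohlmann1968.ExponentFourTimesPrime (card_index_isCyclic_eq_ncard_level
  cm_abelian_pow_eq_one_of_isCyclotomicExtension)
open Literature.AlgebraicGeometry.Pohlmann1968.ExponentTwoOddPrimes (forall_card_filter_add_eq_iff_separable
  card_index_eq_ncard_separable)

/-! ## §0 Arithmetic helper -/

/-- If `a + b + 2c + kd + 2ke + lf + 2lg + (kl)i + 2(kl)j = n` with `k, l ≠ 0` (naturals) then `a = n` iff `b = c = d = e = f = g = i = j = 0`.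
[folklore] -/
private theorem eq_iff_of_add_eq_fpq {a b c d e f g i j k l n : ℕ} (hk : k ≠ 0) (hl : l ≠ 0)
    (h : a + b + 2 * c + k * d + 2 * k * e + l * f + 2 * l * g + k * l * i + 2 * (k * l) * j = n) :
    a = n ↔ b = 0 ∧ c = 0 ∧ d = 0 ∧ e = 0 ∧ f = 0 ∧ g = 0 ∧ i = 0 ∧ j = 0 := by
  have hkl : k * l ≠ 0 := Nat.mul_ne_zero hk hl
  set u := k * d with hu
  set v := 2 * k * e with hv
  set w := l * f with hw
  set x := 2 * l * g with hx
  set y := k * l * i with hy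
  set z := 2 * (k * l) * j with hz
  have hu0 : u = 0 ↔ d = 0 := by rw [hu, Nat.mul_eq_zero]; omega
  have hv0 : v = 0 ↔ e = 0 := by rw [hv, Nat.mul_eq_zero, Nat.mul_eq_zero]; omega
  have hw0 : w = 0 ↔ f = 0 := by rw [hw, Nat.mul_eq_zero]; omega
  have hx0 : x = 0 ↔ g = 0 := by rw [hx, Nat.mul_eq_zero, Nat.mul_eq_zero]; omega
  have hy0 : y = 0 ↔ i = 0 := by rw [hy, Nat.mul_eq_zero]; omega
  have hz0 : z = 0 ↔ j = 0 := by rw [hz, Nat.mul_eq_zero, Nat.mul_eq_zero]; omega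
  constructor
  · intro ha
    exact ⟨by omega, by omega, hu0.1 (by omega), hv0.1 (by omega), hw0.1 (by omega), hx0.1 (by omega), hy0.1 (by omega),
      hz0.1 (by omega)⟩
  · rintro ⟨hb, hc, hd, he, hf, hg, hi, hj⟩
    have := hu0.2 hd; have := hv0.2 he; have := hw0.2 hf; have := hx0.2 hg; have := hy0.2 hi; have := hz0.2 hj
    omega

/-! ## §1 Group level: in exponent `4pq` the admissible kernels have index `2, 4, 2p, 4p, 2q, 4q, 2pq, 4pq`, and each is decided -/

section Group

variable {G : Type*} [CommGroup G] {p q : ℕ}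

/-- A commutative group of order `2p` (`p` an odd prime) is cyclic. [folklore] -/
private theorem isCyclic_of_card_eq_two_mul_fpq [Finite G] [hp : Fact p.Prime] (hp2 : p ≠ 2) (hG : Nat.card G = 2 * p) :
    IsCyclic G := by
  haveI : Fact (Nat.Prime 2) := ⟨Nat.prime_two⟩
  obtain ⟨x, hx⟩ := exists_prime_orderOf_dvd_card' (G := G) 2 (by rw [hG]; exact dvd_mul_right 2 p)
  obtain ⟨y, hy⟩ := exists_prime_orderOf_dvd_card' (G := G) p (by rw [hG]; exact dvd_mul_left p 2)
  have hcop : Nat.Coprime (orderOf x) (orderOf y) := by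
    rw [hx, hy]; exact (Nat.coprime_primes Nat.prime_two hp.out).2 hp2.symm
  exact isCyclic_of_orderOf_eq_card (x * y)
    (by rw [(Commute.all x y).orderOf_mul_eq_mul_orderOf_of_coprime hcop, hx, hy, hG])

/-- A commutative group of order `2pq` (`p ≠ q` odd primes) is cyclic. [folklore] -/
private theorem isCyclic_of_card_eq_two_mul_mul_fpq [Finite G] [hp : Fact p.Prime] [hq : Fact q.Prime] (hpq : p ≠ q)
    (hp2 : p ≠ 2) (hq2 : q ≠ 2) (hG : Nat.card G = 2 * (p * q)) : IsCyclic G := by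
  haveI : Fact (Nat.Prime 2) := ⟨Nat.prime_two⟩
  obtain ⟨x, hx⟩ := exists_prime_orderOf_dvd_card' (G := G) 2 (by rw [hG]; exact dvd_mul_right 2 _)
  obtain ⟨y, hy⟩ := exists_prime_orderOf_dvd_card' (G := G) p
    (by rw [hG]; exact Dvd.dvd.mul_left (dvd_mul_right p q) 2)
  obtain ⟨z, hz⟩ := exists_prime_orderOf_dvd_card' (G := G) q
    (by rw [hG]; exact Dvd.dvd.mul_left (dvd_mul_left q p) 2)
  have hcop : Nat.Coprime (orderOf x) (orderOf y) := by
    rw [hx, hy]; exact (Nat.coprime_primes Nat.prime_two hp.out).2 hp2.symm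
  have hxy : orderOf (x * y) = 2 * p := by
    rw [(Commute.all x y).orderOf_mul_eq_mul_orderOf_of_coprime hcop, hx, hy]
  have hcop' : Nat.Coprime (orderOf (x * y)) (orderOf z) := by
    rw [hxy, hz]
    exact Nat.Coprime.mul_left ((Nat.coprime_primes Nat.prime_two hq.out).2 hq2.symm)
      ((Nat.coprime_primes hp.out hq.out).2 hpq)
  exact isCyclic_of_orderOf_eq_card (x * y * z)
    (by rw [(Commute.all (x * y) z).orderOf_mul_eq_mul_orderOf_of_coprime hcop', hxy, hz, hG]; ring)

/-- **In a commutative group with `g^{4pq} = 1` for all `g` (`p ≠ q` odd primes), a subgroup `H` missing an involution `ρ` and with CYCLIC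
quotient has index `2, 4, 2p, 4p, 2q, 4q, 2pq` or `4pq`**: `|G/H|` divides the exponent `4pq` and is even.  (For index `2, 2p, 2q, 2pq` the
quotient is automatically cyclic; for index `4, 4p, 4q, 4pq` it need not be.) [cite: Kubota1965, §4 Lemma 2]
[cite: White1993SporadicCycles, §4, proof of Lemma 3 (p. 131)] -/
theorem index_eq_of_isCyclic_quotient [hp : Fact p.Prime] [hq : Fact q.Prime] (hp2 : p ≠ 2) (hq2 : q ≠ 2)
    (hexp : ∀ g : G, g ^ (4 * (p * q)) = 1) {H : Subgroup G} {ρ : G} (hρH : ρ ∉ H) (hρ2 : ρ * ρ = 1)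
    (hcyc : IsCyclic (G ⧸ H)) :
    H.index = 2 ∨ H.index = 4 ∨ H.index = 2 * p ∨ H.index = 4 * p ∨ H.index = 2 * q ∨ H.index = 4 * q ∨
      H.index = 2 * (p * q) ∨ H.index = 4 * (p * q) := by
  haveI := hcyc
  have hdvd : H.index ∣ 4 * (p * q) := by
    rw [Subgroup.index_eq_card, ← IsCyclic.exponent_eq_card]
    exact Monoid.exponent_dvd_of_forall_pow_eq_one fun x => QuotientGroup.induction_on x fun g => by
      rw [← QuotientGroup.mk_pow, hexp, QuotientGroup.mk_one]
  have hρ1 : (ρ : G ⧸ H) ≠ 1 := fun h => hρH ((QuotientGroup.eq_one_iff ρ).1 h)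
  have hord : orderOf (ρ : G ⧸ H) = 2 := by
    haveI : Fact (Nat.Prime 2) := ⟨Nat.prime_two⟩
    refine orderOf_eq_prime ?_ hρ1
    rw [pow_two, ← QuotientGroup.mk_mul, hρ2, QuotientGroup.mk_one]
  have h2 : 2 ∣ H.index := by rw [Subgroup.index_eq_card, ← hord]; exact orderOf_dvd_natCard _
  have hp2' : ¬ 2 ∣ p := fun h => hp2 ((Nat.prime_dvd_prime_iff_eq Nat.prime_two hp.out).1 h).symm
  have hq2' : ¬ 2 ∣ q := fun h => hq2 ((Nat.prime_dvd_prime_iff_eq Nat.prime_two hq.out).1 h).symm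
  obtain ⟨d₁, d₂, hd₁, hd₂, hdeq⟩ := Nat.dvd_mul.1 hdvd
  have hd₁' : d₁ ∣ 2 ^ 2 := by rw [show (2 : ℕ) ^ 2 = 4 by norm_num]; exact hd₁
  obtain ⟨i, hi, rfl⟩ := (Nat.dvd_prime_pow Nat.prime_two).1 hd₁'
  obtain ⟨e₁, e₂, he₁, he₂, rfl⟩ := Nat.dvd_mul.1 hd₂
  have hodd : ¬ 2 ∣ e₁ * e₂ := by
    rw [Nat.Prime.dvd_mul Nat.prime_two]
    rcases (Nat.dvd_prime hp.out).1 he₁ with h₁ | h₁ <;> rcases (Nat.dvd_prime hq.out).1 he₂ with h₂ | h₂ <;>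
      rw [h₁, h₂] <;> push Not
    · exact ⟨by norm_num, by norm_num⟩
    · exact ⟨by norm_num, hq2'⟩
    · exact ⟨hp2', by norm_num⟩
    · exact ⟨hp2', hq2'⟩
  interval_cases i
  · exfalso; rw [← hdeq, pow_zero, one_mul] at h2; exact hodd h2
  · rcases (Nat.dvd_prime hp.out).1 he₁ with h₁ | h₁ <;> rcases (Nat.dvd_prime hq.out).1 he₂ with h₂ | h₂ <;>
      rw [h₁, h₂] at hdeq
    · exact Or.inl (by rw [← hdeq]; ring)
    · exact Or.inr (Or.inr (Or.inr (Or.inr (Or.inl (by rw [← hdeq]; ring)))))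
    · exact Or.inr (Or.inr (Or.inl (by rw [← hdeq]; ring)))
    · exact Or.inr (Or.inr (Or.inr (Or.inr (Or.inr (Or.inr (Or.inl (by rw [← hdeq]; ring)))))))
  · rcases (Nat.dvd_prime hp.out).1 he₁ with h₁ | h₁ <;> rcases (Nat.dvd_prime hq.out).1 he₂ with h₂ | h₂ <;>
      rw [h₁, h₂] at hdeq
    · exact Or.inr (Or.inl (by rw [← hdeq]; ring))
    · exact Or.inr (Or.inr (Or.inr (Or.inr (Or.inr (Or.inl (by rw [← hdeq]; ring))))))
    · exact Or.inr (Or.inr (Or.inr (Or.inl (by rw [← hdeq]; ring))))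
    · exact Or.inr (Or.inr (Or.inr (Or.inr (Or.inr (Or.inr (Or.inr (by rw [← hdeq]; ring)))))))

variable [Fintype G] [DecidableEq G]

/-- **THE RANK OF A CM TYPE IN EXPONENT `4pq` (group level).**  Let `G` be a finite commutative group with `g^{4pq} = 1` for all `g` (`p ≠ q`
odd primes; `G ≅ (ℤ/2)^r × (ℤ/4)^s × (ℤ/p)^t × (ℤ/q)^w`), `ρ ∈ G` and `T` a CM type (`T ⊔ ρT = G`).  Then

  `rank(T) + #B₂ + 2·#B₄ + (p−1)·#B_{2p} + 2(p−1)·#B_{4p} + (q−1)·#B_{2q} + 2(q−1)·#B_{4q} + (p−1)(q−1)·#S_{2pq} + 2(p−1)(q−1)·#S_{4pq} = |G|/2 + 1`,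

where `B₂` = the index-`2` subgroups `H ∌ ρ` splitting `T` evenly, `B₄` = the index-`4` subgroups `H ∌ ρ` with CYCLIC quotient meeting `T` in half of
every coset, `B_{2p}, B_{2q}` (resp. `B_{4p}, B_{4q}`, with CYCLIC quotient) = the subgroups `H ∌ ρ` of that index at which `T` is EQUIDISTRIBUTED
along the `p`- resp. `q`-torsion, and `S_{2pq}` (resp. `S_{4pq}`, with CYCLIC quotient) = those at which the coset counts of `T` are ADDITIVELY SEPARABLE
along `ℤ/p × ℤ/q` (`#(T ∩ gH) + #(T ∩ gxyH) = #(T ∩ gxH) + #(T ∩ gyH)`, `x^p, y^q ∈ H`).  Kubota's defect `Σ_H φ([G:H])` over the admissible kernels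
(tree `AbelianKernels.typeRank_add_sum_totient_eq`) with the eight vanishing criteria: index `2` and `4` (tree), `2p, 2q` (tree `…equidistributed_of_index`),
`4p, 4q` (lane `…of_index_four_mul`), `2pq` (F64i), `4pq` (F65b); `φ = 1, 2, p−1, 2(p−1), q−1, 2(q−1), (p−1)(q−1), 2(p−1)(q−1)`.  The exponent-`2pq`
case is the neighbour `ExponentTwoOddPrimes.typeRank_add_card_kernels_eq`, the exponent-`4p` case `ExponentFourTimesPrime.typeRank_add_card_kernels_eq`.
[cite: Kubota1965, §4 Lemma 2] [cite: Hazama2003CyclicCM, Prop. 4.3, Lemma 4.6.1 and Thm. 4.8] [cite: Dodson1984, §3.1.1 Theorem]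
[cite: Gordon1999HodgeAVSurvey, 9.4.3] -/
theorem typeRank_add_card_kernels_eq [hp : Fact p.Prime] [hq : Fact q.Prime] (hpq : p ≠ q) (hp2 : p ≠ 2) (hq2 : q ≠ 2)
    {ρ : G} {T : Finset G} (h : IsCMTypeWith ρ (T : Set G)) (hexp : ∀ g : G, g ^ (4 * (p * q)) = 1) :
    typeRank G (T : Set G) +
      ((Finset.univ : Finset (Subgroup G)).filter fun H => ρ ∉ H ∧ H.index = 2 ∧
        (T.filter fun s => s ∈ H).card = (T.filter fun s => s ∉ H).card).card +
      2 * ((Finset.univ : Finset (Subgroup G)).filter fun H : Subgroup G => ρ ∉ H ∧ H.index = 4 ∧ IsCyclic (G ⧸ H) ∧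
        ∀ g : G, 2 * ((T.filter fun s => g⁻¹ * s ∈ H).card) = Nat.card H).card +
      (p - 1) * ((Finset.univ : Finset (Subgroup G)).filter fun H => ρ ∉ H ∧ H.index = 2 * p ∧
        ∀ x : G, x ^ p ∈ H → ∀ g : G,
          (T.filter fun s => (g * x)⁻¹ * s ∈ H).card = (T.filter fun s => g⁻¹ * s ∈ H).card).card +
      2 * (p - 1) * ((Finset.univ : Finset (Subgroup G)).filter fun H => ρ ∉ H ∧ H.index = 4 * p ∧ IsCyclic (G ⧸ H) ∧
        ∀ x : G, x ^ p ∈ H → ∀ g : G,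
          (T.filter fun s => (g * x)⁻¹ * s ∈ H).card = (T.filter fun s => g⁻¹ * s ∈ H).card).card +
      (q - 1) * ((Finset.univ : Finset (Subgroup G)).filter fun H => ρ ∉ H ∧ H.index = 2 * q ∧
        ∀ x : G, x ^ q ∈ H → ∀ g : G,
          (T.filter fun s => (g * x)⁻¹ * s ∈ H).card = (T.filter fun s => g⁻¹ * s ∈ H).card).card +
      2 * (q - 1) * ((Finset.univ : Finset (Subgroup G)).filter fun H => ρ ∉ H ∧ H.index = 4 * q ∧ IsCyclic (G ⧸ H) ∧
        ∀ x : G, x ^ q ∈ H → ∀ g : G,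
          (T.filter fun s => (g * x)⁻¹ * s ∈ H).card = (T.filter fun s => g⁻¹ * s ∈ H).card).card +
      (p - 1) * (q - 1) * ((Finset.univ : Finset (Subgroup G)).filter fun H => ρ ∉ H ∧ H.index = 2 * (p * q) ∧
        ∀ g x y : G, x ^ p ∈ H → y ^ q ∈ H →
          (T.filter fun s => g⁻¹ * s ∈ H).card + (T.filter fun s => (g * x * y)⁻¹ * s ∈ H).card =
            (T.filter fun s => (g * x)⁻¹ * s ∈ H).card + (T.filter fun s => (g * y)⁻¹ * s ∈ H).card).card +
      2 * ((p - 1) * (q - 1)) * ((Finset.univ : Finset (Subgroup G)).filter fun H => ρ ∉ H ∧ H.index = 4 * (p * q) ∧ IsCyclic (G ⧸ H) ∧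
        ∀ g x y : G, x ^ p ∈ H → y ^ q ∈ H →
          (T.filter fun s => g⁻¹ * s ∈ H).card + (T.filter fun s => (g * x * y)⁻¹ * s ∈ H).card =
            (T.filter fun s => (g * x)⁻¹ * s ∈ H).card + (T.filter fun s => (g * y)⁻¹ * s ∈ H).card).card =
      Fintype.card G / 2 + 1 := by
  have hρ2 : ρ * ρ = 1 := by simpa [smul_eq_mul] using h.invol (1 : G)
  have hp3 : 3 ≤ p := by
    have := hp.out.two_le
    rcases Nat.lt_or_ge 2 p with h' | h'
    · omega
    · exfalso; exact hp2 (le_antisymm h' this)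
  have hq3 : 3 ≤ q := by
    have := hq.out.two_le
    rcases Nat.lt_or_ge 2 q with h' | h'
    · omega
    · exfalso; exact hq2 (le_antisymm h' this)
  have hpodd : p % 2 = 1 := Nat.odd_iff.1 (hp.out.odd_of_ne_two hp2)
  have hqodd : q % 2 = 1 := Nat.odd_iff.1 (hq.out.odd_of_ne_two hq2)
  have hpq3 : 3 * p ≤ p * q := by nlinarith
  have hqp3 : 3 * q ≤ p * q := by nlinarith
  have hpqne : p * q ≠ 2 * p := by nlinarith
  have hpqne' : p * q ≠ 2 * q := by nlinarith
  have h2p : Nat.Coprime 2 p := (Nat.coprime_primes Nat.prime_two hp.out).2 hp2.symm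
  have h4p : Nat.Coprime 4 p := by rw [show (4 : ℕ) = 2 ^ 2 by norm_num]; exact h2p.pow_left 2
  have h2q : Nat.Coprime 2 q := (Nat.coprime_primes Nat.prime_two hq.out).2 hq2.symm
  have h4q : Nat.Coprime 4 q := by rw [show (4 : ℕ) = 2 ^ 2 by norm_num]; exact h2q.pow_left 2
  have hpq' : Nat.Coprime p q := (Nat.coprime_primes hp.out hq.out).2 hpq
  have h2pq : Nat.Coprime 2 (p * q) := Nat.Coprime.mul_right h2p h2q
  have h4pq : Nat.Coprime 4 (p * q) := Nat.Coprime.mul_right h4p h4q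
  have ht4 : Nat.totient 4 = 2 := by decide
  have key := CyclicCMType.AbelianKernels.typeRank_add_sum_totient_eq h
  set A := (Finset.univ : Finset (Subgroup G)).filter (fun H => ρ ∉ H ∧ IsCyclic (G ⧸ H) ∧
    ∀ χ : AddChar (Additive G) ℂ, (∀ g : G, χ (Additive.ofMul g) = 1 ↔ g ∈ H) →
      ∑ s ∈ T, χ (Additive.ofMul s) = 0) with hA
  set B₂ := ((Finset.univ : Finset (Subgroup G)).filter fun H => ρ ∉ H ∧ H.index = 2 ∧
        (T.filter fun s => s ∈ H).card = (T.filter fun s => s ∉ H).card) with hB₂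
  set B₄ := ((Finset.univ : Finset (Subgroup G)).filter fun H : Subgroup G => ρ ∉ H ∧ H.index = 4 ∧ IsCyclic (G ⧸ H) ∧
        ∀ g : G, 2 * ((T.filter fun s => g⁻¹ * s ∈ H).card) = Nat.card H) with hB₄
  set Bp := ((Finset.univ : Finset (Subgroup G)).filter fun H => ρ ∉ H ∧ H.index = 2 * p ∧
        ∀ x : G, x ^ p ∈ H → ∀ g : G,
          (T.filter fun s => (g * x)⁻¹ * s ∈ H).card = (T.filter fun s => g⁻¹ * s ∈ H).card) with hBp
  set Bp4 := ((Finset.univ : Finset (Subgroup G)).filter fun H => ρ ∉ H ∧ H.index = 4 * p ∧ IsCyclic (G ⧸ H) ∧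
        ∀ x : G, x ^ p ∈ H → ∀ g : G,
          (T.filter fun s => (g * x)⁻¹ * s ∈ H).card = (T.filter fun s => g⁻¹ * s ∈ H).card) with hBp4
  set Bq := ((Finset.univ : Finset (Subgroup G)).filter fun H => ρ ∉ H ∧ H.index = 2 * q ∧
        ∀ x : G, x ^ q ∈ H → ∀ g : G,
          (T.filter fun s => (g * x)⁻¹ * s ∈ H).card = (T.filter fun s => g⁻¹ * s ∈ H).card) with hBq
  set Bq4 := ((Finset.univ : Finset (Subgroup G)).filter fun H => ρ ∉ H ∧ H.index = 4 * q ∧ IsCyclic (G ⧸ H) ∧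
        ∀ x : G, x ^ q ∈ H → ∀ g : G,
          (T.filter fun s => (g * x)⁻¹ * s ∈ H).card = (T.filter fun s => g⁻¹ * s ∈ H).card) with hBq4
  set Bpq := ((Finset.univ : Finset (Subgroup G)).filter fun H => ρ ∉ H ∧ H.index = 2 * (p * q) ∧
        ∀ g x y : G, x ^ p ∈ H → y ^ q ∈ H →
          (T.filter fun s => g⁻¹ * s ∈ H).card + (T.filter fun s => (g * x * y)⁻¹ * s ∈ H).card =
            (T.filter fun s => (g * x)⁻¹ * s ∈ H).card + (T.filter fun s => (g * y)⁻¹ * s ∈ H).card) with hBpq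
  set Bpq4 := ((Finset.univ : Finset (Subgroup G)).filter fun H => ρ ∉ H ∧ H.index = 4 * (p * q) ∧ IsCyclic (G ⧸ H) ∧
        ∀ g x y : G, x ^ p ∈ H → y ^ q ∈ H →
          (T.filter fun s => g⁻¹ * s ∈ H).card + (T.filter fun s => (g * x * y)⁻¹ * s ∈ H).card =
            (T.filter fun s => (g * x)⁻¹ * s ∈ H).card + (T.filter fun s => (g * y)⁻¹ * s ∈ H).card) with hBpq4
  -- the admissible kernels of index `2`
  have hA0 : A.filter (fun H => H.index = 2) = B₂ := by
    rw [hA, hB₂, Finset.filter_filter]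
    refine Finset.filter_congr fun H _ => ?_
    constructor
    · rintro ⟨⟨hρH, -, hchar⟩, hidx⟩
      exact ⟨hρH, hidx,
        (CyclicCMType.AbelianKernels.forall_sum_char_eq_zero_iff_of_index_two hρ2 hρH hidx T).1 hchar⟩
    · rintro ⟨hρH, hidx, hsplit⟩
      haveI : Fact (Nat.Prime 2) := ⟨Nat.prime_two⟩
      exact ⟨⟨hρH, isCyclic_of_prime_card (p := 2) (by rw [← Subgroup.index_eq_card, hidx]),
        (CyclicCMType.AbelianKernels.forall_sum_char_eq_zero_iff_of_index_two hρ2 hρH hidx T).2 hsplit⟩, hidx⟩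
  -- index `4`
  have hA1 : A.filter (fun H => H.index = 4) = B₄ := by
    rw [hA, hB₄, Finset.filter_filter]
    refine Finset.filter_congr fun H _ => ?_
    constructor
    · rintro ⟨⟨hρH, hcyc, hchar⟩, hidx⟩
      exact ⟨hρH, hidx, hcyc,
        (CyclicCMType.AbelianKernels.forall_sum_char_eq_zero_iff_of_index_four h hρH hidx hcyc).1 hchar⟩
    · rintro ⟨hρH, hidx, hcyc, hhalf⟩
      exact ⟨⟨hρH, hcyc,
        (CyclicCMType.AbelianKernels.forall_sum_char_eq_zero_iff_of_index_four h hρH hidx hcyc).2 hhalf⟩, hidx⟩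
  -- index `2p`
  have hA2 : A.filter (fun H => H.index = 2 * p) = Bp := by
    rw [hA, hBp, Finset.filter_filter]
    refine Finset.filter_congr fun H _ => ?_
    constructor
    · rintro ⟨⟨hρH, hcyc, hchar⟩, hidx⟩
      have hidx'' : H.index = 2 * p ^ (0 + 1) := by rw [zero_add, pow_one]; exact hidx
      exact ⟨hρH, hidx, (CyclicCMType.AbelianKernels.forall_sum_char_eq_zero_iff_equidistributed_of_index
        hp2 h hρH hcyc hidx'').1 hchar⟩
    · rintro ⟨hρH, hidx, hE⟩
      have hcyc : IsCyclic (G ⧸ H) :=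
        isCyclic_of_card_eq_two_mul_fpq hp2 (by rw [← Subgroup.index_eq_card, hidx])
      have hidx'' : H.index = 2 * p ^ (0 + 1) := by rw [zero_add, pow_one]; exact hidx
      exact ⟨⟨hρH, hcyc, (CyclicCMType.AbelianKernels.forall_sum_char_eq_zero_iff_equidistributed_of_index
        hp2 h hρH hcyc hidx'').2 hE⟩, hidx⟩
  -- index `4p`
  have hA3 : A.filter (fun H => H.index = 4 * p) = Bp4 := by
    rw [hA, hBp4, Finset.filter_filter]
    refine Finset.filter_congr fun H _ => ?_
    constructor
    · rintro ⟨⟨hρH, hcyc, hchar⟩, hidx⟩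
      exact ⟨hρH, hidx, hcyc, (CyclicCMType.AbelianKernels.forall_sum_char_eq_zero_iff_equidistributed_of_index_four_mul
        hp2 h hρH hcyc hidx).1 hchar⟩
    · rintro ⟨hρH, hidx, hcyc, hE⟩
      exact ⟨⟨hρH, hcyc, (CyclicCMType.AbelianKernels.forall_sum_char_eq_zero_iff_equidistributed_of_index_four_mul
        hp2 h hρH hcyc hidx).2 hE⟩, hidx⟩
  -- index `2q`
  have hA4 : A.filter (fun H => H.index = 2 * q) = Bq := by
    rw [hA, hBq, Finset.filter_filter]
    refine Finset.filter_congr fun H _ => ?_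
    constructor
    · rintro ⟨⟨hρH, hcyc, hchar⟩, hidx⟩
      have hidx'' : H.index = 2 * q ^ (0 + 1) := by rw [zero_add, pow_one]; exact hidx
      exact ⟨hρH, hidx, (CyclicCMType.AbelianKernels.forall_sum_char_eq_zero_iff_equidistributed_of_index
        hq2 h hρH hcyc hidx'').1 hchar⟩
    · rintro ⟨hρH, hidx, hE⟩
      have hcyc : IsCyclic (G ⧸ H) :=
        isCyclic_of_card_eq_two_mul_fpq hq2 (by rw [← Subgroup.index_eq_card, hidx])
      have hidx'' : H.index = 2 * q ^ (0 + 1) := by rw [zero_add, pow_one]; exact hidx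
      exact ⟨⟨hρH, hcyc, (CyclicCMType.AbelianKernels.forall_sum_char_eq_zero_iff_equidistributed_of_index
        hq2 h hρH hcyc hidx'').2 hE⟩, hidx⟩
  -- index `4q`
  have hA5 : A.filter (fun H => H.index = 4 * q) = Bq4 := by
    rw [hA, hBq4, Finset.filter_filter]
    refine Finset.filter_congr fun H _ => ?_
    constructor
    · rintro ⟨⟨hρH, hcyc, hchar⟩, hidx⟩
      exact ⟨hρH, hidx, hcyc, (CyclicCMType.AbelianKernels.forall_sum_char_eq_zero_iff_equidistributed_of_index_four_mul
        hq2 h hρH hcyc hidx).1 hchar⟩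
    · rintro ⟨hρH, hidx, hcyc, hE⟩
      exact ⟨⟨hρH, hcyc, (CyclicCMType.AbelianKernels.forall_sum_char_eq_zero_iff_equidistributed_of_index_four_mul
        hq2 h hρH hcyc hidx).2 hE⟩, hidx⟩
  -- index `2pq`
  have hA6 : A.filter (fun H => H.index = 2 * (p * q)) = Bpq := by
    rw [hA, hBpq, Finset.filter_filter]
    refine Finset.filter_congr fun H _ => ?_
    constructor
    · rintro ⟨⟨hρH, hcyc, hchar⟩, hidx⟩
      exact ⟨hρH, hidx, (CyclicCMType.AbelianKernels.forall_sum_char_eq_zero_iff_separable_of_index_two_mul_odd_primes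
        hpq hp2 hq2 h hρH hcyc hidx).1 hchar⟩
    · rintro ⟨hρH, hidx, hS⟩
      have hcyc : IsCyclic (G ⧸ H) :=
        isCyclic_of_card_eq_two_mul_mul_fpq hpq hp2 hq2 (by rw [← Subgroup.index_eq_card, hidx])
      exact ⟨⟨hρH, hcyc, (CyclicCMType.AbelianKernels.forall_sum_char_eq_zero_iff_separable_of_index_two_mul_odd_primes
        hpq hp2 hq2 h hρH hcyc hidx).2 hS⟩, hidx⟩
  -- index `4pq`
  have hA7 : A.filter (fun H => H.index = 4 * (p * q)) = Bpq4 := by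
    rw [hA, hBpq4, Finset.filter_filter]
    refine Finset.filter_congr fun H _ => ?_
    constructor
    · rintro ⟨⟨hρH, hcyc, hchar⟩, hidx⟩
      exact ⟨hρH, hidx, hcyc, (CyclicCMType.AbelianKernels.forall_sum_char_eq_zero_iff_separable_of_index_four_mul_odd_primes
        hpq hp2 hq2 h hρH hcyc hidx).1 hchar⟩
    · rintro ⟨hρH, hidx, hcyc, hS⟩
      exact ⟨⟨hρH, hcyc, (CyclicCMType.AbelianKernels.forall_sum_char_eq_zero_iff_separable_of_index_four_mul_odd_primes
        hpq hp2 hq2 h hρH hcyc hidx).2 hS⟩, hidx⟩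
  -- Euler's `φ` on the admissible kernels, pointwise
  have hpt : ∀ H ∈ A, H.index.totient =
      (if H.index = 2 then 1 else 0) + 2 * (if H.index = 4 then 1 else 0) + (p - 1) * (if H.index = 2 * p then 1 else 0) + 2 * (p - 1) * (if H.index = 4 * p then 1 else 0) +
        (q - 1) * (if H.index = 2 * q then 1 else 0) + 2 * (q - 1) * (if H.index = 4 * q then 1 else 0) + (p - 1) * (q - 1) * (if H.index = 2 * (p * q) then 1 else 0) + 2 * ((p - 1) * (q - 1)) * (if H.index = 4 * (p * q) then 1 else 0) := by
    intro H hH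
    rw [hA, Finset.mem_filter] at hH
    obtain ⟨-, hρH, hcyc, -⟩ := hH
    rcases index_eq_of_isCyclic_quotient hp2 hq2 hexp hρH hρ2 hcyc with hi | hi | hi | hi | hi | hi | hi | hi <;> rw [hi]
    · rw [if_pos rfl, if_neg (by omega : ¬ (2 : ℕ) = 4), if_neg (by omega : ¬ (2 : ℕ) = 2 * p), if_neg (by omega : ¬ (2 : ℕ) = 4 * p), if_neg (by omega : ¬ (2 : ℕ) = 2 * q), if_neg (by omega : ¬ (2 : ℕ) = 4 * q), if_neg (by omega : ¬ (2 : ℕ) = 2 * (p * q)), if_neg (by omega : ¬ (2 : ℕ) = 4 * (p * q)),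
        Nat.totient_two]
      ring
    · rw [if_neg (by omega : ¬ (4 : ℕ) = 2), if_pos rfl, if_neg (by omega : ¬ (4 : ℕ) = 2 * p), if_neg (by omega : ¬ (4 : ℕ) = 4 * p), if_neg (by omega : ¬ (4 : ℕ) = 2 * q), if_neg (by omega : ¬ (4 : ℕ) = 4 * q), if_neg (by omega : ¬ (4 : ℕ) = 2 * (p * q)), if_neg (by omega : ¬ (4 : ℕ) = 4 * (p * q)),
        ht4]
      ring
    · rw [if_neg (by omega : ¬ (2 * p : ℕ) = 2), if_neg (by omega : ¬ (2 * p : ℕ) = 4), if_pos rfl, if_neg (by omega : ¬ (2 * p : ℕ) = 4 * p), if_neg (by omega : ¬ (2 * p : ℕ) = 2 * q), if_neg (by omega : ¬ (2 * p : ℕ) = 4 * q), if_neg (by omega : ¬ (2 * p : ℕ) = 2 * (p * q)), if_neg (by omega : ¬ (2 * p : ℕ) = 4 * (p * q)),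
        Nat.totient_mul h2p, Nat.totient_two, Nat.totient_prime hp.out]
      ring
    · rw [if_neg (by omega : ¬ (4 * p : ℕ) = 2), if_neg (by omega : ¬ (4 * p : ℕ) = 4), if_neg (by omega : ¬ (4 * p : ℕ) = 2 * p), if_pos rfl, if_neg (by omega : ¬ (4 * p : ℕ) = 2 * q), if_neg (by omega : ¬ (4 * p : ℕ) = 4 * q), if_neg (by omega : ¬ (4 * p : ℕ) = 2 * (p * q)), if_neg (by omega : ¬ (4 * p : ℕ) = 4 * (p * q)),
        Nat.totient_mul h4p, ht4, Nat.totient_prime hp.out]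
      ring
    · rw [if_neg (by omega : ¬ (2 * q : ℕ) = 2), if_neg (by omega : ¬ (2 * q : ℕ) = 4), if_neg (by omega : ¬ (2 * q : ℕ) = 2 * p), if_neg (by omega : ¬ (2 * q : ℕ) = 4 * p), if_pos rfl, if_neg (by omega : ¬ (2 * q : ℕ) = 4 * q), if_neg (by omega : ¬ (2 * q : ℕ) = 2 * (p * q)), if_neg (by omega : ¬ (2 * q : ℕ) = 4 * (p * q)),
        Nat.totient_mul h2q, Nat.totient_two, Nat.totient_prime hq.out]
      ring
    · rw [if_neg (by omega : ¬ (4 * q : ℕ) = 2), if_neg (by omega : ¬ (4 * q : ℕ) = 4), if_neg (by omega : ¬ (4 * q : ℕ) = 2 * p), if_neg (by omega : ¬ (4 * q : ℕ) = 4 * p), if_neg (by omega : ¬ (4 * q : ℕ) = 2 * q), if_pos rfl, if_neg (by omega : ¬ (4 * q : ℕ) = 2 * (p * q)), if_neg (by omega : ¬ (4 * q : ℕ) = 4 * (p * q)),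
        Nat.totient_mul h4q, ht4, Nat.totient_prime hq.out]
      ring
    · rw [if_neg (by omega : ¬ (2 * (p * q) : ℕ) = 2), if_neg (by omega : ¬ (2 * (p * q) : ℕ) = 4), if_neg (by omega : ¬ (2 * (p * q) : ℕ) = 2 * p), if_neg (by omega : ¬ (2 * (p * q) : ℕ) = 4 * p), if_neg (by omega : ¬ (2 * (p * q) : ℕ) = 2 * q), if_neg (by omega : ¬ (2 * (p * q) : ℕ) = 4 * q), if_pos rfl, if_neg (by omega : ¬ (2 * (p * q) : ℕ) = 4 * (p * q)),
        Nat.totient_mul h2pq, Nat.totient_two, Nat.totient_mul hpq', Nat.totient_prime hp.out, Nat.totient_prime hq.out]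
      ring
    · rw [if_neg (by omega : ¬ (4 * (p * q) : ℕ) = 2), if_neg (by omega : ¬ (4 * (p * q) : ℕ) = 4), if_neg (by omega : ¬ (4 * (p * q) : ℕ) = 2 * p), if_neg (by omega : ¬ (4 * (p * q) : ℕ) = 4 * p), if_neg (by omega : ¬ (4 * (p * q) : ℕ) = 2 * q), if_neg (by omega : ¬ (4 * (p * q) : ℕ) = 4 * q), if_neg (by omega : ¬ (4 * (p * q) : ℕ) = 2 * (p * q)), if_pos rfl,
        Nat.totient_mul h4pq, ht4, Nat.totient_mul hpq', Nat.totient_prime hp.out, Nat.totient_prime hq.out]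
      ring
  have hsum : ∑ H ∈ A, H.index.totient = B₂.card + 2 * B₄.card + (p - 1) * Bp.card + 2 * (p - 1) * Bp4.card +
      (q - 1) * Bq.card + 2 * (q - 1) * Bq4.card + (p - 1) * (q - 1) * Bpq.card + 2 * ((p - 1) * (q - 1)) * Bpq4.card := by
    rw [Finset.sum_congr rfl hpt, Finset.sum_add_distrib, Finset.sum_add_distrib, Finset.sum_add_distrib, Finset.sum_add_distrib,
      Finset.sum_add_distrib, Finset.sum_add_distrib, Finset.sum_add_distrib,
      ← Finset.mul_sum, ← Finset.mul_sum, ← Finset.mul_sum, ← Finset.mul_sum, ← Finset.mul_sum, ← Finset.mul_sum, ← Finset.mul_sum,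
      ← Finset.card_filter, ← Finset.card_filter, ← Finset.card_filter, ← Finset.card_filter, ← Finset.card_filter,
      ← Finset.card_filter, ← Finset.card_filter, ← Finset.card_filter, hA0, hA1, hA2, hA3, hA4, hA5, hA6, hA7]
  have e : typeRank G (T : Set G) + B₂.card + 2 * B₄.card + (p - 1) * Bp.card + 2 * (p - 1) * Bp4.card + (q - 1) * Bq.card +
      2 * (q - 1) * Bq4.card + (p - 1) * (q - 1) * Bpq.card + 2 * ((p - 1) * (q - 1)) * Bpq4.card =
      typeRank G (T : Set G) + ∑ H ∈ A, H.index.totient := by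
    rw [hsum]; ring
  rw [e]
  exact key

/-- **NONDEGENERATE iff all eight families are empty** (exponent `4pq`). [cite: Kubota1965, §4 Lemma 2] [cite: Hazama2003CyclicCM, Prop. 4.3 and Thm. 4.8]
[cite: Dodson1984, §3.1.1 Theorem] [cite: Gordon1999HodgeAVSurvey, 9.4.3] -/
theorem typeRank_eq_iff [hp : Fact p.Prime] [hq : Fact q.Prime] (hpq : p ≠ q) (hp2 : p ≠ 2) (hq2 : q ≠ 2)
    {ρ : G} {T : Finset G} (h : IsCMTypeWith ρ (T : Set G)) (hexp : ∀ g : G, g ^ (4 * (p * q)) = 1) :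
    typeRank G (T : Set G) = Fintype.card G / 2 + 1 ↔
      (∀ H : Subgroup G, ρ ∉ H → H.index = 2 →
          (T.filter fun s => s ∈ H).card ≠ (T.filter fun s => s ∉ H).card) ∧
      (∀ H : Subgroup G, ρ ∉ H → H.index = 4 → IsCyclic (G ⧸ H) →
          ¬ ∀ g : G, 2 * ((T.filter fun s => g⁻¹ * s ∈ H).card) = Nat.card H) ∧
      (∀ H : Subgroup G, ρ ∉ H → H.index = 2 * p →
          ¬ ∀ x : G, x ^ p ∈ H → ∀ g : G,
            (T.filter fun s => (g * x)⁻¹ * s ∈ H).card = (T.filter fun s => g⁻¹ * s ∈ H).card) ∧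
      (∀ H : Subgroup G, ρ ∉ H → H.index = 4 * p → IsCyclic (G ⧸ H) →
          ¬ ∀ x : G, x ^ p ∈ H → ∀ g : G,
            (T.filter fun s => (g * x)⁻¹ * s ∈ H).card = (T.filter fun s => g⁻¹ * s ∈ H).card) ∧
      (∀ H : Subgroup G, ρ ∉ H → H.index = 2 * q →
          ¬ ∀ x : G, x ^ q ∈ H → ∀ g : G,
            (T.filter fun s => (g * x)⁻¹ * s ∈ H).card = (T.filter fun s => g⁻¹ * s ∈ H).card) ∧
      (∀ H : Subgroup G, ρ ∉ H → H.index = 4 * q → IsCyclic (G ⧸ H) →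
          ¬ ∀ x : G, x ^ q ∈ H → ∀ g : G,
            (T.filter fun s => (g * x)⁻¹ * s ∈ H).card = (T.filter fun s => g⁻¹ * s ∈ H).card) ∧
      (∀ H : Subgroup G, ρ ∉ H → H.index = 2 * (p * q) →
          ¬ ∀ g x y : G, x ^ p ∈ H → y ^ q ∈ H →
            (T.filter fun s => g⁻¹ * s ∈ H).card + (T.filter fun s => (g * x * y)⁻¹ * s ∈ H).card =
              (T.filter fun s => (g * x)⁻¹ * s ∈ H).card + (T.filter fun s => (g * y)⁻¹ * s ∈ H).card) ∧
      (∀ H : Subgroup G, ρ ∉ H → H.index = 4 * (p * q) → IsCyclic (G ⧸ H) →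
          ¬ ∀ g x y : G, x ^ p ∈ H → y ^ q ∈ H →
            (T.filter fun s => g⁻¹ * s ∈ H).card + (T.filter fun s => (g * x * y)⁻¹ * s ∈ H).card =
              (T.filter fun s => (g * x)⁻¹ * s ∈ H).card + (T.filter fun s => (g * y)⁻¹ * s ∈ H).card) := by
  have hp1 : p - 1 ≠ 0 := by have := hp.out.two_le; omega
  have hq1 : q - 1 ≠ 0 := by have := hq.out.two_le; omega
  rw [eq_iff_of_add_eq_fpq hp1 hq1 (typeRank_add_card_kernels_eq hpq hp2 hq2 h hexp), Finset.card_eq_zero, Finset.card_eq_zero,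
    Finset.card_eq_zero, Finset.card_eq_zero, Finset.card_eq_zero, Finset.card_eq_zero, Finset.card_eq_zero, Finset.card_eq_zero,
    Finset.filter_eq_empty_iff, Finset.filter_eq_empty_iff, Finset.filter_eq_empty_iff, Finset.filter_eq_empty_iff,
    Finset.filter_eq_empty_iff, Finset.filter_eq_empty_iff, Finset.filter_eq_empty_iff, Finset.filter_eq_empty_iff]
  simp only [Finset.mem_univ, forall_true_left, not_and, ne_eq]

end Group

/-! ## §2 Abelian CM fields with Galois group of exponent `4pq`: the defect is
`b + 2e₄ + (p−1)e_{2p} + 2(p−1)e_{4p} + (q−1)e_{2q} + 2(q−1)e_{4q} + (p−1)(q−1)s_{2pq} + 2(p−1)(q−1)s_{4pq}` -/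

section Field

variable {K : Type} [Field K] [NumberField K] [IsCMField K] [IsAbelianGalois ℚ K] {p q : ℕ}

/-- **The defect on `Gal(K/ℚ)` for an abelian CM field of exponent `4pq`** (`S = {g : σ_g ∈ Φ}`, `σ_g = φ₀ ∘ g⁻¹`, `ρ` = complex conjugation): the
eight families of `typeRank_add_card_kernels_eq` read on the subgroups of `Gal(K/ℚ)`. [cite: Kubota1965, §4 Lemma 2] [cite: Hazama2003CyclicCM, Prop. 4.3 and Thm. 4.8]
[cite: Dodson1984, §3.1.1 Theorem] [cite: Gordon1999HodgeAVSurvey, 9.4.3] -/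
theorem cmTypeRank_add_card_kernels_eq [Fact p.Prime] [Fact q.Prime] (hpq : p ≠ q) (hp2 : p ≠ 2) (hq2 : q ≠ 2) (φ₀ : K →+* ℂ)
    (hexp : ∀ g : K ≃ₐ[ℚ] K, g ^ (4 * (p * q)) = 1) (Φ : CMType K) :
    cmTypeRank Φ +
      ((Finset.univ : Finset (Subgroup (K ≃ₐ[ℚ] K))).filter fun H =>
        (conjGal : K ≃ₐ[ℚ] K) ∉ H ∧ H.index = 2 ∧
        ((Finset.univ.filter fun g : K ≃ₐ[ℚ] K => embOf φ₀ g ∈ Φ.1).filter fun s => s ∈ H).card =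
          ((Finset.univ.filter fun g : K ≃ₐ[ℚ] K => embOf φ₀ g ∈ Φ.1).filter fun s => s ∉ H).card).card +
      2 * ((Finset.univ : Finset (Subgroup (K ≃ₐ[ℚ] K))).filter fun H : Subgroup (K ≃ₐ[ℚ] K) =>
        (conjGal : K ≃ₐ[ℚ] K) ∉ H ∧ H.index = 4 ∧ IsCyclic ((K ≃ₐ[ℚ] K) ⧸ H) ∧
        ∀ g : K ≃ₐ[ℚ] K, 2 * (((Finset.univ.filter fun g : K ≃ₐ[ℚ] K => embOf φ₀ g ∈ Φ.1).filter
          fun s => g⁻¹ * s ∈ H).card) = Nat.card H).card +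
      (p - 1) * ((Finset.univ : Finset (Subgroup (K ≃ₐ[ℚ] K))).filter fun H =>
        (conjGal : K ≃ₐ[ℚ] K) ∉ H ∧ H.index = 2 * p ∧
        ∀ x : K ≃ₐ[ℚ] K, x ^ p ∈ H → ∀ g : K ≃ₐ[ℚ] K,
          ((Finset.univ.filter fun g : K ≃ₐ[ℚ] K => embOf φ₀ g ∈ Φ.1).filter fun s => (g * x)⁻¹ * s ∈ H).card =
          ((Finset.univ.filter fun g : K ≃ₐ[ℚ] K => embOf φ₀ g ∈ Φ.1).filter fun s => g⁻¹ * s ∈ H).card).card +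
      2 * (p - 1) * ((Finset.univ : Finset (Subgroup (K ≃ₐ[ℚ] K))).filter fun H =>
        (conjGal : K ≃ₐ[ℚ] K) ∉ H ∧ H.index = 4 * p ∧ IsCyclic ((K ≃ₐ[ℚ] K) ⧸ H) ∧
        ∀ x : K ≃ₐ[ℚ] K, x ^ p ∈ H → ∀ g : K ≃ₐ[ℚ] K,
          ((Finset.univ.filter fun g : K ≃ₐ[ℚ] K => embOf φ₀ g ∈ Φ.1).filter fun s => (g * x)⁻¹ * s ∈ H).card =
          ((Finset.univ.filter fun g : K ≃ₐ[ℚ] K => embOf φ₀ g ∈ Φ.1).filter fun s => g⁻¹ * s ∈ H).card).card +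
      (q - 1) * ((Finset.univ : Finset (Subgroup (K ≃ₐ[ℚ] K))).filter fun H =>
        (conjGal : K ≃ₐ[ℚ] K) ∉ H ∧ H.index = 2 * q ∧
        ∀ x : K ≃ₐ[ℚ] K, x ^ q ∈ H → ∀ g : K ≃ₐ[ℚ] K,
          ((Finset.univ.filter fun g : K ≃ₐ[ℚ] K => embOf φ₀ g ∈ Φ.1).filter fun s => (g * x)⁻¹ * s ∈ H).card =
          ((Finset.univ.filter fun g : K ≃ₐ[ℚ] K => embOf φ₀ g ∈ Φ.1).filter fun s => g⁻¹ * s ∈ H).card).card +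
      2 * (q - 1) * ((Finset.univ : Finset (Subgroup (K ≃ₐ[ℚ] K))).filter fun H =>
        (conjGal : K ≃ₐ[ℚ] K) ∉ H ∧ H.index = 4 * q ∧ IsCyclic ((K ≃ₐ[ℚ] K) ⧸ H) ∧
        ∀ x : K ≃ₐ[ℚ] K, x ^ q ∈ H → ∀ g : K ≃ₐ[ℚ] K,
          ((Finset.univ.filter fun g : K ≃ₐ[ℚ] K => embOf φ₀ g ∈ Φ.1).filter fun s => (g * x)⁻¹ * s ∈ H).card =
          ((Finset.univ.filter fun g : K ≃ₐ[ℚ] K => embOf φ₀ g ∈ Φ.1).filter fun s => g⁻¹ * s ∈ H).card).card +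
      (p - 1) * (q - 1) * ((Finset.univ : Finset (Subgroup (K ≃ₐ[ℚ] K))).filter fun H =>
        (conjGal : K ≃ₐ[ℚ] K) ∉ H ∧ H.index = 2 * (p * q) ∧
        ∀ g x y : K ≃ₐ[ℚ] K, x ^ p ∈ H → y ^ q ∈ H →
          ((Finset.univ.filter fun g : K ≃ₐ[ℚ] K => embOf φ₀ g ∈ Φ.1).filter fun s => g⁻¹ * s ∈ H).card +
              ((Finset.univ.filter fun g : K ≃ₐ[ℚ] K => embOf φ₀ g ∈ Φ.1).filter fun s => (g * x * y)⁻¹ * s ∈ H).card =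
            ((Finset.univ.filter fun g : K ≃ₐ[ℚ] K => embOf φ₀ g ∈ Φ.1).filter fun s => (g * x)⁻¹ * s ∈ H).card +
              ((Finset.univ.filter fun g : K ≃ₐ[ℚ] K => embOf φ₀ g ∈ Φ.1).filter fun s => (g * y)⁻¹ * s ∈ H).card).card +
      2 * ((p - 1) * (q - 1)) * ((Finset.univ : Finset (Subgroup (K ≃ₐ[ℚ] K))).filter fun H =>
        (conjGal : K ≃ₐ[ℚ] K) ∉ H ∧ H.index = 4 * (p * q) ∧ IsCyclic ((K ≃ₐ[ℚ] K) ⧸ H) ∧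
        ∀ g x y : K ≃ₐ[ℚ] K, x ^ p ∈ H → y ^ q ∈ H →
          ((Finset.univ.filter fun g : K ≃ₐ[ℚ] K => embOf φ₀ g ∈ Φ.1).filter fun s => g⁻¹ * s ∈ H).card +
              ((Finset.univ.filter fun g : K ≃ₐ[ℚ] K => embOf φ₀ g ∈ Φ.1).filter fun s => (g * x * y)⁻¹ * s ∈ H).card =
            ((Finset.univ.filter fun g : K ≃ₐ[ℚ] K => embOf φ₀ g ∈ Φ.1).filter fun s => (g * x)⁻¹ * s ∈ H).card +
              ((Finset.univ.filter fun g : K ≃ₐ[ℚ] K => embOf φ₀ g ∈ Φ.1).filter fun s => (g * y)⁻¹ * s ∈ H).card).card =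
      Module.finrank ℚ K / 2 + 1 := by
  rw [cmTypeRank_eq_typeRank_galType Φ φ₀, ← card_gal_eq_finrank φ₀]
  exact typeRank_add_card_kernels_eq hpq hp2 hq2 (isCMTypeWith_galType (AbelianCMFieldExistence.apply_conjGal_eq φ₀) Φ) hexp

/-- **The separable kernels of index `n` WITH CYCLIC QUOTIENT are the CM subfields of degree `n` with CYCLIC Galois group over which `Φ` is
additively separable**: `H ↦ K^H` (Galois correspondence; `G/H ≅ Gal(K^H/ℚ)`; separability at `Gal(K/F)` is separability over `F`, the neighbour's
`ExponentTwoOddPrimes.forall_card_filter_add_eq_iff_separable`).  The version without the cyclicity clause is the neighbour's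
`card_index_eq_ncard_separable`. [cite: Yanai2015IndexDegeneracy, Thm. 4.1 (proof, p. 818)] [cite: MilneFT2022, Thm. 3.16] -/
theorem card_index_isCyclic_eq_ncard_separable (φ₀ : K →+* ℂ) (Φ : CMType K) (n : ℕ) :
    ((Finset.univ : Finset (Subgroup (K ≃ₐ[ℚ] K))).filter fun H =>
        (conjGal : K ≃ₐ[ℚ] K) ∉ H ∧ H.index = n ∧ IsCyclic ((K ≃ₐ[ℚ] K) ⧸ H) ∧
        ∀ g x y : K ≃ₐ[ℚ] K, x ^ p ∈ H → y ^ q ∈ H →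
          ((Finset.univ.filter fun g : K ≃ₐ[ℚ] K => embOf φ₀ g ∈ Φ.1).filter fun s => g⁻¹ * s ∈ H).card +
              ((Finset.univ.filter fun g : K ≃ₐ[ℚ] K => embOf φ₀ g ∈ Φ.1).filter fun s => (g * x * y)⁻¹ * s ∈ H).card =
            ((Finset.univ.filter fun g : K ≃ₐ[ℚ] K => embOf φ₀ g ∈ Φ.1).filter fun s => (g * x)⁻¹ * s ∈ H).card +
              ((Finset.univ.filter fun g : K ≃ₐ[ℚ] K => embOf φ₀ g ∈ Φ.1).filter fun s => (g * y)⁻¹ * s ∈ H).card).card =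
      {F : IntermediateField ℚ K | Module.finrank ℚ F = n ∧ ¬ IsTotallyReal F ∧ IsCyclic (F ≃ₐ[ℚ] F) ∧
        ∀ σ σ' : F ≃ₐ[ℚ] F, σ ^ p = 1 → σ' ^ q = 1 → ∀ τ : F →+* ℂ,
          {φ : K →+* ℂ | φ.comp (algebraMap F K) = τ ∧ φ ∈ Φ.1}.ncard +
              {φ : K →+* ℂ | φ.comp (algebraMap F K) = τ.comp (σ * σ').toRingEquiv.toRingHom ∧ φ ∈ Φ.1}.ncard =
            {φ : K →+* ℂ | φ.comp (algebraMap F K) = τ.comp σ.toRingEquiv.toRingHom ∧ φ ∈ Φ.1}.ncard +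
              {φ : K →+* ℂ | φ.comp (algebraMap F K) = τ.comp σ'.toRingEquiv.toRingHom ∧ φ ∈ Φ.1}.ncard}.ncard := by
  set B := ((Finset.univ : Finset (Subgroup (K ≃ₐ[ℚ] K))).filter fun H =>
        (conjGal : K ≃ₐ[ℚ] K) ∉ H ∧ H.index = n ∧ IsCyclic ((K ≃ₐ[ℚ] K) ⧸ H) ∧
        ∀ g x y : K ≃ₐ[ℚ] K, x ^ p ∈ H → y ^ q ∈ H →
          ((Finset.univ.filter fun g : K ≃ₐ[ℚ] K => embOf φ₀ g ∈ Φ.1).filter fun s => g⁻¹ * s ∈ H).card +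
              ((Finset.univ.filter fun g : K ≃ₐ[ℚ] K => embOf φ₀ g ∈ Φ.1).filter fun s => (g * x * y)⁻¹ * s ∈ H).card =
            ((Finset.univ.filter fun g : K ≃ₐ[ℚ] K => embOf φ₀ g ∈ Φ.1).filter fun s => (g * x)⁻¹ * s ∈ H).card +
              ((Finset.univ.filter fun g : K ≃ₐ[ℚ] K => embOf φ₀ g ∈ Φ.1).filter fun s => (g * y)⁻¹ * s ∈ H).card) with hB
  have hinj : Function.Injective (fun H : Subgroup (K ≃ₐ[ℚ] K) => fixedField H) := fun H H' hHH' => by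
    have := congrArg IntermediateField.fixingSubgroup hHH'
    simpa only [fixingSubgroup_fixedField] using this
  have himage : (fun H : Subgroup (K ≃ₐ[ℚ] K) => fixedField H) '' (↑B : Set (Subgroup (K ≃ₐ[ℚ] K))) =
      {F : IntermediateField ℚ K | Module.finrank ℚ F = n ∧ ¬ IsTotallyReal F ∧ IsCyclic (F ≃ₐ[ℚ] F) ∧
        ∀ σ σ' : F ≃ₐ[ℚ] F, σ ^ p = 1 → σ' ^ q = 1 → ∀ τ : F →+* ℂ,
          {φ : K →+* ℂ | φ.comp (algebraMap F K) = τ ∧ φ ∈ Φ.1}.ncard +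
              {φ : K →+* ℂ | φ.comp (algebraMap F K) = τ.comp (σ * σ').toRingEquiv.toRingHom ∧ φ ∈ Φ.1}.ncard =
            {φ : K →+* ℂ | φ.comp (algebraMap F K) = τ.comp σ.toRingEquiv.toRingHom ∧ φ ∈ Φ.1}.ncard +
              {φ : K →+* ℂ | φ.comp (algebraMap F K) = τ.comp σ'.toRingEquiv.toRingHom ∧ φ ∈ Φ.1}.ncard} := by
    ext F
    simp only [Set.mem_image, Finset.mem_coe, hB, Finset.mem_filter, Finset.mem_univ, true_and,
      Set.mem_setOf_eq]
    constructor
    · rintro ⟨H, ⟨hρH, hidx, hcyc, hS⟩, rfl⟩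
      refine ⟨by rw [← index_eq_finrank_fixedField, hidx],
        (conjGal_not_mem_iff_not_isTotallyReal_fixedField H).1 hρH,
        (isCyclic_quotient_iff_isCyclic_gal_fixedField H).1 hcyc,
        (forall_card_filter_add_eq_iff_separable φ₀ Φ (fixedField H)).1 ?_⟩
      simpa only [fixingSubgroup_fixedField] using hS
    · rintro ⟨hn, hF, hcyc, hS⟩
      refine ⟨F.fixingSubgroup, ⟨(conjGal_not_mem_fixingSubgroup_iff F).2 hF,
        by rw [CMNumbers.index_fixingSubgroup_eq_finrank, hn], (isCyclic_quotient_fixingSubgroup_iff F).2 hcyc,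
        (forall_card_filter_add_eq_iff_separable φ₀ Φ F).2 hS⟩, IsGalois.fixedField_fixingSubgroup F⟩
  rw [← himage, Set.ncard_image_of_injective _ hinj, Set.ncard_coe_finset]

/-- **THE RANK OF A CM TYPE OF AN ABELIAN CM FIELD OF EXPONENT `4pq`, ON THE LATTICE OF SUBFIELDS.**  Let `K` be a CM field, abelian over `ℚ`, with
`g^{4pq} = 1` on `Gal(K/ℚ)` (`p ≠ q` odd primes; `Gal ≅ (ℤ/2)^r × (ℤ/4)^s × (ℤ/p)^t × (ℤ/q)^w` — e.g. the cyclic `ℚ(ζ₆₁)` (`ℤ/60`), `ℚ(ζ₁₄₃)`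
(`ℤ/10 × ℤ/12`), `ℚ(ζ₁₅₅)` (`ℤ/4 × ℤ/30`), `ℚ(ζ₁₇₅), ℚ(ζ₂₂₅)` (`ℤ/6 × ℤ/20`), `ℚ(ζ₁₈₃), ℚ(ζ₂₄₄)` (`ℤ/2 × ℤ/60`), their CM subfields and
composita with `ℚ(i), ℚ(ζ₅)`), and `Φ` ANY CM type of `K`.  Then

  `Rank(Φ) + b + 2·e₄ + (p−1)·e_{2p} + 2(p−1)·e_{4p} + (q−1)·e_{2q} + 2(q−1)·e_{4q} + (p−1)(q−1)·s_{2pq} + 2(p−1)(q−1)·s_{4pq} = [K:ℚ]/2 + 1`,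

`b` = the imaginary quadratic subfields over which `Φ` is of Weil type, `e₄` = the CM subfields `F` with `Gal(F/ℚ) ≅ ℤ/4` every embedding of which
has `[K:F]/2` extensions in `Φ`, `e_{2p}, e_{2q}` (resp. `e_{4p}, e_{4q}` with CYCLIC `Gal(F/ℚ)`) = the CM subfields of that degree over which `Φ` is
LEVEL of exponent `p` resp. `q`, `s_{2pq}` (resp. `s_{4pq}` with CYCLIC `Gal(F/ℚ)`) = the CM subfields of that degree over which `Φ` is ADDITIVELY
SEPARABLE (`n(τ) + n(τ ∘ σσ') = n(τ ∘ σ) + n(τ ∘ σ')`, `σ^p = 1`, `σ'^q = 1`). [cite: Kubota1965, §4 Lemma 2]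
[cite: Hazama2003CyclicCM, Prop. 4.1, 4.3, Lemma 4.6.1 and Thm. 4.8] [cite: Dodson1984, §3.1.1 Theorem] [cite: Gordon1999HodgeAVSurvey, 5.13 (ii), 9.4.1 and 9.4.3]
[cite: Yanai2015IndexDegeneracy, Thm. 4.1 (proof, p. 818)] -/
theorem cmTypeRank_add_ncard_subfields_eq [Fact p.Prime] [Fact q.Prime] (hpq : p ≠ q) (hp2 : p ≠ 2) (hq2 : q ≠ 2)
    (hexp : ∀ g : K ≃ₐ[ℚ] K, g ^ (4 * (p * q)) = 1) (Φ : CMType K) :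
    cmTypeRank Φ + {F : IntermediateField ℚ K | Module.finrank ℚ F = 2 ∧ ¬ IsTotallyReal F ∧
        ∀ τ : F →+* ℂ, {φ : K →+* ℂ | φ.comp (algebraMap F K) = τ ∧ φ ∈ Φ.1}.ncard =
          {φ : K →+* ℂ | φ.comp (algebraMap F K) = τ ∧ φ ∉ Φ.1}.ncard}.ncard +
      2 * {F : IntermediateField ℚ K | Module.finrank ℚ F = 4 ∧ ¬ IsTotallyReal F ∧ IsCyclic (F ≃ₐ[ℚ] F) ∧
        ∀ τ : F →+* ℂ, 2 * {φ : K →+* ℂ | φ.comp (algebraMap F K) = τ ∧ φ ∈ Φ.1}.ncard = Module.finrank F K}.ncard +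
      (p - 1) * {F : IntermediateField ℚ K | Module.finrank ℚ F = 2 * p ∧ ¬ IsTotallyReal F ∧
        ∀ σ : F ≃ₐ[ℚ] F, σ ^ p = 1 → ∀ τ : F →+* ℂ,
          {φ : K →+* ℂ | φ.comp (algebraMap F K) = τ.comp σ.toRingEquiv.toRingHom ∧ φ ∈ Φ.1}.ncard =
            {φ : K →+* ℂ | φ.comp (algebraMap F K) = τ ∧ φ ∈ Φ.1}.ncard}.ncard +
      2 * (p - 1) * {F : IntermediateField ℚ K | Module.finrank ℚ F = 4 * p ∧ ¬ IsTotallyReal F ∧ IsCyclic (F ≃ₐ[ℚ] F) ∧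
        ∀ σ : F ≃ₐ[ℚ] F, σ ^ p = 1 → ∀ τ : F →+* ℂ,
          {φ : K →+* ℂ | φ.comp (algebraMap F K) = τ.comp σ.toRingEquiv.toRingHom ∧ φ ∈ Φ.1}.ncard =
            {φ : K →+* ℂ | φ.comp (algebraMap F K) = τ ∧ φ ∈ Φ.1}.ncard}.ncard +
      (q - 1) * {F : IntermediateField ℚ K | Module.finrank ℚ F = 2 * q ∧ ¬ IsTotallyReal F ∧
        ∀ σ : F ≃ₐ[ℚ] F, σ ^ q = 1 → ∀ τ : F →+* ℂ,
          {φ : K →+* ℂ | φ.comp (algebraMap F K) = τ.comp σ.toRingEquiv.toRingHom ∧ φ ∈ Φ.1}.ncard =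
            {φ : K →+* ℂ | φ.comp (algebraMap F K) = τ ∧ φ ∈ Φ.1}.ncard}.ncard +
      2 * (q - 1) * {F : IntermediateField ℚ K | Module.finrank ℚ F = 4 * q ∧ ¬ IsTotallyReal F ∧ IsCyclic (F ≃ₐ[ℚ] F) ∧
        ∀ σ : F ≃ₐ[ℚ] F, σ ^ q = 1 → ∀ τ : F →+* ℂ,
          {φ : K →+* ℂ | φ.comp (algebraMap F K) = τ.comp σ.toRingEquiv.toRingHom ∧ φ ∈ Φ.1}.ncard =
            {φ : K →+* ℂ | φ.comp (algebraMap F K) = τ ∧ φ ∈ Φ.1}.ncard}.ncard +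
      (p - 1) * (q - 1) * {F : IntermediateField ℚ K | Module.finrank ℚ F = 2 * (p * q) ∧ ¬ IsTotallyReal F ∧
        ∀ σ σ' : F ≃ₐ[ℚ] F, σ ^ p = 1 → σ' ^ q = 1 → ∀ τ : F →+* ℂ,
          {φ : K →+* ℂ | φ.comp (algebraMap F K) = τ ∧ φ ∈ Φ.1}.ncard +
              {φ : K →+* ℂ | φ.comp (algebraMap F K) = τ.comp (σ * σ').toRingEquiv.toRingHom ∧ φ ∈ Φ.1}.ncard =
            {φ : K →+* ℂ | φ.comp (algebraMap F K) = τ.comp σ.toRingEquiv.toRingHom ∧ φ ∈ Φ.1}.ncard +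
              {φ : K →+* ℂ | φ.comp (algebraMap F K) = τ.comp σ'.toRingEquiv.toRingHom ∧ φ ∈ Φ.1}.ncard}.ncard +
      2 * ((p - 1) * (q - 1)) * {F : IntermediateField ℚ K | Module.finrank ℚ F = 4 * (p * q) ∧ ¬ IsTotallyReal F ∧ IsCyclic (F ≃ₐ[ℚ] F) ∧
        ∀ σ σ' : F ≃ₐ[ℚ] F, σ ^ p = 1 → σ' ^ q = 1 → ∀ τ : F →+* ℂ,
          {φ : K →+* ℂ | φ.comp (algebraMap F K) = τ ∧ φ ∈ Φ.1}.ncard +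
              {φ : K →+* ℂ | φ.comp (algebraMap F K) = τ.comp (σ * σ').toRingEquiv.toRingHom ∧ φ ∈ Φ.1}.ncard =
            {φ : K →+* ℂ | φ.comp (algebraMap F K) = τ.comp σ.toRingEquiv.toRingHom ∧ φ ∈ Φ.1}.ncard +
              {φ : K →+* ℂ | φ.comp (algebraMap F K) = τ.comp σ'.toRingEquiv.toRingHom ∧ φ ∈ Φ.1}.ncard}.ncard = Module.finrank ℚ K / 2 + 1 := by
  obtain ⟨φ₀⟩ := (inferInstance : Nonempty (K →+* ℂ))
  rw [← card_indexTwo_eq_ncard_weilQuadratic φ₀ Φ, ← card_indexFour_eq_ncard_weilQuartic φ₀ Φ,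
    ← card_index_eq_ncard_level φ₀ Φ, ← card_index_isCyclic_eq_ncard_level φ₀ Φ (4 * p),
    ← card_index_eq_ncard_level φ₀ Φ, ← card_index_isCyclic_eq_ncard_level φ₀ Φ (4 * q),
    ← card_index_eq_ncard_separable φ₀ Φ, ← card_index_isCyclic_eq_ncard_separable φ₀ Φ (4 * (p * q))]
  exact cmTypeRank_add_card_kernels_eq hpq hp2 hq2 φ₀ hexp Φ

omit [IsCMField K] [IsAbelianGalois ℚ K] in
/-- A number field has finitely many subfields (primitive element theorem). [folklore] -/
private theorem finite_intermediateField_fpq : Finite (IntermediateField ℚ K) :=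
  Field.finite_intermediateField_of_exists_primitive_element ℚ K (Field.exists_primitive_element ℚ K)

/-- **NONDEGENERACY CRITERION ON THE LATTICE OF SUBFIELDS (exponent `4pq`).**  `Φ` is NONDEGENERATE iff it is (i) of Weil type over NO imaginary
quadratic subfield, (ii) «half of every fibre» over NO CM subfield with `Gal ≅ ℤ/4`, (iii)–(vi) level of exponent `p` (resp. `q`) over NO CM subfield of
degree `2p` (resp. `2q`), nor of degree `4p` (resp. `4q`) with cyclic Galois group, and (vii)–(viii) additively separable over NO CM subfield of degree
`2pq`, nor of degree `4pq` with cyclic Galois group — one surviving odd character per admissible kernel. [cite: Kubota1965, §4 Lemma 2]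
[cite: Hazama2003CyclicCM, Prop. 4.3 and Thm. 4.8] [cite: Dodson1984, §3.1.1 Theorem] [cite: Gordon1999HodgeAVSurvey, 9.4.3] -/
theorem isNondegenerate_iff_forall_intermediateField [hp : Fact p.Prime] [hq : Fact q.Prime] (hpq : p ≠ q) (hp2 : p ≠ 2)
    (hq2 : q ≠ 2) (hexp : ∀ g : K ≃ₐ[ℚ] K, g ^ (4 * (p * q)) = 1) (Φ : CMType K) :
    IsNondegenerate Φ ↔
      (∀ F : IntermediateField ℚ K, Module.finrank ℚ F = 2 → ¬ IsTotallyReal F →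
        ¬ ∀ τ : F →+* ℂ, {φ : K →+* ℂ | φ.comp (algebraMap F K) = τ ∧ φ ∈ Φ.1}.ncard =
          {φ : K →+* ℂ | φ.comp (algebraMap F K) = τ ∧ φ ∉ Φ.1}.ncard) ∧
      (∀ F : IntermediateField ℚ K, Module.finrank ℚ F = 4 → ¬ IsTotallyReal F → IsCyclic (F ≃ₐ[ℚ] F) →
        ¬ ∀ τ : F →+* ℂ, 2 * {φ : K →+* ℂ | φ.comp (algebraMap F K) = τ ∧ φ ∈ Φ.1}.ncard = Module.finrank F K) ∧
      (∀ F : IntermediateField ℚ K, Module.finrank ℚ F = 2 * p → ¬ IsTotallyReal F →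
        ¬ ∀ σ : F ≃ₐ[ℚ] F, σ ^ p = 1 → ∀ τ : F →+* ℂ,
          {φ : K →+* ℂ | φ.comp (algebraMap F K) = τ.comp σ.toRingEquiv.toRingHom ∧ φ ∈ Φ.1}.ncard =
            {φ : K →+* ℂ | φ.comp (algebraMap F K) = τ ∧ φ ∈ Φ.1}.ncard) ∧
      (∀ F : IntermediateField ℚ K, Module.finrank ℚ F = 4 * p → ¬ IsTotallyReal F → IsCyclic (F ≃ₐ[ℚ] F) →
        ¬ ∀ σ : F ≃ₐ[ℚ] F, σ ^ p = 1 → ∀ τ : F →+* ℂ,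
          {φ : K →+* ℂ | φ.comp (algebraMap F K) = τ.comp σ.toRingEquiv.toRingHom ∧ φ ∈ Φ.1}.ncard =
            {φ : K →+* ℂ | φ.comp (algebraMap F K) = τ ∧ φ ∈ Φ.1}.ncard) ∧
      (∀ F : IntermediateField ℚ K, Module.finrank ℚ F = 2 * q → ¬ IsTotallyReal F →
        ¬ ∀ σ : F ≃ₐ[ℚ] F, σ ^ q = 1 → ∀ τ : F →+* ℂ,
          {φ : K →+* ℂ | φ.comp (algebraMap F K) = τ.comp σ.toRingEquiv.toRingHom ∧ φ ∈ Φ.1}.ncard =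
            {φ : K →+* ℂ | φ.comp (algebraMap F K) = τ ∧ φ ∈ Φ.1}.ncard) ∧
      (∀ F : IntermediateField ℚ K, Module.finrank ℚ F = 4 * q → ¬ IsTotallyReal F → IsCyclic (F ≃ₐ[ℚ] F) →
        ¬ ∀ σ : F ≃ₐ[ℚ] F, σ ^ q = 1 → ∀ τ : F →+* ℂ,
          {φ : K →+* ℂ | φ.comp (algebraMap F K) = τ.comp σ.toRingEquiv.toRingHom ∧ φ ∈ Φ.1}.ncard =
            {φ : K →+* ℂ | φ.comp (algebraMap F K) = τ ∧ φ ∈ Φ.1}.ncard) ∧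
      (∀ F : IntermediateField ℚ K, Module.finrank ℚ F = 2 * (p * q) → ¬ IsTotallyReal F →
        ¬ ∀ σ σ' : F ≃ₐ[ℚ] F, σ ^ p = 1 → σ' ^ q = 1 → ∀ τ : F →+* ℂ,
          {φ : K →+* ℂ | φ.comp (algebraMap F K) = τ ∧ φ ∈ Φ.1}.ncard +
              {φ : K →+* ℂ | φ.comp (algebraMap F K) = τ.comp (σ * σ').toRingEquiv.toRingHom ∧ φ ∈ Φ.1}.ncard =
            {φ : K →+* ℂ | φ.comp (algebraMap F K) = τ.comp σ.toRingEquiv.toRingHom ∧ φ ∈ Φ.1}.ncard +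
              {φ : K →+* ℂ | φ.comp (algebraMap F K) = τ.comp σ'.toRingEquiv.toRingHom ∧ φ ∈ Φ.1}.ncard) ∧
      (∀ F : IntermediateField ℚ K, Module.finrank ℚ F = 4 * (p * q) → ¬ IsTotallyReal F → IsCyclic (F ≃ₐ[ℚ] F) →
        ¬ ∀ σ σ' : F ≃ₐ[ℚ] F, σ ^ p = 1 → σ' ^ q = 1 → ∀ τ : F →+* ℂ,
          {φ : K →+* ℂ | φ.comp (algebraMap F K) = τ ∧ φ ∈ Φ.1}.ncard +
              {φ : K →+* ℂ | φ.comp (algebraMap F K) = τ.comp (σ * σ').toRingEquiv.toRingHom ∧ φ ∈ Φ.1}.ncard =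
            {φ : K →+* ℂ | φ.comp (algebraMap F K) = τ.comp σ.toRingEquiv.toRingHom ∧ φ ∈ Φ.1}.ncard +
              {φ : K →+* ℂ | φ.comp (algebraMap F K) = τ.comp σ'.toRingEquiv.toRingHom ∧ φ ∈ Φ.1}.ncard) := by
  haveI := finite_intermediateField_fpq (K := K)
  have hp1 : p - 1 ≠ 0 := by have := hp.out.two_le; omega
  have hq1 : q - 1 ≠ 0 := by have := hq.out.two_le; omega
  rw [_root_.Literature.AlgebraicGeometry.Pohlmann1968.isNondegenerate_iff,
    eq_iff_of_add_eq_fpq hp1 hq1 (cmTypeRank_add_ncard_subfields_eq hpq hp2 hq2 hexp Φ),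
    Set.ncard_eq_zero, Set.ncard_eq_zero, Set.ncard_eq_zero, Set.ncard_eq_zero, Set.ncard_eq_zero, Set.ncard_eq_zero, Set.ncard_eq_zero,
    Set.ncard_eq_zero, Set.eq_empty_iff_forall_notMem, Set.eq_empty_iff_forall_notMem, Set.eq_empty_iff_forall_notMem,
    Set.eq_empty_iff_forall_notMem, Set.eq_empty_iff_forall_notMem, Set.eq_empty_iff_forall_notMem, Set.eq_empty_iff_forall_notMem,
    Set.eq_empty_iff_forall_notMem]
  simp only [Set.mem_setOf_eq, not_and]

/-- **Conversely: a CM subfield of degree `4pq` with cyclic Galois group over which `Φ` is additively separable makes the type DEGENERATE** (it costs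
`φ(4pq) = 2(p−1)(q−1)` in rank; the other seven converses are the neighbours' `not_isNondegenerate_of_*`). [cite: Kubota1965, §4 Lemma 2]
[cite: Hazama2003CyclicCM, Thm. 4.8] -/
theorem not_isNondegenerate_of_separable_of_isCyclic [Fact p.Prime] [Fact q.Prime] (hpq : p ≠ q) (hp2 : p ≠ 2) (hq2 : q ≠ 2)
    (hexp : ∀ g : K ≃ₐ[ℚ] K, g ^ (4 * (p * q)) = 1) (Φ : CMType K) (F : IntermediateField ℚ K)
    (h4pq : Module.finrank ℚ F = 4 * (p * q)) (hF : ¬ IsTotallyReal F) (hcyc : IsCyclic (F ≃ₐ[ℚ] F))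
    (hS : ∀ σ σ' : F ≃ₐ[ℚ] F, σ ^ p = 1 → σ' ^ q = 1 → ∀ τ : F →+* ℂ,
          {φ : K →+* ℂ | φ.comp (algebraMap F K) = τ ∧ φ ∈ Φ.1}.ncard +
              {φ : K →+* ℂ | φ.comp (algebraMap F K) = τ.comp (σ * σ').toRingEquiv.toRingHom ∧ φ ∈ Φ.1}.ncard =
            {φ : K →+* ℂ | φ.comp (algebraMap F K) = τ.comp σ.toRingEquiv.toRingHom ∧ φ ∈ Φ.1}.ncard +
              {φ : K →+* ℂ | φ.comp (algebraMap F K) = τ.comp σ'.toRingEquiv.toRingHom ∧ φ ∈ Φ.1}.ncard) :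
    ¬ IsNondegenerate Φ := by
  rw [isNondegenerate_iff_forall_intermediateField hpq hp2 hq2 hexp Φ]
  exact fun h => h.2.2.2.2.2.2.2 F h4pq hF hcyc hS

end Field

/-! ## §3 Consequences for abelian varieties: `B•(Aⁿ) ⊗ ℂ = D•(Aⁿ) ⊗ ℂ` and the Hodge conjecture for all powers -/

section Varieties

open Literature.AlgebraicGeometry.Motives (AbelianVariety)
open Literature.AlgebraicGeometry.HodgeTheory
open Literature.AlgebraicGeometry.ComplexMultiplication (IsCMTypeRealisation)
open Literature.AlgebraicGeometry.VanGeemen1994 (hodgeClassSpan)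
open Literature.Barriers.HodgeConjecture (divisorClassesSpan)
open _root_.CategoryTheory _root_.CategoryTheory.Limits

variable {K : Type} [Field K] [NumberField K] [IsCMField K] [IsAbelianGalois ℚ K] {p q : ℕ}
  {Φ : CMType K} {A : AbelianVariety ℂ} {ι : 𝓞 K →+* End A} {θ : K →+* Module.End ℂ (complexBetti A.X 1)}

/-- `Bᵐ ⊗ ℂ = Dᵐ ⊗ ℂ` for all `m` on an abelian variety gives the Hodge conjecture for it (Lefschetz `(1,1)`, cup products, tree theorems).
[cite: Gordon1999HodgeAVSurvey, §9.3] -/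
private theorem hodgeConjectureFor_of_forall_hodgeClassSpan_eq_fpq (B : AbelianVariety ℂ)
    (h : ∀ m : ℕ, hodgeClassSpan B.dim B.X m = divisorClassesSpan B.X B.dim m) : HodgeConjectureFor B.dim B.X :=
  ⟨nonempty_hodgeModel_holds (Motives.AbelianVariety.isSmoothProjective_holds (A := B)),
    fun m _ hc hmm ↦ AbelianVariety.divisorClassesSpan_le_algebraicClasses B
      (fun b hb hb' ↦ lefschetzOneOne_rational_holds (Motives.AbelianVariety.isSmoothProjective_holds (A := B)) b hb hb') m
      ((h m) ▸ Submodule.subset_span ⟨hc, hmm⟩)⟩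

/-- **`B•(Aⁿ) ⊗ ℂ = D•(Aⁿ) ⊗ ℂ` FOR EVERY REALISATION OF A TYPE OFF THE EIGHT LISTS** (abelian CM field with `g^{4pq} = 1` on `Gal`): such a `Φ` is
nondegenerate, so for every abelian variety `(A, ι, θ)` of type `(K; Φ)` and all `n, m` the Hodge classes of `Aⁿ` in degree `2m` are spanned by products
of divisor classes (Hazama's criterion ∕ Pohlmann, tree `IsNondegenerate.hodgeClassSpan_pow_eq_divisorClassesSpan`). [cite: Kubota1965, §4 Lemma 2]
[cite: Gordon1999HodgeAVSurvey, Thm. 6.4 and §9.3] [cite: Hazama2003CyclicCM, Prop. 4.3 and Thm. 4.8] -/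
theorem hodgeClassSpan_pow_eq_divisorClassesSpan_of_forall_intermediateField [Fact p.Prime] [Fact q.Prime] (hpq : p ≠ q)
    (hp2 : p ≠ 2) (hq2 : q ≠ 2) (hexp : ∀ g : K ≃ₐ[ℚ] K, g ^ (4 * (p * q)) = 1)
    (hW : ∀ F : IntermediateField ℚ K, Module.finrank ℚ F = 2 → ¬ IsTotallyReal F →
        ¬ ∀ τ : F →+* ℂ, {φ : K →+* ℂ | φ.comp (algebraMap F K) = τ ∧ φ ∈ Φ.1}.ncard =
          {φ : K →+* ℂ | φ.comp (algebraMap F K) = τ ∧ φ ∉ Φ.1}.ncard)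
    (hQ : ∀ F : IntermediateField ℚ K, Module.finrank ℚ F = 4 → ¬ IsTotallyReal F → IsCyclic (F ≃ₐ[ℚ] F) →
        ¬ ∀ τ : F →+* ℂ, 2 * {φ : K →+* ℂ | φ.comp (algebraMap F K) = τ ∧ φ ∈ Φ.1}.ncard = Module.finrank F K)
    (hLp : ∀ F : IntermediateField ℚ K, Module.finrank ℚ F = 2 * p → ¬ IsTotallyReal F →
        ¬ ∀ σ : F ≃ₐ[ℚ] F, σ ^ p = 1 → ∀ τ : F →+* ℂ,
          {φ : K →+* ℂ | φ.comp (algebraMap F K) = τ.comp σ.toRingEquiv.toRingHom ∧ φ ∈ Φ.1}.ncard =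
            {φ : K →+* ℂ | φ.comp (algebraMap F K) = τ ∧ φ ∈ Φ.1}.ncard)
    (hLp4 : ∀ F : IntermediateField ℚ K, Module.finrank ℚ F = 4 * p → ¬ IsTotallyReal F → IsCyclic (F ≃ₐ[ℚ] F) →
        ¬ ∀ σ : F ≃ₐ[ℚ] F, σ ^ p = 1 → ∀ τ : F →+* ℂ,
          {φ : K →+* ℂ | φ.comp (algebraMap F K) = τ.comp σ.toRingEquiv.toRingHom ∧ φ ∈ Φ.1}.ncard =
            {φ : K →+* ℂ | φ.comp (algebraMap F K) = τ ∧ φ ∈ Φ.1}.ncard)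
    (hLq : ∀ F : IntermediateField ℚ K, Module.finrank ℚ F = 2 * q → ¬ IsTotallyReal F →
        ¬ ∀ σ : F ≃ₐ[ℚ] F, σ ^ q = 1 → ∀ τ : F →+* ℂ,
          {φ : K →+* ℂ | φ.comp (algebraMap F K) = τ.comp σ.toRingEquiv.toRingHom ∧ φ ∈ Φ.1}.ncard =
            {φ : K →+* ℂ | φ.comp (algebraMap F K) = τ ∧ φ ∈ Φ.1}.ncard)
    (hLq4 : ∀ F : IntermediateField ℚ K, Module.finrank ℚ F = 4 * q → ¬ IsTotallyReal F → IsCyclic (F ≃ₐ[ℚ] F) →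
        ¬ ∀ σ : F ≃ₐ[ℚ] F, σ ^ q = 1 → ∀ τ : F →+* ℂ,
          {φ : K →+* ℂ | φ.comp (algebraMap F K) = τ.comp σ.toRingEquiv.toRingHom ∧ φ ∈ Φ.1}.ncard =
            {φ : K →+* ℂ | φ.comp (algebraMap F K) = τ ∧ φ ∈ Φ.1}.ncard)
    (hS : ∀ F : IntermediateField ℚ K, Module.finrank ℚ F = 2 * (p * q) → ¬ IsTotallyReal F →
        ¬ ∀ σ σ' : F ≃ₐ[ℚ] F, σ ^ p = 1 → σ' ^ q = 1 → ∀ τ : F →+* ℂ,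
          {φ : K →+* ℂ | φ.comp (algebraMap F K) = τ ∧ φ ∈ Φ.1}.ncard +
              {φ : K →+* ℂ | φ.comp (algebraMap F K) = τ.comp (σ * σ').toRingEquiv.toRingHom ∧ φ ∈ Φ.1}.ncard =
            {φ : K →+* ℂ | φ.comp (algebraMap F K) = τ.comp σ.toRingEquiv.toRingHom ∧ φ ∈ Φ.1}.ncard +
              {φ : K →+* ℂ | φ.comp (algebraMap F K) = τ.comp σ'.toRingEquiv.toRingHom ∧ φ ∈ Φ.1}.ncard)
    (hS4 : ∀ F : IntermediateField ℚ K, Module.finrank ℚ F = 4 * (p * q) → ¬ IsTotallyReal F → IsCyclic (F ≃ₐ[ℚ] F) →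
        ¬ ∀ σ σ' : F ≃ₐ[ℚ] F, σ ^ p = 1 → σ' ^ q = 1 → ∀ τ : F →+* ℂ,
          {φ : K →+* ℂ | φ.comp (algebraMap F K) = τ ∧ φ ∈ Φ.1}.ncard +
              {φ : K →+* ℂ | φ.comp (algebraMap F K) = τ.comp (σ * σ').toRingEquiv.toRingHom ∧ φ ∈ Φ.1}.ncard =
            {φ : K →+* ℂ | φ.comp (algebraMap F K) = τ.comp σ.toRingEquiv.toRingHom ∧ φ ∈ Φ.1}.ncard +
              {φ : K →+* ℂ | φ.comp (algebraMap F K) = τ.comp σ'.toRingEquiv.toRingHom ∧ φ ∈ Φ.1}.ncard)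
    (hA : IsCMTypeRealisation Φ A ι θ) (n m : ℕ) :
    hodgeClassSpan (⨁ fun _ : Fin n => A).dim (⨁ fun _ : Fin n => A).X m =
      divisorClassesSpan (⨁ fun _ : Fin n => A).X (⨁ fun _ : Fin n => A).dim m :=
  ((isNondegenerate_iff_forall_intermediateField hpq hp2 hq2 hexp Φ).2
    ⟨hW, hQ, hLp, hLp4, hLq, hLq4, hS, hS4⟩).hodgeClassSpan_pow_eq_divisorClassesSpan hA n m

/-- **THE HODGE CONJECTURE FOR ALL POWERS OF EVERY REALISATION OF A TYPE OFF THE EIGHT LISTS** (abelian CM field with `g^{4pq} = 1` on `Gal`) —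
UNCONDITIONAL, any realisation. [cite: Gordon1999HodgeAVSurvey, Thm. 6.4 and §9.3] [cite: Kubota1965, §4 Lemma 2] [cite: Deligne2000, §1] -/
theorem hodgeConjectureFor_pow_of_forall_intermediateField [Fact p.Prime] [Fact q.Prime] (hpq : p ≠ q) (hp2 : p ≠ 2) (hq2 : q ≠ 2)
    (hexp : ∀ g : K ≃ₐ[ℚ] K, g ^ (4 * (p * q)) = 1)
    (hW : ∀ F : IntermediateField ℚ K, Module.finrank ℚ F = 2 → ¬ IsTotallyReal F →
        ¬ ∀ τ : F →+* ℂ, {φ : K →+* ℂ | φ.comp (algebraMap F K) = τ ∧ φ ∈ Φ.1}.ncard =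
          {φ : K →+* ℂ | φ.comp (algebraMap F K) = τ ∧ φ ∉ Φ.1}.ncard)
    (hQ : ∀ F : IntermediateField ℚ K, Module.finrank ℚ F = 4 → ¬ IsTotallyReal F → IsCyclic (F ≃ₐ[ℚ] F) →
        ¬ ∀ τ : F →+* ℂ, 2 * {φ : K →+* ℂ | φ.comp (algebraMap F K) = τ ∧ φ ∈ Φ.1}.ncard = Module.finrank F K)
    (hLp : ∀ F : IntermediateField ℚ K, Module.finrank ℚ F = 2 * p → ¬ IsTotallyReal F →
        ¬ ∀ σ : F ≃ₐ[ℚ] F, σ ^ p = 1 → ∀ τ : F →+* ℂ,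
          {φ : K →+* ℂ | φ.comp (algebraMap F K) = τ.comp σ.toRingEquiv.toRingHom ∧ φ ∈ Φ.1}.ncard =
            {φ : K →+* ℂ | φ.comp (algebraMap F K) = τ ∧ φ ∈ Φ.1}.ncard)
    (hLp4 : ∀ F : IntermediateField ℚ K, Module.finrank ℚ F = 4 * p → ¬ IsTotallyReal F → IsCyclic (F ≃ₐ[ℚ] F) →
        ¬ ∀ σ : F ≃ₐ[ℚ] F, σ ^ p = 1 → ∀ τ : F →+* ℂ,
          {φ : K →+* ℂ | φ.comp (algebraMap F K) = τ.comp σ.toRingEquiv.toRingHom ∧ φ ∈ Φ.1}.ncard =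
            {φ : K →+* ℂ | φ.comp (algebraMap F K) = τ ∧ φ ∈ Φ.1}.ncard)
    (hLq : ∀ F : IntermediateField ℚ K, Module.finrank ℚ F = 2 * q → ¬ IsTotallyReal F →
        ¬ ∀ σ : F ≃ₐ[ℚ] F, σ ^ q = 1 → ∀ τ : F →+* ℂ,
          {φ : K →+* ℂ | φ.comp (algebraMap F K) = τ.comp σ.toRingEquiv.toRingHom ∧ φ ∈ Φ.1}.ncard =
            {φ : K →+* ℂ | φ.comp (algebraMap F K) = τ ∧ φ ∈ Φ.1}.ncard)
    (hLq4 : ∀ F : IntermediateField ℚ K, Module.finrank ℚ F = 4 * q → ¬ IsTotallyReal F → IsCyclic (F ≃ₐ[ℚ] F) →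
        ¬ ∀ σ : F ≃ₐ[ℚ] F, σ ^ q = 1 → ∀ τ : F →+* ℂ,
          {φ : K →+* ℂ | φ.comp (algebraMap F K) = τ.comp σ.toRingEquiv.toRingHom ∧ φ ∈ Φ.1}.ncard =
            {φ : K →+* ℂ | φ.comp (algebraMap F K) = τ ∧ φ ∈ Φ.1}.ncard)
    (hS : ∀ F : IntermediateField ℚ K, Module.finrank ℚ F = 2 * (p * q) → ¬ IsTotallyReal F →
        ¬ ∀ σ σ' : F ≃ₐ[ℚ] F, σ ^ p = 1 → σ' ^ q = 1 → ∀ τ : F →+* ℂ,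
          {φ : K →+* ℂ | φ.comp (algebraMap F K) = τ ∧ φ ∈ Φ.1}.ncard +
              {φ : K →+* ℂ | φ.comp (algebraMap F K) = τ.comp (σ * σ').toRingEquiv.toRingHom ∧ φ ∈ Φ.1}.ncard =
            {φ : K →+* ℂ | φ.comp (algebraMap F K) = τ.comp σ.toRingEquiv.toRingHom ∧ φ ∈ Φ.1}.ncard +
              {φ : K →+* ℂ | φ.comp (algebraMap F K) = τ.comp σ'.toRingEquiv.toRingHom ∧ φ ∈ Φ.1}.ncard)
    (hS4 : ∀ F : IntermediateField ℚ K, Module.finrank ℚ F = 4 * (p * q) → ¬ IsTotallyReal F → IsCyclic (F ≃ₐ[ℚ] F) →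
        ¬ ∀ σ σ' : F ≃ₐ[ℚ] F, σ ^ p = 1 → σ' ^ q = 1 → ∀ τ : F →+* ℂ,
          {φ : K →+* ℂ | φ.comp (algebraMap F K) = τ ∧ φ ∈ Φ.1}.ncard +
              {φ : K →+* ℂ | φ.comp (algebraMap F K) = τ.comp (σ * σ').toRingEquiv.toRingHom ∧ φ ∈ Φ.1}.ncard =
            {φ : K →+* ℂ | φ.comp (algebraMap F K) = τ.comp σ.toRingEquiv.toRingHom ∧ φ ∈ Φ.1}.ncard +
              {φ : K →+* ℂ | φ.comp (algebraMap F K) = τ.comp σ'.toRingEquiv.toRingHom ∧ φ ∈ Φ.1}.ncard)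
    (hA : IsCMTypeRealisation Φ A ι θ) (n : ℕ) :
    HodgeConjectureFor (⨁ fun _ : Fin n => A).dim (⨁ fun _ : Fin n => A).X :=
  hodgeConjectureFor_of_forall_hodgeClassSpan_eq_fpq _
    fun m ↦ hodgeClassSpan_pow_eq_divisorClassesSpan_of_forall_intermediateField hpq hp2 hq2 hexp hW hQ hLp hLp4 hLq hLq4 hS hS4 hA n m

/-- **No power of such an `A` carries an exceptional Hodge class** (a rational `(m,m)`-class outside `Dᵐ ⊗ ℂ`). [cite: Gordon1999HodgeAVSurvey, Thm. 6.4] -/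
theorem not_exists_exceptional_pow_of_forall_intermediateField [Fact p.Prime] [Fact q.Prime] (hpq : p ≠ q) (hp2 : p ≠ 2) (hq2 : q ≠ 2)
    (hexp : ∀ g : K ≃ₐ[ℚ] K, g ^ (4 * (p * q)) = 1)
    (hW : ∀ F : IntermediateField ℚ K, Module.finrank ℚ F = 2 → ¬ IsTotallyReal F →
        ¬ ∀ τ : F →+* ℂ, {φ : K →+* ℂ | φ.comp (algebraMap F K) = τ ∧ φ ∈ Φ.1}.ncard =
          {φ : K →+* ℂ | φ.comp (algebraMap F K) = τ ∧ φ ∉ Φ.1}.ncard)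
    (hQ : ∀ F : IntermediateField ℚ K, Module.finrank ℚ F = 4 → ¬ IsTotallyReal F → IsCyclic (F ≃ₐ[ℚ] F) →
        ¬ ∀ τ : F →+* ℂ, 2 * {φ : K →+* ℂ | φ.comp (algebraMap F K) = τ ∧ φ ∈ Φ.1}.ncard = Module.finrank F K)
    (hLp : ∀ F : IntermediateField ℚ K, Module.finrank ℚ F = 2 * p → ¬ IsTotallyReal F →
        ¬ ∀ σ : F ≃ₐ[ℚ] F, σ ^ p = 1 → ∀ τ : F →+* ℂ,
          {φ : K →+* ℂ | φ.comp (algebraMap F K) = τ.comp σ.toRingEquiv.toRingHom ∧ φ ∈ Φ.1}.ncard =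
            {φ : K →+* ℂ | φ.comp (algebraMap F K) = τ ∧ φ ∈ Φ.1}.ncard)
    (hLp4 : ∀ F : IntermediateField ℚ K, Module.finrank ℚ F = 4 * p → ¬ IsTotallyReal F → IsCyclic (F ≃ₐ[ℚ] F) →
        ¬ ∀ σ : F ≃ₐ[ℚ] F, σ ^ p = 1 → ∀ τ : F →+* ℂ,
          {φ : K →+* ℂ | φ.comp (algebraMap F K) = τ.comp σ.toRingEquiv.toRingHom ∧ φ ∈ Φ.1}.ncard =
            {φ : K →+* ℂ | φ.comp (algebraMap F K) = τ ∧ φ ∈ Φ.1}.ncard)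
    (hLq : ∀ F : IntermediateField ℚ K, Module.finrank ℚ F = 2 * q → ¬ IsTotallyReal F →
        ¬ ∀ σ : F ≃ₐ[ℚ] F, σ ^ q = 1 → ∀ τ : F →+* ℂ,
          {φ : K →+* ℂ | φ.comp (algebraMap F K) = τ.comp σ.toRingEquiv.toRingHom ∧ φ ∈ Φ.1}.ncard =
            {φ : K →+* ℂ | φ.comp (algebraMap F K) = τ ∧ φ ∈ Φ.1}.ncard)
    (hLq4 : ∀ F : IntermediateField ℚ K, Module.finrank ℚ F = 4 * q → ¬ IsTotallyReal F → IsCyclic (F ≃ₐ[ℚ] F) →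
        ¬ ∀ σ : F ≃ₐ[ℚ] F, σ ^ q = 1 → ∀ τ : F →+* ℂ,
          {φ : K →+* ℂ | φ.comp (algebraMap F K) = τ.comp σ.toRingEquiv.toRingHom ∧ φ ∈ Φ.1}.ncard =
            {φ : K →+* ℂ | φ.comp (algebraMap F K) = τ ∧ φ ∈ Φ.1}.ncard)
    (hS : ∀ F : IntermediateField ℚ K, Module.finrank ℚ F = 2 * (p * q) → ¬ IsTotallyReal F →
        ¬ ∀ σ σ' : F ≃ₐ[ℚ] F, σ ^ p = 1 → σ' ^ q = 1 → ∀ τ : F →+* ℂ,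
          {φ : K →+* ℂ | φ.comp (algebraMap F K) = τ ∧ φ ∈ Φ.1}.ncard +
              {φ : K →+* ℂ | φ.comp (algebraMap F K) = τ.comp (σ * σ').toRingEquiv.toRingHom ∧ φ ∈ Φ.1}.ncard =
            {φ : K →+* ℂ | φ.comp (algebraMap F K) = τ.comp σ.toRingEquiv.toRingHom ∧ φ ∈ Φ.1}.ncard +
              {φ : K →+* ℂ | φ.comp (algebraMap F K) = τ.comp σ'.toRingEquiv.toRingHom ∧ φ ∈ Φ.1}.ncard)
    (hS4 : ∀ F : IntermediateField ℚ K, Module.finrank ℚ F = 4 * (p * q) → ¬ IsTotallyReal F → IsCyclic (F ≃ₐ[ℚ] F) →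
        ¬ ∀ σ σ' : F ≃ₐ[ℚ] F, σ ^ p = 1 → σ' ^ q = 1 → ∀ τ : F →+* ℂ,
          {φ : K →+* ℂ | φ.comp (algebraMap F K) = τ ∧ φ ∈ Φ.1}.ncard +
              {φ : K →+* ℂ | φ.comp (algebraMap F K) = τ.comp (σ * σ').toRingEquiv.toRingHom ∧ φ ∈ Φ.1}.ncard =
            {φ : K →+* ℂ | φ.comp (algebraMap F K) = τ.comp σ.toRingEquiv.toRingHom ∧ φ ∈ Φ.1}.ncard +
              {φ : K →+* ℂ | φ.comp (algebraMap F K) = τ.comp σ'.toRingEquiv.toRingHom ∧ φ ∈ Φ.1}.ncard)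
    (hA : IsCMTypeRealisation Φ A ι θ) (n m : ℕ) :
    ¬ ∃ c : complexBetti (⨁ fun _ : Fin n => A).X (2 * m), IsRationalClass c ∧
        IsOfHodgeType (⨁ fun _ : Fin n => A).dim (⨁ fun _ : Fin n => A).X (2 * m) m m c ∧
        c ∉ divisorClassesSpan (⨁ fun _ : Fin n => A).X (⨁ fun _ : Fin n => A).dim m := by
  rintro ⟨c, hcQ, hcH, hcD⟩
  exact hcD ((hodgeClassSpan_pow_eq_divisorClassesSpan_of_forall_intermediateField hpq hp2 hq2 hexp hW hQ hLp hLp4 hLq hLq4 hS hS4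
    hA n m) ▸ Submodule.subset_span ⟨hcQ, hcH⟩)

end Varieties

/-! ## §4 The cyclotomic fields `ℚ(ζ_N)` with `(ℤ/N)ˣ` of exponent `4pq`: `N = 61` (`φ = 60`) and `143, 155, 175, 183, 225, 244` (`φ = 120`), exponent `60` -/

section Cyclotomic

open Literature.AlgebraicGeometry.Motives (AbelianVariety)
open Literature.AlgebraicGeometry.HodgeTheory
open Literature.AlgebraicGeometry.ComplexMultiplication (IsCMTypeRealisation)
open Literature.AlgebraicGeometry.VanGeemen1994 (hodgeClassSpan)
open Literature.Barriers.HodgeConjecture (divisorClassesSpan)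
open _root_.CategoryTheory _root_.CategoryTheory.Limits
open Polynomial

variable {N p q : ℕ} {L : Type} [Field L] [NumberField L]
  {Φ : CMType L} {A : AbelianVariety ℂ} {ι : 𝓞 L →+* End A} {θ : L →+* Module.End ℂ (complexBetti A.X 1)}

/-- **The rank formula for `ℚ(ζ_N)`, `(ℤ/N)ˣ` of exponent `4pq`.** [cite: Kubota1965, §4 Lemma 2] [cite: Hazama2003CyclicCM, Prop. 4.3 and Thm. 4.8]
[cite: Dodson1984, §3.1.1 Theorem] [cite: Washington1997, Ch. 2 Thm. 2.5] -/
theorem cmTypeRank_add_ncard_subfields_eq_of_isCyclotomicExtension [NeZero N] [IsCyclotomicExtension {N} ℚ L]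
    (h2N : 2 < N) [Fact p.Prime] [Fact q.Prime] (hpq : p ≠ q) (hp2 : p ≠ 2) (hq2 : q ≠ 2)
    (hN : ∀ u : (ZMod N)ˣ, u ^ (4 * (p * q)) = 1) (Φ : CMType L) :
    cmTypeRank Φ + {F : IntermediateField ℚ L | Module.finrank ℚ F = 2 ∧ ¬ IsTotallyReal F ∧
        ∀ τ : F →+* ℂ, {φ : L →+* ℂ | φ.comp (algebraMap F L) = τ ∧ φ ∈ Φ.1}.ncard =
          {φ : L →+* ℂ | φ.comp (algebraMap F L) = τ ∧ φ ∉ Φ.1}.ncard}.ncard +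
      2 * {F : IntermediateField ℚ L | Module.finrank ℚ F = 4 ∧ ¬ IsTotallyReal F ∧ IsCyclic (F ≃ₐ[ℚ] F) ∧
        ∀ τ : F →+* ℂ, 2 * {φ : L →+* ℂ | φ.comp (algebraMap F L) = τ ∧ φ ∈ Φ.1}.ncard = Module.finrank F L}.ncard +
      (p - 1) * {F : IntermediateField ℚ L | Module.finrank ℚ F = 2 * p ∧ ¬ IsTotallyReal F ∧
        ∀ σ : F ≃ₐ[ℚ] F, σ ^ p = 1 → ∀ τ : F →+* ℂ,
          {φ : L →+* ℂ | φ.comp (algebraMap F L) = τ.comp σ.toRingEquiv.toRingHom ∧ φ ∈ Φ.1}.ncard =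
            {φ : L →+* ℂ | φ.comp (algebraMap F L) = τ ∧ φ ∈ Φ.1}.ncard}.ncard +
      2 * (p - 1) * {F : IntermediateField ℚ L | Module.finrank ℚ F = 4 * p ∧ ¬ IsTotallyReal F ∧ IsCyclic (F ≃ₐ[ℚ] F) ∧
        ∀ σ : F ≃ₐ[ℚ] F, σ ^ p = 1 → ∀ τ : F →+* ℂ,
          {φ : L →+* ℂ | φ.comp (algebraMap F L) = τ.comp σ.toRingEquiv.toRingHom ∧ φ ∈ Φ.1}.ncard =
            {φ : L →+* ℂ | φ.comp (algebraMap F L) = τ ∧ φ ∈ Φ.1}.ncard}.ncard +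
      (q - 1) * {F : IntermediateField ℚ L | Module.finrank ℚ F = 2 * q ∧ ¬ IsTotallyReal F ∧
        ∀ σ : F ≃ₐ[ℚ] F, σ ^ q = 1 → ∀ τ : F →+* ℂ,
          {φ : L →+* ℂ | φ.comp (algebraMap F L) = τ.comp σ.toRingEquiv.toRingHom ∧ φ ∈ Φ.1}.ncard =
            {φ : L →+* ℂ | φ.comp (algebraMap F L) = τ ∧ φ ∈ Φ.1}.ncard}.ncard +
      2 * (q - 1) * {F : IntermediateField ℚ L | Module.finrank ℚ F = 4 * q ∧ ¬ IsTotallyReal F ∧ IsCyclic (F ≃ₐ[ℚ] F) ∧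
        ∀ σ : F ≃ₐ[ℚ] F, σ ^ q = 1 → ∀ τ : F →+* ℂ,
          {φ : L →+* ℂ | φ.comp (algebraMap F L) = τ.comp σ.toRingEquiv.toRingHom ∧ φ ∈ Φ.1}.ncard =
            {φ : L →+* ℂ | φ.comp (algebraMap F L) = τ ∧ φ ∈ Φ.1}.ncard}.ncard +
      (p - 1) * (q - 1) * {F : IntermediateField ℚ L | Module.finrank ℚ F = 2 * (p * q) ∧ ¬ IsTotallyReal F ∧
        ∀ σ σ' : F ≃ₐ[ℚ] F, σ ^ p = 1 → σ' ^ q = 1 → ∀ τ : F →+* ℂ,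
          {φ : L →+* ℂ | φ.comp (algebraMap F L) = τ ∧ φ ∈ Φ.1}.ncard +
              {φ : L →+* ℂ | φ.comp (algebraMap F L) = τ.comp (σ * σ').toRingEquiv.toRingHom ∧ φ ∈ Φ.1}.ncard =
            {φ : L →+* ℂ | φ.comp (algebraMap F L) = τ.comp σ.toRingEquiv.toRingHom ∧ φ ∈ Φ.1}.ncard +
              {φ : L →+* ℂ | φ.comp (algebraMap F L) = τ.comp σ'.toRingEquiv.toRingHom ∧ φ ∈ Φ.1}.ncard}.ncard +
      2 * ((p - 1) * (q - 1)) * {F : IntermediateField ℚ L | Module.finrank ℚ F = 4 * (p * q) ∧ ¬ IsTotallyReal F ∧ IsCyclic (F ≃ₐ[ℚ] F) ∧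
        ∀ σ σ' : F ≃ₐ[ℚ] F, σ ^ p = 1 → σ' ^ q = 1 → ∀ τ : F →+* ℂ,
          {φ : L →+* ℂ | φ.comp (algebraMap F L) = τ ∧ φ ∈ Φ.1}.ncard +
              {φ : L →+* ℂ | φ.comp (algebraMap F L) = τ.comp (σ * σ').toRingEquiv.toRingHom ∧ φ ∈ Φ.1}.ncard =
            {φ : L →+* ℂ | φ.comp (algebraMap F L) = τ.comp σ.toRingEquiv.toRingHom ∧ φ ∈ Φ.1}.ncard +
              {φ : L →+* ℂ | φ.comp (algebraMap F L) = τ.comp σ'.toRingEquiv.toRingHom ∧ φ ∈ Φ.1}.ncard}.ncard = Nat.totient N / 2 + 1 := by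
  obtain ⟨hcm, hab, hexp, hL⟩ := cm_abelian_pow_eq_one_of_isCyclotomicExtension h2N hN L
  haveI := hcm; haveI := hab
  rw [← hL]
  exact cmTypeRank_add_ncard_subfields_eq hpq hp2 hq2 hexp Φ

/-- **Nondegeneracy criterion for `ℚ(ζ_N)`, `(ℤ/N)ˣ` of exponent `4pq`.** [cite: Kubota1965, §4 Lemma 2] [cite: Hazama2003CyclicCM, Prop. 4.3 and Thm. 4.8]
[cite: Dodson1984, §3.1.1 Theorem] -/
theorem isNondegenerate_iff_of_isCyclotomicExtension [NeZero N] [IsCyclotomicExtension {N} ℚ L]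
    (h2N : 2 < N) [Fact p.Prime] [Fact q.Prime] (hpq : p ≠ q) (hp2 : p ≠ 2) (hq2 : q ≠ 2)
    (hN : ∀ u : (ZMod N)ˣ, u ^ (4 * (p * q)) = 1) (Φ : CMType L) :
    IsNondegenerate Φ ↔
      (∀ F : IntermediateField ℚ L, Module.finrank ℚ F = 2 → ¬ IsTotallyReal F →
        ¬ ∀ τ : F →+* ℂ, {φ : L →+* ℂ | φ.comp (algebraMap F L) = τ ∧ φ ∈ Φ.1}.ncard =
          {φ : L →+* ℂ | φ.comp (algebraMap F L) = τ ∧ φ ∉ Φ.1}.ncard) ∧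
      (∀ F : IntermediateField ℚ L, Module.finrank ℚ F = 4 → ¬ IsTotallyReal F → IsCyclic (F ≃ₐ[ℚ] F) →
        ¬ ∀ τ : F →+* ℂ, 2 * {φ : L →+* ℂ | φ.comp (algebraMap F L) = τ ∧ φ ∈ Φ.1}.ncard = Module.finrank F L) ∧
      (∀ F : IntermediateField ℚ L, Module.finrank ℚ F = 2 * p → ¬ IsTotallyReal F →
        ¬ ∀ σ : F ≃ₐ[ℚ] F, σ ^ p = 1 → ∀ τ : F →+* ℂ,
          {φ : L →+* ℂ | φ.comp (algebraMap F L) = τ.comp σ.toRingEquiv.toRingHom ∧ φ ∈ Φ.1}.ncard =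
            {φ : L →+* ℂ | φ.comp (algebraMap F L) = τ ∧ φ ∈ Φ.1}.ncard) ∧
      (∀ F : IntermediateField ℚ L, Module.finrank ℚ F = 4 * p → ¬ IsTotallyReal F → IsCyclic (F ≃ₐ[ℚ] F) →
        ¬ ∀ σ : F ≃ₐ[ℚ] F, σ ^ p = 1 → ∀ τ : F →+* ℂ,
          {φ : L →+* ℂ | φ.comp (algebraMap F L) = τ.comp σ.toRingEquiv.toRingHom ∧ φ ∈ Φ.1}.ncard =
            {φ : L →+* ℂ | φ.comp (algebraMap F L) = τ ∧ φ ∈ Φ.1}.ncard) ∧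
      (∀ F : IntermediateField ℚ L, Module.finrank ℚ F = 2 * q → ¬ IsTotallyReal F →
        ¬ ∀ σ : F ≃ₐ[ℚ] F, σ ^ q = 1 → ∀ τ : F →+* ℂ,
          {φ : L →+* ℂ | φ.comp (algebraMap F L) = τ.comp σ.toRingEquiv.toRingHom ∧ φ ∈ Φ.1}.ncard =
            {φ : L →+* ℂ | φ.comp (algebraMap F L) = τ ∧ φ ∈ Φ.1}.ncard) ∧
      (∀ F : IntermediateField ℚ L, Module.finrank ℚ F = 4 * q → ¬ IsTotallyReal F → IsCyclic (F ≃ₐ[ℚ] F) →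
        ¬ ∀ σ : F ≃ₐ[ℚ] F, σ ^ q = 1 → ∀ τ : F →+* ℂ,
          {φ : L →+* ℂ | φ.comp (algebraMap F L) = τ.comp σ.toRingEquiv.toRingHom ∧ φ ∈ Φ.1}.ncard =
            {φ : L →+* ℂ | φ.comp (algebraMap F L) = τ ∧ φ ∈ Φ.1}.ncard) ∧
      (∀ F : IntermediateField ℚ L, Module.finrank ℚ F = 2 * (p * q) → ¬ IsTotallyReal F →
        ¬ ∀ σ σ' : F ≃ₐ[ℚ] F, σ ^ p = 1 → σ' ^ q = 1 → ∀ τ : F →+* ℂ,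
          {φ : L →+* ℂ | φ.comp (algebraMap F L) = τ ∧ φ ∈ Φ.1}.ncard +
              {φ : L →+* ℂ | φ.comp (algebraMap F L) = τ.comp (σ * σ').toRingEquiv.toRingHom ∧ φ ∈ Φ.1}.ncard =
            {φ : L →+* ℂ | φ.comp (algebraMap F L) = τ.comp σ.toRingEquiv.toRingHom ∧ φ ∈ Φ.1}.ncard +
              {φ : L →+* ℂ | φ.comp (algebraMap F L) = τ.comp σ'.toRingEquiv.toRingHom ∧ φ ∈ Φ.1}.ncard) ∧
      (∀ F : IntermediateField ℚ L, Module.finrank ℚ F = 4 * (p * q) → ¬ IsTotallyReal F → IsCyclic (F ≃ₐ[ℚ] F) →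
        ¬ ∀ σ σ' : F ≃ₐ[ℚ] F, σ ^ p = 1 → σ' ^ q = 1 → ∀ τ : F →+* ℂ,
          {φ : L →+* ℂ | φ.comp (algebraMap F L) = τ ∧ φ ∈ Φ.1}.ncard +
              {φ : L →+* ℂ | φ.comp (algebraMap F L) = τ.comp (σ * σ').toRingEquiv.toRingHom ∧ φ ∈ Φ.1}.ncard =
            {φ : L →+* ℂ | φ.comp (algebraMap F L) = τ.comp σ.toRingEquiv.toRingHom ∧ φ ∈ Φ.1}.ncard +
              {φ : L →+* ℂ | φ.comp (algebraMap F L) = τ.comp σ'.toRingEquiv.toRingHom ∧ φ ∈ Φ.1}.ncard) := by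
  obtain ⟨hcm, hab, hexp, -⟩ := cm_abelian_pow_eq_one_of_isCyclotomicExtension h2N hN L
  haveI := hcm; haveI := hab
  exact isNondegenerate_iff_forall_intermediateField hpq hp2 hq2 hexp Φ

/-- **The Hodge conjecture for all powers of every realisation of a type of `ℚ(ζ_N)`** (`(ℤ/N)ˣ` of exponent `4pq`) **off the eight lists** —
UNCONDITIONAL. [cite: Gordon1999HodgeAVSurvey, Thm. 6.4 and §9.3] [cite: Kubota1965, §4 Lemma 2] -/
theorem hodgeConjectureFor_pow_of_forall_of_isCyclotomicExtension [NeZero N] [IsCyclotomicExtension {N} ℚ L]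
    (h2N : 2 < N) [Fact p.Prime] [Fact q.Prime] (hpq : p ≠ q) (hp2 : p ≠ 2) (hq2 : q ≠ 2)
    (hN : ∀ u : (ZMod N)ˣ, u ^ (4 * (p * q)) = 1)
    (hW : ∀ F : IntermediateField ℚ L, Module.finrank ℚ F = 2 → ¬ IsTotallyReal F →
        ¬ ∀ τ : F →+* ℂ, {φ : L →+* ℂ | φ.comp (algebraMap F L) = τ ∧ φ ∈ Φ.1}.ncard =
          {φ : L →+* ℂ | φ.comp (algebraMap F L) = τ ∧ φ ∉ Φ.1}.ncard)
    (hQ : ∀ F : IntermediateField ℚ L, Module.finrank ℚ F = 4 → ¬ IsTotallyReal F → IsCyclic (F ≃ₐ[ℚ] F) →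
        ¬ ∀ τ : F →+* ℂ, 2 * {φ : L →+* ℂ | φ.comp (algebraMap F L) = τ ∧ φ ∈ Φ.1}.ncard = Module.finrank F L)
    (hLp : ∀ F : IntermediateField ℚ L, Module.finrank ℚ F = 2 * p → ¬ IsTotallyReal F →
        ¬ ∀ σ : F ≃ₐ[ℚ] F, σ ^ p = 1 → ∀ τ : F →+* ℂ,
          {φ : L →+* ℂ | φ.comp (algebraMap F L) = τ.comp σ.toRingEquiv.toRingHom ∧ φ ∈ Φ.1}.ncard =
            {φ : L →+* ℂ | φ.comp (algebraMap F L) = τ ∧ φ ∈ Φ.1}.ncard)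
    (hLp4 : ∀ F : IntermediateField ℚ L, Module.finrank ℚ F = 4 * p → ¬ IsTotallyReal F → IsCyclic (F ≃ₐ[ℚ] F) →
        ¬ ∀ σ : F ≃ₐ[ℚ] F, σ ^ p = 1 → ∀ τ : F →+* ℂ,
          {φ : L →+* ℂ | φ.comp (algebraMap F L) = τ.comp σ.toRingEquiv.toRingHom ∧ φ ∈ Φ.1}.ncard =
            {φ : L →+* ℂ | φ.comp (algebraMap F L) = τ ∧ φ ∈ Φ.1}.ncard)
    (hLq : ∀ F : IntermediateField ℚ L, Module.finrank ℚ F = 2 * q → ¬ IsTotallyReal F →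
        ¬ ∀ σ : F ≃ₐ[ℚ] F, σ ^ q = 1 → ∀ τ : F →+* ℂ,
          {φ : L →+* ℂ | φ.comp (algebraMap F L) = τ.comp σ.toRingEquiv.toRingHom ∧ φ ∈ Φ.1}.ncard =
            {φ : L →+* ℂ | φ.comp (algebraMap F L) = τ ∧ φ ∈ Φ.1}.ncard)
    (hLq4 : ∀ F : IntermediateField ℚ L, Module.finrank ℚ F = 4 * q → ¬ IsTotallyReal F → IsCyclic (F ≃ₐ[ℚ] F) →
        ¬ ∀ σ : F ≃ₐ[ℚ] F, σ ^ q = 1 → ∀ τ : F →+* ℂ,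
          {φ : L →+* ℂ | φ.comp (algebraMap F L) = τ.comp σ.toRingEquiv.toRingHom ∧ φ ∈ Φ.1}.ncard =
            {φ : L →+* ℂ | φ.comp (algebraMap F L) = τ ∧ φ ∈ Φ.1}.ncard)
    (hS : ∀ F : IntermediateField ℚ L, Module.finrank ℚ F = 2 * (p * q) → ¬ IsTotallyReal F →
        ¬ ∀ σ σ' : F ≃ₐ[ℚ] F, σ ^ p = 1 → σ' ^ q = 1 → ∀ τ : F →+* ℂ,
          {φ : L →+* ℂ | φ.comp (algebraMap F L) = τ ∧ φ ∈ Φ.1}.ncard +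
              {φ : L →+* ℂ | φ.comp (algebraMap F L) = τ.comp (σ * σ').toRingEquiv.toRingHom ∧ φ ∈ Φ.1}.ncard =
            {φ : L →+* ℂ | φ.comp (algebraMap F L) = τ.comp σ.toRingEquiv.toRingHom ∧ φ ∈ Φ.1}.ncard +
              {φ : L →+* ℂ | φ.comp (algebraMap F L) = τ.comp σ'.toRingEquiv.toRingHom ∧ φ ∈ Φ.1}.ncard)
    (hS4 : ∀ F : IntermediateField ℚ L, Module.finrank ℚ F = 4 * (p * q) → ¬ IsTotallyReal F → IsCyclic (F ≃ₐ[ℚ] F) →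
        ¬ ∀ σ σ' : F ≃ₐ[ℚ] F, σ ^ p = 1 → σ' ^ q = 1 → ∀ τ : F →+* ℂ,
          {φ : L →+* ℂ | φ.comp (algebraMap F L) = τ ∧ φ ∈ Φ.1}.ncard +
              {φ : L →+* ℂ | φ.comp (algebraMap F L) = τ.comp (σ * σ').toRingEquiv.toRingHom ∧ φ ∈ Φ.1}.ncard =
            {φ : L →+* ℂ | φ.comp (algebraMap F L) = τ.comp σ.toRingEquiv.toRingHom ∧ φ ∈ Φ.1}.ncard +
              {φ : L →+* ℂ | φ.comp (algebraMap F L) = τ.comp σ'.toRingEquiv.toRingHom ∧ φ ∈ Φ.1}.ncard)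
    (hA : IsCMTypeRealisation Φ A ι θ) (n : ℕ) :
    HodgeConjectureFor (⨁ fun _ : Fin n => A).dim (⨁ fun _ : Fin n => A).X := by
  obtain ⟨hcm, hab, hexp, -⟩ := cm_abelian_pow_eq_one_of_isCyclotomicExtension h2N hN L
  haveI := hcm; haveI := hab
  exact hodgeConjectureFor_pow_of_forall_intermediateField hpq hp2 hq2 hexp hW hQ hLp hLp4 hLq hLq4 hS hS4 hA n

/-! ### The levels of exponent `60 = 4·3·5`: `61` (`φ = 60`) and `143, 155, 175, 183, 225, 244` (`φ = 120`) -/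

/-- `u⁶⁰ = 1` for every unit of `ℤ/61`: `(ℤ/61)ˣ ≅ ℤ/60 (cyclic)` (`61 = 61 prime`; kernel decision on residues coprime to `61`).
[cite: Washington1997, Ch. 2 Thm. 2.5] -/
theorem units_pow_sixty_sixtyOne (u : (ZMod 61)ˣ) : u ^ (4 * (3 * 5)) = 1 := by
  have h : ∀ a : ZMod 61, Nat.Coprime a.val 61 → a ^ 60 = 1 := by decide +kernel
  exact Units.ext (by rw [Units.val_pow_eq_pow_val, h _ (ZMod.val_coe_unit_coprime u), Units.val_one])

/-- **`ℚ(ζ_{61})` (degree `60`, `Gal ≅ ℤ/60 (cyclic)`, exponent `60`): the rank formula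
`Rank(Φ) + b + 2e₄ + 2e₆ + 4e₁₂ + 4e₁₀ + 8e₂₀ + 8s₃₀ + 16s₆₀ = 31`** for every CM type — `b` Weil imaginary quadratic subfields, `e₄` cyclic quartic
CM subfields with half fibres, `e₆, e₁₀` (`e₁₂, e₂₀`, cyclic) CM subfields over which `Φ` is level of exponent `3` resp. `5`, `s₃₀` (`s₆₀`, cyclic) CM
subfields over which `Φ` is additively separable. [cite: Kubota1965, §4 Lemma 2] [cite: Hazama2003CyclicCM, Prop. 4.3 and Thm. 4.8] [cite: Dodson1984, §3.1.1 Theorem] -/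
theorem cmTypeRank_add_ncard_subfields_sixtyOne [IsCyclotomicExtension {61} ℚ L] (Φ : CMType L) :
    cmTypeRank Φ + {F : IntermediateField ℚ L | Module.finrank ℚ F = 2 ∧ ¬ IsTotallyReal F ∧
        ∀ τ : F →+* ℂ, {φ : L →+* ℂ | φ.comp (algebraMap F L) = τ ∧ φ ∈ Φ.1}.ncard =
          {φ : L →+* ℂ | φ.comp (algebraMap F L) = τ ∧ φ ∉ Φ.1}.ncard}.ncard +
      2 * {F : IntermediateField ℚ L | Module.finrank ℚ F = 4 ∧ ¬ IsTotallyReal F ∧ IsCyclic (F ≃ₐ[ℚ] F) ∧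
        ∀ τ : F →+* ℂ, 2 * {φ : L →+* ℂ | φ.comp (algebraMap F L) = τ ∧ φ ∈ Φ.1}.ncard = Module.finrank F L}.ncard +
      2 * {F : IntermediateField ℚ L | Module.finrank ℚ F = 6 ∧ ¬ IsTotallyReal F ∧
        ∀ σ : F ≃ₐ[ℚ] F, σ ^ (3 : ℕ) = AlgEquiv.refl → ∀ τ : F →+* ℂ,
          {φ : L →+* ℂ | φ.comp (algebraMap F L) = τ.comp σ.toRingEquiv.toRingHom ∧ φ ∈ Φ.1}.ncard =
            {φ : L →+* ℂ | φ.comp (algebraMap F L) = τ ∧ φ ∈ Φ.1}.ncard}.ncard +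
      4 * {F : IntermediateField ℚ L | Module.finrank ℚ F = 12 ∧ ¬ IsTotallyReal F ∧ IsCyclic (F ≃ₐ[ℚ] F) ∧
        ∀ σ : F ≃ₐ[ℚ] F, σ ^ (3 : ℕ) = AlgEquiv.refl → ∀ τ : F →+* ℂ,
          {φ : L →+* ℂ | φ.comp (algebraMap F L) = τ.comp σ.toRingEquiv.toRingHom ∧ φ ∈ Φ.1}.ncard =
            {φ : L →+* ℂ | φ.comp (algebraMap F L) = τ ∧ φ ∈ Φ.1}.ncard}.ncard +
      4 * {F : IntermediateField ℚ L | Module.finrank ℚ F = 10 ∧ ¬ IsTotallyReal F ∧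
        ∀ σ : F ≃ₐ[ℚ] F, σ ^ (5 : ℕ) = AlgEquiv.refl → ∀ τ : F →+* ℂ,
          {φ : L →+* ℂ | φ.comp (algebraMap F L) = τ.comp σ.toRingEquiv.toRingHom ∧ φ ∈ Φ.1}.ncard =
            {φ : L →+* ℂ | φ.comp (algebraMap F L) = τ ∧ φ ∈ Φ.1}.ncard}.ncard +
      8 * {F : IntermediateField ℚ L | Module.finrank ℚ F = 20 ∧ ¬ IsTotallyReal F ∧ IsCyclic (F ≃ₐ[ℚ] F) ∧
        ∀ σ : F ≃ₐ[ℚ] F, σ ^ (5 : ℕ) = AlgEquiv.refl → ∀ τ : F →+* ℂ,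
          {φ : L →+* ℂ | φ.comp (algebraMap F L) = τ.comp σ.toRingEquiv.toRingHom ∧ φ ∈ Φ.1}.ncard =
            {φ : L →+* ℂ | φ.comp (algebraMap F L) = τ ∧ φ ∈ Φ.1}.ncard}.ncard +
      8 * {F : IntermediateField ℚ L | Module.finrank ℚ F = 30 ∧ ¬ IsTotallyReal F ∧
        ∀ σ σ' : F ≃ₐ[ℚ] F, σ ^ (3 : ℕ) = AlgEquiv.refl → σ' ^ (5 : ℕ) = AlgEquiv.refl → ∀ τ : F →+* ℂ,
          {φ : L →+* ℂ | φ.comp (algebraMap F L) = τ ∧ φ ∈ Φ.1}.ncard +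
              {φ : L →+* ℂ | φ.comp (algebraMap F L) = τ.comp (σ * σ').toRingEquiv.toRingHom ∧ φ ∈ Φ.1}.ncard =
            {φ : L →+* ℂ | φ.comp (algebraMap F L) = τ.comp σ.toRingEquiv.toRingHom ∧ φ ∈ Φ.1}.ncard +
              {φ : L →+* ℂ | φ.comp (algebraMap F L) = τ.comp σ'.toRingEquiv.toRingHom ∧ φ ∈ Φ.1}.ncard}.ncard +
      16 * {F : IntermediateField ℚ L | Module.finrank ℚ F = 60 ∧ ¬ IsTotallyReal F ∧ IsCyclic (F ≃ₐ[ℚ] F) ∧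
        ∀ σ σ' : F ≃ₐ[ℚ] F, σ ^ (3 : ℕ) = AlgEquiv.refl → σ' ^ (5 : ℕ) = AlgEquiv.refl → ∀ τ : F →+* ℂ,
          {φ : L →+* ℂ | φ.comp (algebraMap F L) = τ ∧ φ ∈ Φ.1}.ncard +
              {φ : L →+* ℂ | φ.comp (algebraMap F L) = τ.comp (σ * σ').toRingEquiv.toRingHom ∧ φ ∈ Φ.1}.ncard =
            {φ : L →+* ℂ | φ.comp (algebraMap F L) = τ.comp σ.toRingEquiv.toRingHom ∧ φ ∈ Φ.1}.ncard +
              {φ : L →+* ℂ | φ.comp (algebraMap F L) = τ.comp σ'.toRingEquiv.toRingHom ∧ φ ∈ Φ.1}.ncard}.ncard = 31 := by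
  haveI : Fact (Nat.Prime 3) := ⟨Nat.prime_three⟩
  haveI : Fact (Nat.Prime 5) := ⟨Nat.prime_five⟩
  have h := cmTypeRank_add_ncard_subfields_eq_of_isCyclotomicExtension (L := L) (N := 61) (by norm_num)
    (by decide : (3 : ℕ) ≠ 5) (by decide : (3 : ℕ) ≠ 2) (by decide : (5 : ℕ) ≠ 2) units_pow_sixty_sixtyOne Φ
  have hN : Nat.totient 61 = 60 := by decide +kernel
  rw [hN] at h
  exact h

/-- **`ℚ(ζ_{61})`: THE HODGE CONJECTURE FOR ALL POWERS of every abelian variety with complex multiplication by `ℚ(ζ_{61})` (CM `30`-folds)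
whose type is off the eight lists** — UNCONDITIONAL. [cite: Gordon1999HodgeAVSurvey, Thm. 6.4 and §9.3] [cite: Kubota1965, §4 Lemma 2] -/
theorem hodgeConjectureFor_pow_of_forall_sixtyOne [IsCyclotomicExtension {61} ℚ L]
    (hW : ∀ F : IntermediateField ℚ L, Module.finrank ℚ F = 2 → ¬ IsTotallyReal F →
        ¬ ∀ τ : F →+* ℂ, {φ : L →+* ℂ | φ.comp (algebraMap F L) = τ ∧ φ ∈ Φ.1}.ncard =
          {φ : L →+* ℂ | φ.comp (algebraMap F L) = τ ∧ φ ∉ Φ.1}.ncard)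
    (hQ : ∀ F : IntermediateField ℚ L, Module.finrank ℚ F = 4 → ¬ IsTotallyReal F → IsCyclic (F ≃ₐ[ℚ] F) →
        ¬ ∀ τ : F →+* ℂ, 2 * {φ : L →+* ℂ | φ.comp (algebraMap F L) = τ ∧ φ ∈ Φ.1}.ncard = Module.finrank F L)
    (hLp : ∀ F : IntermediateField ℚ L, Module.finrank ℚ F = 2 * 3 → ¬ IsTotallyReal F →
        ¬ ∀ σ : F ≃ₐ[ℚ] F, σ ^ (3 : ℕ) = AlgEquiv.refl → ∀ τ : F →+* ℂ,
          {φ : L →+* ℂ | φ.comp (algebraMap F L) = τ.comp σ.toRingEquiv.toRingHom ∧ φ ∈ Φ.1}.ncard =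
            {φ : L →+* ℂ | φ.comp (algebraMap F L) = τ ∧ φ ∈ Φ.1}.ncard)
    (hLp4 : ∀ F : IntermediateField ℚ L, Module.finrank ℚ F = 4 * 3 → ¬ IsTotallyReal F → IsCyclic (F ≃ₐ[ℚ] F) →
        ¬ ∀ σ : F ≃ₐ[ℚ] F, σ ^ (3 : ℕ) = AlgEquiv.refl → ∀ τ : F →+* ℂ,
          {φ : L →+* ℂ | φ.comp (algebraMap F L) = τ.comp σ.toRingEquiv.toRingHom ∧ φ ∈ Φ.1}.ncard =
            {φ : L →+* ℂ | φ.comp (algebraMap F L) = τ ∧ φ ∈ Φ.1}.ncard)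
    (hLq : ∀ F : IntermediateField ℚ L, Module.finrank ℚ F = 2 * 5 → ¬ IsTotallyReal F →
        ¬ ∀ σ : F ≃ₐ[ℚ] F, σ ^ (5 : ℕ) = AlgEquiv.refl → ∀ τ : F →+* ℂ,
          {φ : L →+* ℂ | φ.comp (algebraMap F L) = τ.comp σ.toRingEquiv.toRingHom ∧ φ ∈ Φ.1}.ncard =
            {φ : L →+* ℂ | φ.comp (algebraMap F L) = τ ∧ φ ∈ Φ.1}.ncard)
    (hLq4 : ∀ F : IntermediateField ℚ L, Module.finrank ℚ F = 4 * 5 → ¬ IsTotallyReal F → IsCyclic (F ≃ₐ[ℚ] F) →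
        ¬ ∀ σ : F ≃ₐ[ℚ] F, σ ^ (5 : ℕ) = AlgEquiv.refl → ∀ τ : F →+* ℂ,
          {φ : L →+* ℂ | φ.comp (algebraMap F L) = τ.comp σ.toRingEquiv.toRingHom ∧ φ ∈ Φ.1}.ncard =
            {φ : L →+* ℂ | φ.comp (algebraMap F L) = τ ∧ φ ∈ Φ.1}.ncard)
    (hS : ∀ F : IntermediateField ℚ L, Module.finrank ℚ F = 2 * (3 * 5) → ¬ IsTotallyReal F →
        ¬ ∀ σ σ' : F ≃ₐ[ℚ] F, σ ^ (3 : ℕ) = AlgEquiv.refl → σ' ^ (5 : ℕ) = AlgEquiv.refl → ∀ τ : F →+* ℂ,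
          {φ : L →+* ℂ | φ.comp (algebraMap F L) = τ ∧ φ ∈ Φ.1}.ncard +
              {φ : L →+* ℂ | φ.comp (algebraMap F L) = τ.comp (σ * σ').toRingEquiv.toRingHom ∧ φ ∈ Φ.1}.ncard =
            {φ : L →+* ℂ | φ.comp (algebraMap F L) = τ.comp σ.toRingEquiv.toRingHom ∧ φ ∈ Φ.1}.ncard +
              {φ : L →+* ℂ | φ.comp (algebraMap F L) = τ.comp σ'.toRingEquiv.toRingHom ∧ φ ∈ Φ.1}.ncard)
    (hS4 : ∀ F : IntermediateField ℚ L, Module.finrank ℚ F = 4 * (3 * 5) → ¬ IsTotallyReal F → IsCyclic (F ≃ₐ[ℚ] F) →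
        ¬ ∀ σ σ' : F ≃ₐ[ℚ] F, σ ^ (3 : ℕ) = AlgEquiv.refl → σ' ^ (5 : ℕ) = AlgEquiv.refl → ∀ τ : F →+* ℂ,
          {φ : L →+* ℂ | φ.comp (algebraMap F L) = τ ∧ φ ∈ Φ.1}.ncard +
              {φ : L →+* ℂ | φ.comp (algebraMap F L) = τ.comp (σ * σ').toRingEquiv.toRingHom ∧ φ ∈ Φ.1}.ncard =
            {φ : L →+* ℂ | φ.comp (algebraMap F L) = τ.comp σ.toRingEquiv.toRingHom ∧ φ ∈ Φ.1}.ncard +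
              {φ : L →+* ℂ | φ.comp (algebraMap F L) = τ.comp σ'.toRingEquiv.toRingHom ∧ φ ∈ Φ.1}.ncard)
    (hA : IsCMTypeRealisation Φ A ι θ) (n : ℕ) :
    HodgeConjectureFor (⨁ fun _ : Fin n => A).dim (⨁ fun _ : Fin n => A).X :=
  haveI : Fact (Nat.Prime 3) := ⟨Nat.prime_three⟩
  haveI : Fact (Nat.Prime 5) := ⟨Nat.prime_five⟩
  hodgeConjectureFor_pow_of_forall_of_isCyclotomicExtension (N := 61) (by norm_num) (by decide) (by decide) (by decide)
    units_pow_sixty_sixtyOne hW hQ hLp hLp4 hLq hLq4 hS hS4 hA n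

/-- `u⁶⁰ = 1` for every unit of `ℤ/143`: `(ℤ/143)ˣ ≅ ℤ/10 × ℤ/12` (`143 = 11·13`; kernel decision on residues coprime to `143`).
[cite: Washington1997, Ch. 2 Thm. 2.5] -/
theorem units_pow_sixty_oneHundredFortyThree (u : (ZMod 143)ˣ) : u ^ (4 * (3 * 5)) = 1 := by
  have h : ∀ a : ZMod 143, Nat.Coprime a.val 143 → a ^ 60 = 1 := by decide +kernel
  exact Units.ext (by rw [Units.val_pow_eq_pow_val, h _ (ZMod.val_coe_unit_coprime u), Units.val_one])

/-- **`ℚ(ζ_{143})` (degree `120`, `Gal ≅ ℤ/10 × ℤ/12`, exponent `60`): the rank formula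
`Rank(Φ) + b + 2e₄ + 2e₆ + 4e₁₂ + 4e₁₀ + 8e₂₀ + 8s₃₀ + 16s₆₀ = 61`** for every CM type — `b` Weil imaginary quadratic subfields, `e₄` cyclic quartic
CM subfields with half fibres, `e₆, e₁₀` (`e₁₂, e₂₀`, cyclic) CM subfields over which `Φ` is level of exponent `3` resp. `5`, `s₃₀` (`s₆₀`, cyclic) CM
subfields over which `Φ` is additively separable. [cite: Kubota1965, §4 Lemma 2] [cite: Hazama2003CyclicCM, Prop. 4.3 and Thm. 4.8] [cite: Dodson1984, §3.1.1 Theorem] -/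
theorem cmTypeRank_add_ncard_subfields_oneHundredFortyThree [IsCyclotomicExtension {143} ℚ L] (Φ : CMType L) :
    cmTypeRank Φ + {F : IntermediateField ℚ L | Module.finrank ℚ F = 2 ∧ ¬ IsTotallyReal F ∧
        ∀ τ : F →+* ℂ, {φ : L →+* ℂ | φ.comp (algebraMap F L) = τ ∧ φ ∈ Φ.1}.ncard =
          {φ : L →+* ℂ | φ.comp (algebraMap F L) = τ ∧ φ ∉ Φ.1}.ncard}.ncard +
      2 * {F : IntermediateField ℚ L | Module.finrank ℚ F = 4 ∧ ¬ IsTotallyReal F ∧ IsCyclic (F ≃ₐ[ℚ] F) ∧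
        ∀ τ : F →+* ℂ, 2 * {φ : L →+* ℂ | φ.comp (algebraMap F L) = τ ∧ φ ∈ Φ.1}.ncard = Module.finrank F L}.ncard +
      2 * {F : IntermediateField ℚ L | Module.finrank ℚ F = 6 ∧ ¬ IsTotallyReal F ∧
        ∀ σ : F ≃ₐ[ℚ] F, σ ^ (3 : ℕ) = AlgEquiv.refl → ∀ τ : F →+* ℂ,
          {φ : L →+* ℂ | φ.comp (algebraMap F L) = τ.comp σ.toRingEquiv.toRingHom ∧ φ ∈ Φ.1}.ncard =
            {φ : L →+* ℂ | φ.comp (algebraMap F L) = τ ∧ φ ∈ Φ.1}.ncard}.ncard +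
      4 * {F : IntermediateField ℚ L | Module.finrank ℚ F = 12 ∧ ¬ IsTotallyReal F ∧ IsCyclic (F ≃ₐ[ℚ] F) ∧
        ∀ σ : F ≃ₐ[ℚ] F, σ ^ (3 : ℕ) = AlgEquiv.refl → ∀ τ : F →+* ℂ,
          {φ : L →+* ℂ | φ.comp (algebraMap F L) = τ.comp σ.toRingEquiv.toRingHom ∧ φ ∈ Φ.1}.ncard =
            {φ : L →+* ℂ | φ.comp (algebraMap F L) = τ ∧ φ ∈ Φ.1}.ncard}.ncard +
      4 * {F : IntermediateField ℚ L | Module.finrank ℚ F = 10 ∧ ¬ IsTotallyReal F ∧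
        ∀ σ : F ≃ₐ[ℚ] F, σ ^ (5 : ℕ) = AlgEquiv.refl → ∀ τ : F →+* ℂ,
          {φ : L →+* ℂ | φ.comp (algebraMap F L) = τ.comp σ.toRingEquiv.toRingHom ∧ φ ∈ Φ.1}.ncard =
            {φ : L →+* ℂ | φ.comp (algebraMap F L) = τ ∧ φ ∈ Φ.1}.ncard}.ncard +
      8 * {F : IntermediateField ℚ L | Module.finrank ℚ F = 20 ∧ ¬ IsTotallyReal F ∧ IsCyclic (F ≃ₐ[ℚ] F) ∧
        ∀ σ : F ≃ₐ[ℚ] F, σ ^ (5 : ℕ) = AlgEquiv.refl → ∀ τ : F →+* ℂ,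
          {φ : L →+* ℂ | φ.comp (algebraMap F L) = τ.comp σ.toRingEquiv.toRingHom ∧ φ ∈ Φ.1}.ncard =
            {φ : L →+* ℂ | φ.comp (algebraMap F L) = τ ∧ φ ∈ Φ.1}.ncard}.ncard +
      8 * {F : IntermediateField ℚ L | Module.finrank ℚ F = 30 ∧ ¬ IsTotallyReal F ∧
        ∀ σ σ' : F ≃ₐ[ℚ] F, σ ^ (3 : ℕ) = AlgEquiv.refl → σ' ^ (5 : ℕ) = AlgEquiv.refl → ∀ τ : F →+* ℂ,
          {φ : L →+* ℂ | φ.comp (algebraMap F L) = τ ∧ φ ∈ Φ.1}.ncard +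
              {φ : L →+* ℂ | φ.comp (algebraMap F L) = τ.comp (σ * σ').toRingEquiv.toRingHom ∧ φ ∈ Φ.1}.ncard =
            {φ : L →+* ℂ | φ.comp (algebraMap F L) = τ.comp σ.toRingEquiv.toRingHom ∧ φ ∈ Φ.1}.ncard +
              {φ : L →+* ℂ | φ.comp (algebraMap F L) = τ.comp σ'.toRingEquiv.toRingHom ∧ φ ∈ Φ.1}.ncard}.ncard +
      16 * {F : IntermediateField ℚ L | Module.finrank ℚ F = 60 ∧ ¬ IsTotallyReal F ∧ IsCyclic (F ≃ₐ[ℚ] F) ∧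
        ∀ σ σ' : F ≃ₐ[ℚ] F, σ ^ (3 : ℕ) = AlgEquiv.refl → σ' ^ (5 : ℕ) = AlgEquiv.refl → ∀ τ : F →+* ℂ,
          {φ : L →+* ℂ | φ.comp (algebraMap F L) = τ ∧ φ ∈ Φ.1}.ncard +
              {φ : L →+* ℂ | φ.comp (algebraMap F L) = τ.comp (σ * σ').toRingEquiv.toRingHom ∧ φ ∈ Φ.1}.ncard =
            {φ : L →+* ℂ | φ.comp (algebraMap F L) = τ.comp σ.toRingEquiv.toRingHom ∧ φ ∈ Φ.1}.ncard +
              {φ : L →+* ℂ | φ.comp (algebraMap F L) = τ.comp σ'.toRingEquiv.toRingHom ∧ φ ∈ Φ.1}.ncard}.ncard = 61 := by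
  haveI : Fact (Nat.Prime 3) := ⟨Nat.prime_three⟩
  haveI : Fact (Nat.Prime 5) := ⟨Nat.prime_five⟩
  have h := cmTypeRank_add_ncard_subfields_eq_of_isCyclotomicExtension (L := L) (N := 143) (by norm_num)
    (by decide : (3 : ℕ) ≠ 5) (by decide : (3 : ℕ) ≠ 2) (by decide : (5 : ℕ) ≠ 2) units_pow_sixty_oneHundredFortyThree Φ
  have hN : Nat.totient 143 = 120 := by decide +kernel
  rw [hN] at h
  exact h

/-- **`ℚ(ζ_{143})`: THE HODGE CONJECTURE FOR ALL POWERS of every abelian variety with complex multiplication by `ℚ(ζ_{143})` (CM `60`-folds)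
whose type is off the eight lists** — UNCONDITIONAL. [cite: Gordon1999HodgeAVSurvey, Thm. 6.4 and §9.3] [cite: Kubota1965, §4 Lemma 2] -/
theorem hodgeConjectureFor_pow_of_forall_oneHundredFortyThree [IsCyclotomicExtension {143} ℚ L]
    (hW : ∀ F : IntermediateField ℚ L, Module.finrank ℚ F = 2 → ¬ IsTotallyReal F →
        ¬ ∀ τ : F →+* ℂ, {φ : L →+* ℂ | φ.comp (algebraMap F L) = τ ∧ φ ∈ Φ.1}.ncard =
          {φ : L →+* ℂ | φ.comp (algebraMap F L) = τ ∧ φ ∉ Φ.1}.ncard)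
    (hQ : ∀ F : IntermediateField ℚ L, Module.finrank ℚ F = 4 → ¬ IsTotallyReal F → IsCyclic (F ≃ₐ[ℚ] F) →
        ¬ ∀ τ : F →+* ℂ, 2 * {φ : L →+* ℂ | φ.comp (algebraMap F L) = τ ∧ φ ∈ Φ.1}.ncard = Module.finrank F L)
    (hLp : ∀ F : IntermediateField ℚ L, Module.finrank ℚ F = 2 * 3 → ¬ IsTotallyReal F →
        ¬ ∀ σ : F ≃ₐ[ℚ] F, σ ^ (3 : ℕ) = AlgEquiv.refl → ∀ τ : F →+* ℂ,
          {φ : L →+* ℂ | φ.comp (algebraMap F L) = τ.comp σ.toRingEquiv.toRingHom ∧ φ ∈ Φ.1}.ncard =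
            {φ : L →+* ℂ | φ.comp (algebraMap F L) = τ ∧ φ ∈ Φ.1}.ncard)
    (hLp4 : ∀ F : IntermediateField ℚ L, Module.finrank ℚ F = 4 * 3 → ¬ IsTotallyReal F → IsCyclic (F ≃ₐ[ℚ] F) →
        ¬ ∀ σ : F ≃ₐ[ℚ] F, σ ^ (3 : ℕ) = AlgEquiv.refl → ∀ τ : F →+* ℂ,
          {φ : L →+* ℂ | φ.comp (algebraMap F L) = τ.comp σ.toRingEquiv.toRingHom ∧ φ ∈ Φ.1}.ncard =
            {φ : L →+* ℂ | φ.comp (algebraMap F L) = τ ∧ φ ∈ Φ.1}.ncard)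
    (hLq : ∀ F : IntermediateField ℚ L, Module.finrank ℚ F = 2 * 5 → ¬ IsTotallyReal F →
        ¬ ∀ σ : F ≃ₐ[ℚ] F, σ ^ (5 : ℕ) = AlgEquiv.refl → ∀ τ : F →+* ℂ,
          {φ : L →+* ℂ | φ.comp (algebraMap F L) = τ.comp σ.toRingEquiv.toRingHom ∧ φ ∈ Φ.1}.ncard =
            {φ : L →+* ℂ | φ.comp (algebraMap F L) = τ ∧ φ ∈ Φ.1}.ncard)
    (hLq4 : ∀ F : IntermediateField ℚ L, Module.finrank ℚ F = 4 * 5 → ¬ IsTotallyReal F → IsCyclic (F ≃ₐ[ℚ] F) →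
        ¬ ∀ σ : F ≃ₐ[ℚ] F, σ ^ (5 : ℕ) = AlgEquiv.refl → ∀ τ : F →+* ℂ,
          {φ : L →+* ℂ | φ.comp (algebraMap F L) = τ.comp σ.toRingEquiv.toRingHom ∧ φ ∈ Φ.1}.ncard =
            {φ : L →+* ℂ | φ.comp (algebraMap F L) = τ ∧ φ ∈ Φ.1}.ncard)
    (hS : ∀ F : IntermediateField ℚ L, Module.finrank ℚ F = 2 * (3 * 5) → ¬ IsTotallyReal F →
        ¬ ∀ σ σ' : F ≃ₐ[ℚ] F, σ ^ (3 : ℕ) = AlgEquiv.refl → σ' ^ (5 : ℕ) = AlgEquiv.refl → ∀ τ : F →+* ℂ,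
          {φ : L →+* ℂ | φ.comp (algebraMap F L) = τ ∧ φ ∈ Φ.1}.ncard +
              {φ : L →+* ℂ | φ.comp (algebraMap F L) = τ.comp (σ * σ').toRingEquiv.toRingHom ∧ φ ∈ Φ.1}.ncard =
            {φ : L →+* ℂ | φ.comp (algebraMap F L) = τ.comp σ.toRingEquiv.toRingHom ∧ φ ∈ Φ.1}.ncard +
              {φ : L →+* ℂ | φ.comp (algebraMap F L) = τ.comp σ'.toRingEquiv.toRingHom ∧ φ ∈ Φ.1}.ncard)
    (hS4 : ∀ F : IntermediateField ℚ L, Module.finrank ℚ F = 4 * (3 * 5) → ¬ IsTotallyReal F → IsCyclic (F ≃ₐ[ℚ] F) →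
        ¬ ∀ σ σ' : F ≃ₐ[ℚ] F, σ ^ (3 : ℕ) = AlgEquiv.refl → σ' ^ (5 : ℕ) = AlgEquiv.refl → ∀ τ : F →+* ℂ,
          {φ : L →+* ℂ | φ.comp (algebraMap F L) = τ ∧ φ ∈ Φ.1}.ncard +
              {φ : L →+* ℂ | φ.comp (algebraMap F L) = τ.comp (σ * σ').toRingEquiv.toRingHom ∧ φ ∈ Φ.1}.ncard =
            {φ : L →+* ℂ | φ.comp (algebraMap F L) = τ.comp σ.toRingEquiv.toRingHom ∧ φ ∈ Φ.1}.ncard +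
              {φ : L →+* ℂ | φ.comp (algebraMap F L) = τ.comp σ'.toRingEquiv.toRingHom ∧ φ ∈ Φ.1}.ncard)
    (hA : IsCMTypeRealisation Φ A ι θ) (n : ℕ) :
    HodgeConjectureFor (⨁ fun _ : Fin n => A).dim (⨁ fun _ : Fin n => A).X :=
  haveI : Fact (Nat.Prime 3) := ⟨Nat.prime_three⟩
  haveI : Fact (Nat.Prime 5) := ⟨Nat.prime_five⟩
  hodgeConjectureFor_pow_of_forall_of_isCyclotomicExtension (N := 143) (by norm_num) (by decide) (by decide) (by decide)
    units_pow_sixty_oneHundredFortyThree hW hQ hLp hLp4 hLq hLq4 hS hS4 hA n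

/-- `u⁶⁰ = 1` for every unit of `ℤ/155`: `(ℤ/155)ˣ ≅ ℤ/4 × ℤ/30` (`155 = 5·31`; kernel decision on residues coprime to `155`).
[cite: Washington1997, Ch. 2 Thm. 2.5] -/
theorem units_pow_sixty_oneHundredFiftyFive (u : (ZMod 155)ˣ) : u ^ (4 * (3 * 5)) = 1 := by
  have h : ∀ a : ZMod 155, Nat.Coprime a.val 155 → a ^ 60 = 1 := by decide +kernel
  exact Units.ext (by rw [Units.val_pow_eq_pow_val, h _ (ZMod.val_coe_unit_coprime u), Units.val_one])

/-- **`ℚ(ζ_{155})` (degree `120`, `Gal ≅ ℤ/4 × ℤ/30`, exponent `60`): the rank formula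
`Rank(Φ) + b + 2e₄ + 2e₆ + 4e₁₂ + 4e₁₀ + 8e₂₀ + 8s₃₀ + 16s₆₀ = 61`** for every CM type — `b` Weil imaginary quadratic subfields, `e₄` cyclic quartic
CM subfields with half fibres, `e₆, e₁₀` (`e₁₂, e₂₀`, cyclic) CM subfields over which `Φ` is level of exponent `3` resp. `5`, `s₃₀` (`s₆₀`, cyclic) CM
subfields over which `Φ` is additively separable. [cite: Kubota1965, §4 Lemma 2] [cite: Hazama2003CyclicCM, Prop. 4.3 and Thm. 4.8] [cite: Dodson1984, §3.1.1 Theorem] -/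
theorem cmTypeRank_add_ncard_subfields_oneHundredFiftyFive [IsCyclotomicExtension {155} ℚ L] (Φ : CMType L) :
    cmTypeRank Φ + {F : IntermediateField ℚ L | Module.finrank ℚ F = 2 ∧ ¬ IsTotallyReal F ∧
        ∀ τ : F →+* ℂ, {φ : L →+* ℂ | φ.comp (algebraMap F L) = τ ∧ φ ∈ Φ.1}.ncard =
          {φ : L →+* ℂ | φ.comp (algebraMap F L) = τ ∧ φ ∉ Φ.1}.ncard}.ncard +
      2 * {F : IntermediateField ℚ L | Module.finrank ℚ F = 4 ∧ ¬ IsTotallyReal F ∧ IsCyclic (F ≃ₐ[ℚ] F) ∧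
        ∀ τ : F →+* ℂ, 2 * {φ : L →+* ℂ | φ.comp (algebraMap F L) = τ ∧ φ ∈ Φ.1}.ncard = Module.finrank F L}.ncard +
      2 * {F : IntermediateField ℚ L | Module.finrank ℚ F = 6 ∧ ¬ IsTotallyReal F ∧
        ∀ σ : F ≃ₐ[ℚ] F, σ ^ (3 : ℕ) = AlgEquiv.refl → ∀ τ : F →+* ℂ,
          {φ : L →+* ℂ | φ.comp (algebraMap F L) = τ.comp σ.toRingEquiv.toRingHom ∧ φ ∈ Φ.1}.ncard =
            {φ : L →+* ℂ | φ.comp (algebraMap F L) = τ ∧ φ ∈ Φ.1}.ncard}.ncard +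
      4 * {F : IntermediateField ℚ L | Module.finrank ℚ F = 12 ∧ ¬ IsTotallyReal F ∧ IsCyclic (F ≃ₐ[ℚ] F) ∧
        ∀ σ : F ≃ₐ[ℚ] F, σ ^ (3 : ℕ) = AlgEquiv.refl → ∀ τ : F →+* ℂ,
          {φ : L →+* ℂ | φ.comp (algebraMap F L) = τ.comp σ.toRingEquiv.toRingHom ∧ φ ∈ Φ.1}.ncard =
            {φ : L →+* ℂ | φ.comp (algebraMap F L) = τ ∧ φ ∈ Φ.1}.ncard}.ncard +
      4 * {F : IntermediateField ℚ L | Module.finrank ℚ F = 10 ∧ ¬ IsTotallyReal F ∧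
        ∀ σ : F ≃ₐ[ℚ] F, σ ^ (5 : ℕ) = AlgEquiv.refl → ∀ τ : F →+* ℂ,
          {φ : L →+* ℂ | φ.comp (algebraMap F L) = τ.comp σ.toRingEquiv.toRingHom ∧ φ ∈ Φ.1}.ncard =
            {φ : L →+* ℂ | φ.comp (algebraMap F L) = τ ∧ φ ∈ Φ.1}.ncard}.ncard +
      8 * {F : IntermediateField ℚ L | Module.finrank ℚ F = 20 ∧ ¬ IsTotallyReal F ∧ IsCyclic (F ≃ₐ[ℚ] F) ∧
        ∀ σ : F ≃ₐ[ℚ] F, σ ^ (5 : ℕ) = AlgEquiv.refl → ∀ τ : F →+* ℂ,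
          {φ : L →+* ℂ | φ.comp (algebraMap F L) = τ.comp σ.toRingEquiv.toRingHom ∧ φ ∈ Φ.1}.ncard =
            {φ : L →+* ℂ | φ.comp (algebraMap F L) = τ ∧ φ ∈ Φ.1}.ncard}.ncard +
      8 * {F : IntermediateField ℚ L | Module.finrank ℚ F = 30 ∧ ¬ IsTotallyReal F ∧
        ∀ σ σ' : F ≃ₐ[ℚ] F, σ ^ (3 : ℕ) = AlgEquiv.refl → σ' ^ (5 : ℕ) = AlgEquiv.refl → ∀ τ : F →+* ℂ,
          {φ : L →+* ℂ | φ.comp (algebraMap F L) = τ ∧ φ ∈ Φ.1}.ncard +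
              {φ : L →+* ℂ | φ.comp (algebraMap F L) = τ.comp (σ * σ').toRingEquiv.toRingHom ∧ φ ∈ Φ.1}.ncard =
            {φ : L →+* ℂ | φ.comp (algebraMap F L) = τ.comp σ.toRingEquiv.toRingHom ∧ φ ∈ Φ.1}.ncard +
              {φ : L →+* ℂ | φ.comp (algebraMap F L) = τ.comp σ'.toRingEquiv.toRingHom ∧ φ ∈ Φ.1}.ncard}.ncard +
      16 * {F : IntermediateField ℚ L | Module.finrank ℚ F = 60 ∧ ¬ IsTotallyReal F ∧ IsCyclic (F ≃ₐ[ℚ] F) ∧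
        ∀ σ σ' : F ≃ₐ[ℚ] F, σ ^ (3 : ℕ) = AlgEquiv.refl → σ' ^ (5 : ℕ) = AlgEquiv.refl → ∀ τ : F →+* ℂ,
          {φ : L →+* ℂ | φ.comp (algebraMap F L) = τ ∧ φ ∈ Φ.1}.ncard +
              {φ : L →+* ℂ | φ.comp (algebraMap F L) = τ.comp (σ * σ').toRingEquiv.toRingHom ∧ φ ∈ Φ.1}.ncard =
            {φ : L →+* ℂ | φ.comp (algebraMap F L) = τ.comp σ.toRingEquiv.toRingHom ∧ φ ∈ Φ.1}.ncard +
              {φ : L →+* ℂ | φ.comp (algebraMap F L) = τ.comp σ'.toRingEquiv.toRingHom ∧ φ ∈ Φ.1}.ncard}.ncard = 61 := by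
  haveI : Fact (Nat.Prime 3) := ⟨Nat.prime_three⟩
  haveI : Fact (Nat.Prime 5) := ⟨Nat.prime_five⟩
  have h := cmTypeRank_add_ncard_subfields_eq_of_isCyclotomicExtension (L := L) (N := 155) (by norm_num)
    (by decide : (3 : ℕ) ≠ 5) (by decide : (3 : ℕ) ≠ 2) (by decide : (5 : ℕ) ≠ 2) units_pow_sixty_oneHundredFiftyFive Φ
  have hN : Nat.totient 155 = 120 := by decide +kernel
  rw [hN] at h
  exact h

/-- **`ℚ(ζ_{155})`: THE HODGE CONJECTURE FOR ALL POWERS of every abelian variety with complex multiplication by `ℚ(ζ_{155})` (CM `60`-folds)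
whose type is off the eight lists** — UNCONDITIONAL. [cite: Gordon1999HodgeAVSurvey, Thm. 6.4 and §9.3] [cite: Kubota1965, §4 Lemma 2] -/
theorem hodgeConjectureFor_pow_of_forall_oneHundredFiftyFive [IsCyclotomicExtension {155} ℚ L]
    (hW : ∀ F : IntermediateField ℚ L, Module.finrank ℚ F = 2 → ¬ IsTotallyReal F →
        ¬ ∀ τ : F →+* ℂ, {φ : L →+* ℂ | φ.comp (algebraMap F L) = τ ∧ φ ∈ Φ.1}.ncard =
          {φ : L →+* ℂ | φ.comp (algebraMap F L) = τ ∧ φ ∉ Φ.1}.ncard)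
    (hQ : ∀ F : IntermediateField ℚ L, Module.finrank ℚ F = 4 → ¬ IsTotallyReal F → IsCyclic (F ≃ₐ[ℚ] F) →
        ¬ ∀ τ : F →+* ℂ, 2 * {φ : L →+* ℂ | φ.comp (algebraMap F L) = τ ∧ φ ∈ Φ.1}.ncard = Module.finrank F L)
    (hLp : ∀ F : IntermediateField ℚ L, Module.finrank ℚ F = 2 * 3 → ¬ IsTotallyReal F →
        ¬ ∀ σ : F ≃ₐ[ℚ] F, σ ^ (3 : ℕ) = AlgEquiv.refl → ∀ τ : F →+* ℂ,
          {φ : L →+* ℂ | φ.comp (algebraMap F L) = τ.comp σ.toRingEquiv.toRingHom ∧ φ ∈ Φ.1}.ncard =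
            {φ : L →+* ℂ | φ.comp (algebraMap F L) = τ ∧ φ ∈ Φ.1}.ncard)
    (hLp4 : ∀ F : IntermediateField ℚ L, Module.finrank ℚ F = 4 * 3 → ¬ IsTotallyReal F → IsCyclic (F ≃ₐ[ℚ] F) →
        ¬ ∀ σ : F ≃ₐ[ℚ] F, σ ^ (3 : ℕ) = AlgEquiv.refl → ∀ τ : F →+* ℂ,
          {φ : L →+* ℂ | φ.comp (algebraMap F L) = τ.comp σ.toRingEquiv.toRingHom ∧ φ ∈ Φ.1}.ncard =
            {φ : L →+* ℂ | φ.comp (algebraMap F L) = τ ∧ φ ∈ Φ.1}.ncard)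
    (hLq : ∀ F : IntermediateField ℚ L, Module.finrank ℚ F = 2 * 5 → ¬ IsTotallyReal F →
        ¬ ∀ σ : F ≃ₐ[ℚ] F, σ ^ (5 : ℕ) = AlgEquiv.refl → ∀ τ : F →+* ℂ,
          {φ : L →+* ℂ | φ.comp (algebraMap F L) = τ.comp σ.toRingEquiv.toRingHom ∧ φ ∈ Φ.1}.ncard =
            {φ : L →+* ℂ | φ.comp (algebraMap F L) = τ ∧ φ ∈ Φ.1}.ncard)
    (hLq4 : ∀ F : IntermediateField ℚ L, Module.finrank ℚ F = 4 * 5 → ¬ IsTotallyReal F → IsCyclic (F ≃ₐ[ℚ] F) →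
        ¬ ∀ σ : F ≃ₐ[ℚ] F, σ ^ (5 : ℕ) = AlgEquiv.refl → ∀ τ : F →+* ℂ,
          {φ : L →+* ℂ | φ.comp (algebraMap F L) = τ.comp σ.toRingEquiv.toRingHom ∧ φ ∈ Φ.1}.ncard =
            {φ : L →+* ℂ | φ.comp (algebraMap F L) = τ ∧ φ ∈ Φ.1}.ncard)
    (hS : ∀ F : IntermediateField ℚ L, Module.finrank ℚ F = 2 * (3 * 5) → ¬ IsTotallyReal F →
        ¬ ∀ σ σ' : F ≃ₐ[ℚ] F, σ ^ (3 : ℕ) = AlgEquiv.refl → σ' ^ (5 : ℕ) = AlgEquiv.refl → ∀ τ : F →+* ℂ,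
          {φ : L →+* ℂ | φ.comp (algebraMap F L) = τ ∧ φ ∈ Φ.1}.ncard +
              {φ : L →+* ℂ | φ.comp (algebraMap F L) = τ.comp (σ * σ').toRingEquiv.toRingHom ∧ φ ∈ Φ.1}.ncard =
            {φ : L →+* ℂ | φ.comp (algebraMap F L) = τ.comp σ.toRingEquiv.toRingHom ∧ φ ∈ Φ.1}.ncard +
              {φ : L →+* ℂ | φ.comp (algebraMap F L) = τ.comp σ'.toRingEquiv.toRingHom ∧ φ ∈ Φ.1}.ncard)
    (hS4 : ∀ F : IntermediateField ℚ L, Module.finrank ℚ F = 4 * (3 * 5) → ¬ IsTotallyReal F → IsCyclic (F ≃ₐ[ℚ] F) →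
        ¬ ∀ σ σ' : F ≃ₐ[ℚ] F, σ ^ (3 : ℕ) = AlgEquiv.refl → σ' ^ (5 : ℕ) = AlgEquiv.refl → ∀ τ : F →+* ℂ,
          {φ : L →+* ℂ | φ.comp (algebraMap F L) = τ ∧ φ ∈ Φ.1}.ncard +
              {φ : L →+* ℂ | φ.comp (algebraMap F L) = τ.comp (σ * σ').toRingEquiv.toRingHom ∧ φ ∈ Φ.1}.ncard =
            {φ : L →+* ℂ | φ.comp (algebraMap F L) = τ.comp σ.toRingEquiv.toRingHom ∧ φ ∈ Φ.1}.ncard +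
              {φ : L →+* ℂ | φ.comp (algebraMap F L) = τ.comp σ'.toRingEquiv.toRingHom ∧ φ ∈ Φ.1}.ncard)
    (hA : IsCMTypeRealisation Φ A ι θ) (n : ℕ) :
    HodgeConjectureFor (⨁ fun _ : Fin n => A).dim (⨁ fun _ : Fin n => A).X :=
  haveI : Fact (Nat.Prime 3) := ⟨Nat.prime_three⟩
  haveI : Fact (Nat.Prime 5) := ⟨Nat.prime_five⟩
  hodgeConjectureFor_pow_of_forall_of_isCyclotomicExtension (N := 155) (by norm_num) (by decide) (by decide) (by decide)
    units_pow_sixty_oneHundredFiftyFive hW hQ hLp hLp4 hLq hLq4 hS hS4 hA n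

/-- `u⁶⁰ = 1` for every unit of `ℤ/175`: `(ℤ/175)ˣ ≅ ℤ/6 × ℤ/20` (`175 = 5²·7`; kernel decision on residues coprime to `175`).
[cite: Washington1997, Ch. 2 Thm. 2.5] -/
theorem units_pow_sixty_oneHundredSeventyFive (u : (ZMod 175)ˣ) : u ^ (4 * (3 * 5)) = 1 := by
  have h : ∀ a : ZMod 175, Nat.Coprime a.val 175 → a ^ 60 = 1 := by decide +kernel
  exact Units.ext (by rw [Units.val_pow_eq_pow_val, h _ (ZMod.val_coe_unit_coprime u), Units.val_one])

/-- **`ℚ(ζ_{175})` (degree `120`, `Gal ≅ ℤ/6 × ℤ/20`, exponent `60`): the rank formula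
`Rank(Φ) + b + 2e₄ + 2e₆ + 4e₁₂ + 4e₁₀ + 8e₂₀ + 8s₃₀ + 16s₆₀ = 61`** for every CM type — `b` Weil imaginary quadratic subfields, `e₄` cyclic quartic
CM subfields with half fibres, `e₆, e₁₀` (`e₁₂, e₂₀`, cyclic) CM subfields over which `Φ` is level of exponent `3` resp. `5`, `s₃₀` (`s₆₀`, cyclic) CM
subfields over which `Φ` is additively separable. [cite: Kubota1965, §4 Lemma 2] [cite: Hazama2003CyclicCM, Prop. 4.3 and Thm. 4.8] [cite: Dodson1984, §3.1.1 Theorem] -/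
theorem cmTypeRank_add_ncard_subfields_oneHundredSeventyFive [IsCyclotomicExtension {175} ℚ L] (Φ : CMType L) :
    cmTypeRank Φ + {F : IntermediateField ℚ L | Module.finrank ℚ F = 2 ∧ ¬ IsTotallyReal F ∧
        ∀ τ : F →+* ℂ, {φ : L →+* ℂ | φ.comp (algebraMap F L) = τ ∧ φ ∈ Φ.1}.ncard =
          {φ : L →+* ℂ | φ.comp (algebraMap F L) = τ ∧ φ ∉ Φ.1}.ncard}.ncard +
      2 * {F : IntermediateField ℚ L | Module.finrank ℚ F = 4 ∧ ¬ IsTotallyReal F ∧ IsCyclic (F ≃ₐ[ℚ] F) ∧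
        ∀ τ : F →+* ℂ, 2 * {φ : L →+* ℂ | φ.comp (algebraMap F L) = τ ∧ φ ∈ Φ.1}.ncard = Module.finrank F L}.ncard +
      2 * {F : IntermediateField ℚ L | Module.finrank ℚ F = 6 ∧ ¬ IsTotallyReal F ∧
        ∀ σ : F ≃ₐ[ℚ] F, σ ^ (3 : ℕ) = AlgEquiv.refl → ∀ τ : F →+* ℂ,
          {φ : L →+* ℂ | φ.comp (algebraMap F L) = τ.comp σ.toRingEquiv.toRingHom ∧ φ ∈ Φ.1}.ncard =
            {φ : L →+* ℂ | φ.comp (algebraMap F L) = τ ∧ φ ∈ Φ.1}.ncard}.ncard +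
      4 * {F : IntermediateField ℚ L | Module.finrank ℚ F = 12 ∧ ¬ IsTotallyReal F ∧ IsCyclic (F ≃ₐ[ℚ] F) ∧
        ∀ σ : F ≃ₐ[ℚ] F, σ ^ (3 : ℕ) = AlgEquiv.refl → ∀ τ : F →+* ℂ,
          {φ : L →+* ℂ | φ.comp (algebraMap F L) = τ.comp σ.toRingEquiv.toRingHom ∧ φ ∈ Φ.1}.ncard =
            {φ : L →+* ℂ | φ.comp (algebraMap F L) = τ ∧ φ ∈ Φ.1}.ncard}.ncard +
      4 * {F : IntermediateField ℚ L | Module.finrank ℚ F = 10 ∧ ¬ IsTotallyReal F ∧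
        ∀ σ : F ≃ₐ[ℚ] F, σ ^ (5 : ℕ) = AlgEquiv.refl → ∀ τ : F →+* ℂ,
          {φ : L →+* ℂ | φ.comp (algebraMap F L) = τ.comp σ.toRingEquiv.toRingHom ∧ φ ∈ Φ.1}.ncard =
            {φ : L →+* ℂ | φ.comp (algebraMap F L) = τ ∧ φ ∈ Φ.1}.ncard}.ncard +
      8 * {F : IntermediateField ℚ L | Module.finrank ℚ F = 20 ∧ ¬ IsTotallyReal F ∧ IsCyclic (F ≃ₐ[ℚ] F) ∧
        ∀ σ : F ≃ₐ[ℚ] F, σ ^ (5 : ℕ) = AlgEquiv.refl → ∀ τ : F →+* ℂ,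
          {φ : L →+* ℂ | φ.comp (algebraMap F L) = τ.comp σ.toRingEquiv.toRingHom ∧ φ ∈ Φ.1}.ncard =
            {φ : L →+* ℂ | φ.comp (algebraMap F L) = τ ∧ φ ∈ Φ.1}.ncard}.ncard +
      8 * {F : IntermediateField ℚ L | Module.finrank ℚ F = 30 ∧ ¬ IsTotallyReal F ∧
        ∀ σ σ' : F ≃ₐ[ℚ] F, σ ^ (3 : ℕ) = AlgEquiv.refl → σ' ^ (5 : ℕ) = AlgEquiv.refl → ∀ τ : F →+* ℂ,
          {φ : L →+* ℂ | φ.comp (algebraMap F L) = τ ∧ φ ∈ Φ.1}.ncard +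
              {φ : L →+* ℂ | φ.comp (algebraMap F L) = τ.comp (σ * σ').toRingEquiv.toRingHom ∧ φ ∈ Φ.1}.ncard =
            {φ : L →+* ℂ | φ.comp (algebraMap F L) = τ.comp σ.toRingEquiv.toRingHom ∧ φ ∈ Φ.1}.ncard +
              {φ : L →+* ℂ | φ.comp (algebraMap F L) = τ.comp σ'.toRingEquiv.toRingHom ∧ φ ∈ Φ.1}.ncard}.ncard +
      16 * {F : IntermediateField ℚ L | Module.finrank ℚ F = 60 ∧ ¬ IsTotallyReal F ∧ IsCyclic (F ≃ₐ[ℚ] F) ∧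
        ∀ σ σ' : F ≃ₐ[ℚ] F, σ ^ (3 : ℕ) = AlgEquiv.refl → σ' ^ (5 : ℕ) = AlgEquiv.refl → ∀ τ : F →+* ℂ,
          {φ : L →+* ℂ | φ.comp (algebraMap F L) = τ ∧ φ ∈ Φ.1}.ncard +
              {φ : L →+* ℂ | φ.comp (algebraMap F L) = τ.comp (σ * σ').toRingEquiv.toRingHom ∧ φ ∈ Φ.1}.ncard =
            {φ : L →+* ℂ | φ.comp (algebraMap F L) = τ.comp σ.toRingEquiv.toRingHom ∧ φ ∈ Φ.1}.ncard +
              {φ : L →+* ℂ | φ.comp (algebraMap F L) = τ.comp σ'.toRingEquiv.toRingHom ∧ φ ∈ Φ.1}.ncard}.ncard = 61 := by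
  haveI : Fact (Nat.Prime 3) := ⟨Nat.prime_three⟩
  haveI : Fact (Nat.Prime 5) := ⟨Nat.prime_five⟩
  have h := cmTypeRank_add_ncard_subfields_eq_of_isCyclotomicExtension (L := L) (N := 175) (by norm_num)
    (by decide : (3 : ℕ) ≠ 5) (by decide : (3 : ℕ) ≠ 2) (by decide : (5 : ℕ) ≠ 2) units_pow_sixty_oneHundredSeventyFive Φ
  have hN : Nat.totient 175 = 120 := by decide +kernel
  rw [hN] at h
  exact h

/-- **`ℚ(ζ_{175})`: THE HODGE CONJECTURE FOR ALL POWERS of every abelian variety with complex multiplication by `ℚ(ζ_{175})` (CM `60`-folds)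
whose type is off the eight lists** — UNCONDITIONAL. [cite: Gordon1999HodgeAVSurvey, Thm. 6.4 and §9.3] [cite: Kubota1965, §4 Lemma 2] -/
theorem hodgeConjectureFor_pow_of_forall_oneHundredSeventyFive [IsCyclotomicExtension {175} ℚ L]
    (hW : ∀ F : IntermediateField ℚ L, Module.finrank ℚ F = 2 → ¬ IsTotallyReal F →
        ¬ ∀ τ : F →+* ℂ, {φ : L →+* ℂ | φ.comp (algebraMap F L) = τ ∧ φ ∈ Φ.1}.ncard =
          {φ : L →+* ℂ | φ.comp (algebraMap F L) = τ ∧ φ ∉ Φ.1}.ncard)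
    (hQ : ∀ F : IntermediateField ℚ L, Module.finrank ℚ F = 4 → ¬ IsTotallyReal F → IsCyclic (F ≃ₐ[ℚ] F) →
        ¬ ∀ τ : F →+* ℂ, 2 * {φ : L →+* ℂ | φ.comp (algebraMap F L) = τ ∧ φ ∈ Φ.1}.ncard = Module.finrank F L)
    (hLp : ∀ F : IntermediateField ℚ L, Module.finrank ℚ F = 2 * 3 → ¬ IsTotallyReal F →
        ¬ ∀ σ : F ≃ₐ[ℚ] F, σ ^ (3 : ℕ) = AlgEquiv.refl → ∀ τ : F →+* ℂ,
          {φ : L →+* ℂ | φ.comp (algebraMap F L) = τ.comp σ.toRingEquiv.toRingHom ∧ φ ∈ Φ.1}.ncard =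
            {φ : L →+* ℂ | φ.comp (algebraMap F L) = τ ∧ φ ∈ Φ.1}.ncard)
    (hLp4 : ∀ F : IntermediateField ℚ L, Module.finrank ℚ F = 4 * 3 → ¬ IsTotallyReal F → IsCyclic (F ≃ₐ[ℚ] F) →
        ¬ ∀ σ : F ≃ₐ[ℚ] F, σ ^ (3 : ℕ) = AlgEquiv.refl → ∀ τ : F →+* ℂ,
          {φ : L →+* ℂ | φ.comp (algebraMap F L) = τ.comp σ.toRingEquiv.toRingHom ∧ φ ∈ Φ.1}.ncard =
            {φ : L →+* ℂ | φ.comp (algebraMap F L) = τ ∧ φ ∈ Φ.1}.ncard)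
    (hLq : ∀ F : IntermediateField ℚ L, Module.finrank ℚ F = 2 * 5 → ¬ IsTotallyReal F →
        ¬ ∀ σ : F ≃ₐ[ℚ] F, σ ^ (5 : ℕ) = AlgEquiv.refl → ∀ τ : F →+* ℂ,
          {φ : L →+* ℂ | φ.comp (algebraMap F L) = τ.comp σ.toRingEquiv.toRingHom ∧ φ ∈ Φ.1}.ncard =
            {φ : L →+* ℂ | φ.comp (algebraMap F L) = τ ∧ φ ∈ Φ.1}.ncard)
    (hLq4 : ∀ F : IntermediateField ℚ L, Module.finrank ℚ F = 4 * 5 → ¬ IsTotallyReal F → IsCyclic (F ≃ₐ[ℚ] F) →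
        ¬ ∀ σ : F ≃ₐ[ℚ] F, σ ^ (5 : ℕ) = AlgEquiv.refl → ∀ τ : F →+* ℂ,
          {φ : L →+* ℂ | φ.comp (algebraMap F L) = τ.comp σ.toRingEquiv.toRingHom ∧ φ ∈ Φ.1}.ncard =
            {φ : L →+* ℂ | φ.comp (algebraMap F L) = τ ∧ φ ∈ Φ.1}.ncard)
    (hS : ∀ F : IntermediateField ℚ L, Module.finrank ℚ F = 2 * (3 * 5) → ¬ IsTotallyReal F →
        ¬ ∀ σ σ' : F ≃ₐ[ℚ] F, σ ^ (3 : ℕ) = AlgEquiv.refl → σ' ^ (5 : ℕ) = AlgEquiv.refl → ∀ τ : F →+* ℂ,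
          {φ : L →+* ℂ | φ.comp (algebraMap F L) = τ ∧ φ ∈ Φ.1}.ncard +
              {φ : L →+* ℂ | φ.comp (algebraMap F L) = τ.comp (σ * σ').toRingEquiv.toRingHom ∧ φ ∈ Φ.1}.ncard =
            {φ : L →+* ℂ | φ.comp (algebraMap F L) = τ.comp σ.toRingEquiv.toRingHom ∧ φ ∈ Φ.1}.ncard +
              {φ : L →+* ℂ | φ.comp (algebraMap F L) = τ.comp σ'.toRingEquiv.toRingHom ∧ φ ∈ Φ.1}.ncard)
    (hS4 : ∀ F : IntermediateField ℚ L, Module.finrank ℚ F = 4 * (3 * 5) → ¬ IsTotallyReal F → IsCyclic (F ≃ₐ[ℚ] F) →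
        ¬ ∀ σ σ' : F ≃ₐ[ℚ] F, σ ^ (3 : ℕ) = AlgEquiv.refl → σ' ^ (5 : ℕ) = AlgEquiv.refl → ∀ τ : F →+* ℂ,
          {φ : L →+* ℂ | φ.comp (algebraMap F L) = τ ∧ φ ∈ Φ.1}.ncard +
              {φ : L →+* ℂ | φ.comp (algebraMap F L) = τ.comp (σ * σ').toRingEquiv.toRingHom ∧ φ ∈ Φ.1}.ncard =
            {φ : L →+* ℂ | φ.comp (algebraMap F L) = τ.comp σ.toRingEquiv.toRingHom ∧ φ ∈ Φ.1}.ncard +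
              {φ : L →+* ℂ | φ.comp (algebraMap F L) = τ.comp σ'.toRingEquiv.toRingHom ∧ φ ∈ Φ.1}.ncard)
    (hA : IsCMTypeRealisation Φ A ι θ) (n : ℕ) :
    HodgeConjectureFor (⨁ fun _ : Fin n => A).dim (⨁ fun _ : Fin n => A).X :=
  haveI : Fact (Nat.Prime 3) := ⟨Nat.prime_three⟩
  haveI : Fact (Nat.Prime 5) := ⟨Nat.prime_five⟩
  hodgeConjectureFor_pow_of_forall_of_isCyclotomicExtension (N := 175) (by norm_num) (by decide) (by decide) (by decide)
    units_pow_sixty_oneHundredSeventyFive hW hQ hLp hLp4 hLq hLq4 hS hS4 hA n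

/-- `u⁶⁰ = 1` for every unit of `ℤ/183`: `(ℤ/183)ˣ ≅ ℤ/2 × ℤ/60` (`183 = 3·61`; kernel decision on residues coprime to `183`).
[cite: Washington1997, Ch. 2 Thm. 2.5] -/
theorem units_pow_sixty_oneHundredEightyThree (u : (ZMod 183)ˣ) : u ^ (4 * (3 * 5)) = 1 := by
  have h : ∀ a : ZMod 183, Nat.Coprime a.val 183 → a ^ 60 = 1 := by decide +kernel
  exact Units.ext (by rw [Units.val_pow_eq_pow_val, h _ (ZMod.val_coe_unit_coprime u), Units.val_one])

/-- **`ℚ(ζ_{183})` (degree `120`, `Gal ≅ ℤ/2 × ℤ/60`, exponent `60`): the rank formula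
`Rank(Φ) + b + 2e₄ + 2e₆ + 4e₁₂ + 4e₁₀ + 8e₂₀ + 8s₃₀ + 16s₆₀ = 61`** for every CM type — `b` Weil imaginary quadratic subfields, `e₄` cyclic quartic
CM subfields with half fibres, `e₆, e₁₀` (`e₁₂, e₂₀`, cyclic) CM subfields over which `Φ` is level of exponent `3` resp. `5`, `s₃₀` (`s₆₀`, cyclic) CM
subfields over which `Φ` is additively separable. [cite: Kubota1965, §4 Lemma 2] [cite: Hazama2003CyclicCM, Prop. 4.3 and Thm. 4.8] [cite: Dodson1984, §3.1.1 Theorem] -/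
theorem cmTypeRank_add_ncard_subfields_oneHundredEightyThree [IsCyclotomicExtension {183} ℚ L] (Φ : CMType L) :
    cmTypeRank Φ + {F : IntermediateField ℚ L | Module.finrank ℚ F = 2 ∧ ¬ IsTotallyReal F ∧
        ∀ τ : F →+* ℂ, {φ : L →+* ℂ | φ.comp (algebraMap F L) = τ ∧ φ ∈ Φ.1}.ncard =
          {φ : L →+* ℂ | φ.comp (algebraMap F L) = τ ∧ φ ∉ Φ.1}.ncard}.ncard +
      2 * {F : IntermediateField ℚ L | Module.finrank ℚ F = 4 ∧ ¬ IsTotallyReal F ∧ IsCyclic (F ≃ₐ[ℚ] F) ∧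
        ∀ τ : F →+* ℂ, 2 * {φ : L →+* ℂ | φ.comp (algebraMap F L) = τ ∧ φ ∈ Φ.1}.ncard = Module.finrank F L}.ncard +
      2 * {F : IntermediateField ℚ L | Module.finrank ℚ F = 6 ∧ ¬ IsTotallyReal F ∧
        ∀ σ : F ≃ₐ[ℚ] F, σ ^ (3 : ℕ) = AlgEquiv.refl → ∀ τ : F →+* ℂ,
          {φ : L →+* ℂ | φ.comp (algebraMap F L) = τ.comp σ.toRingEquiv.toRingHom ∧ φ ∈ Φ.1}.ncard =
            {φ : L →+* ℂ | φ.comp (algebraMap F L) = τ ∧ φ ∈ Φ.1}.ncard}.ncard +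
      4 * {F : IntermediateField ℚ L | Module.finrank ℚ F = 12 ∧ ¬ IsTotallyReal F ∧ IsCyclic (F ≃ₐ[ℚ] F) ∧
        ∀ σ : F ≃ₐ[ℚ] F, σ ^ (3 : ℕ) = AlgEquiv.refl → ∀ τ : F →+* ℂ,
          {φ : L →+* ℂ | φ.comp (algebraMap F L) = τ.comp σ.toRingEquiv.toRingHom ∧ φ ∈ Φ.1}.ncard =
            {φ : L →+* ℂ | φ.comp (algebraMap F L) = τ ∧ φ ∈ Φ.1}.ncard}.ncard +
      4 * {F : IntermediateField ℚ L | Module.finrank ℚ F = 10 ∧ ¬ IsTotallyReal F ∧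
        ∀ σ : F ≃ₐ[ℚ] F, σ ^ (5 : ℕ) = AlgEquiv.refl → ∀ τ : F →+* ℂ,
          {φ : L →+* ℂ | φ.comp (algebraMap F L) = τ.comp σ.toRingEquiv.toRingHom ∧ φ ∈ Φ.1}.ncard =
            {φ : L →+* ℂ | φ.comp (algebraMap F L) = τ ∧ φ ∈ Φ.1}.ncard}.ncard +
      8 * {F : IntermediateField ℚ L | Module.finrank ℚ F = 20 ∧ ¬ IsTotallyReal F ∧ IsCyclic (F ≃ₐ[ℚ] F) ∧
        ∀ σ : F ≃ₐ[ℚ] F, σ ^ (5 : ℕ) = AlgEquiv.refl → ∀ τ : F →+* ℂ,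
          {φ : L →+* ℂ | φ.comp (algebraMap F L) = τ.comp σ.toRingEquiv.toRingHom ∧ φ ∈ Φ.1}.ncard =
            {φ : L →+* ℂ | φ.comp (algebraMap F L) = τ ∧ φ ∈ Φ.1}.ncard}.ncard +
      8 * {F : IntermediateField ℚ L | Module.finrank ℚ F = 30 ∧ ¬ IsTotallyReal F ∧
        ∀ σ σ' : F ≃ₐ[ℚ] F, σ ^ (3 : ℕ) = AlgEquiv.refl → σ' ^ (5 : ℕ) = AlgEquiv.refl → ∀ τ : F →+* ℂ,
          {φ : L →+* ℂ | φ.comp (algebraMap F L) = τ ∧ φ ∈ Φ.1}.ncard +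
              {φ : L →+* ℂ | φ.comp (algebraMap F L) = τ.comp (σ * σ').toRingEquiv.toRingHom ∧ φ ∈ Φ.1}.ncard =
            {φ : L →+* ℂ | φ.comp (algebraMap F L) = τ.comp σ.toRingEquiv.toRingHom ∧ φ ∈ Φ.1}.ncard +
              {φ : L →+* ℂ | φ.comp (algebraMap F L) = τ.comp σ'.toRingEquiv.toRingHom ∧ φ ∈ Φ.1}.ncard}.ncard +
      16 * {F : IntermediateField ℚ L | Module.finrank ℚ F = 60 ∧ ¬ IsTotallyReal F ∧ IsCyclic (F ≃ₐ[ℚ] F) ∧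
        ∀ σ σ' : F ≃ₐ[ℚ] F, σ ^ (3 : ℕ) = AlgEquiv.refl → σ' ^ (5 : ℕ) = AlgEquiv.refl → ∀ τ : F →+* ℂ,
          {φ : L →+* ℂ | φ.comp (algebraMap F L) = τ ∧ φ ∈ Φ.1}.ncard +
              {φ : L →+* ℂ | φ.comp (algebraMap F L) = τ.comp (σ * σ').toRingEquiv.toRingHom ∧ φ ∈ Φ.1}.ncard =
            {φ : L →+* ℂ | φ.comp (algebraMap F L) = τ.comp σ.toRingEquiv.toRingHom ∧ φ ∈ Φ.1}.ncard +
              {φ : L →+* ℂ | φ.comp (algebraMap F L) = τ.comp σ'.toRingEquiv.toRingHom ∧ φ ∈ Φ.1}.ncard}.ncard = 61 := by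
  haveI : Fact (Nat.Prime 3) := ⟨Nat.prime_three⟩
  haveI : Fact (Nat.Prime 5) := ⟨Nat.prime_five⟩
  have h := cmTypeRank_add_ncard_subfields_eq_of_isCyclotomicExtension (L := L) (N := 183) (by norm_num)
    (by decide : (3 : ℕ) ≠ 5) (by decide : (3 : ℕ) ≠ 2) (by decide : (5 : ℕ) ≠ 2) units_pow_sixty_oneHundredEightyThree Φ
  have hN : Nat.totient 183 = 120 := by decide +kernel
  rw [hN] at h
  exact h

/-- **`ℚ(ζ_{183})`: THE HODGE CONJECTURE FOR ALL POWERS of every abelian variety with complex multiplication by `ℚ(ζ_{183})` (CM `60`-folds)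
whose type is off the eight lists** — UNCONDITIONAL. [cite: Gordon1999HodgeAVSurvey, Thm. 6.4 and §9.3] [cite: Kubota1965, §4 Lemma 2] -/
theorem hodgeConjectureFor_pow_of_forall_oneHundredEightyThree [IsCyclotomicExtension {183} ℚ L]
    (hW : ∀ F : IntermediateField ℚ L, Module.finrank ℚ F = 2 → ¬ IsTotallyReal F →
        ¬ ∀ τ : F →+* ℂ, {φ : L →+* ℂ | φ.comp (algebraMap F L) = τ ∧ φ ∈ Φ.1}.ncard =
          {φ : L →+* ℂ | φ.comp (algebraMap F L) = τ ∧ φ ∉ Φ.1}.ncard)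
    (hQ : ∀ F : IntermediateField ℚ L, Module.finrank ℚ F = 4 → ¬ IsTotallyReal F → IsCyclic (F ≃ₐ[ℚ] F) →
        ¬ ∀ τ : F →+* ℂ, 2 * {φ : L →+* ℂ | φ.comp (algebraMap F L) = τ ∧ φ ∈ Φ.1}.ncard = Module.finrank F L)
    (hLp : ∀ F : IntermediateField ℚ L, Module.finrank ℚ F = 2 * 3 → ¬ IsTotallyReal F →
        ¬ ∀ σ : F ≃ₐ[ℚ] F, σ ^ (3 : ℕ) = AlgEquiv.refl → ∀ τ : F →+* ℂ,
          {φ : L →+* ℂ | φ.comp (algebraMap F L) = τ.comp σ.toRingEquiv.toRingHom ∧ φ ∈ Φ.1}.ncard =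
            {φ : L →+* ℂ | φ.comp (algebraMap F L) = τ ∧ φ ∈ Φ.1}.ncard)
    (hLp4 : ∀ F : IntermediateField ℚ L, Module.finrank ℚ F = 4 * 3 → ¬ IsTotallyReal F → IsCyclic (F ≃ₐ[ℚ] F) →
        ¬ ∀ σ : F ≃ₐ[ℚ] F, σ ^ (3 : ℕ) = AlgEquiv.refl → ∀ τ : F →+* ℂ,
          {φ : L →+* ℂ | φ.comp (algebraMap F L) = τ.comp σ.toRingEquiv.toRingHom ∧ φ ∈ Φ.1}.ncard =
            {φ : L →+* ℂ | φ.comp (algebraMap F L) = τ ∧ φ ∈ Φ.1}.ncard)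
    (hLq : ∀ F : IntermediateField ℚ L, Module.finrank ℚ F = 2 * 5 → ¬ IsTotallyReal F →
        ¬ ∀ σ : F ≃ₐ[ℚ] F, σ ^ (5 : ℕ) = AlgEquiv.refl → ∀ τ : F →+* ℂ,
          {φ : L →+* ℂ | φ.comp (algebraMap F L) = τ.comp σ.toRingEquiv.toRingHom ∧ φ ∈ Φ.1}.ncard =
            {φ : L →+* ℂ | φ.comp (algebraMap F L) = τ ∧ φ ∈ Φ.1}.ncard)
    (hLq4 : ∀ F : IntermediateField ℚ L, Module.finrank ℚ F = 4 * 5 → ¬ IsTotallyReal F → IsCyclic (F ≃ₐ[ℚ] F) →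
        ¬ ∀ σ : F ≃ₐ[ℚ] F, σ ^ (5 : ℕ) = AlgEquiv.refl → ∀ τ : F →+* ℂ,
          {φ : L →+* ℂ | φ.comp (algebraMap F L) = τ.comp σ.toRingEquiv.toRingHom ∧ φ ∈ Φ.1}.ncard =
            {φ : L →+* ℂ | φ.comp (algebraMap F L) = τ ∧ φ ∈ Φ.1}.ncard)
    (hS : ∀ F : IntermediateField ℚ L, Module.finrank ℚ F = 2 * (3 * 5) → ¬ IsTotallyReal F →
        ¬ ∀ σ σ' : F ≃ₐ[ℚ] F, σ ^ (3 : ℕ) = AlgEquiv.refl → σ' ^ (5 : ℕ) = AlgEquiv.refl → ∀ τ : F →+* ℂ,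
          {φ : L →+* ℂ | φ.comp (algebraMap F L) = τ ∧ φ ∈ Φ.1}.ncard +
              {φ : L →+* ℂ | φ.comp (algebraMap F L) = τ.comp (σ * σ').toRingEquiv.toRingHom ∧ φ ∈ Φ.1}.ncard =
            {φ : L →+* ℂ | φ.comp (algebraMap F L) = τ.comp σ.toRingEquiv.toRingHom ∧ φ ∈ Φ.1}.ncard +
              {φ : L →+* ℂ | φ.comp (algebraMap F L) = τ.comp σ'.toRingEquiv.toRingHom ∧ φ ∈ Φ.1}.ncard)
    (hS4 : ∀ F : IntermediateField ℚ L, Module.finrank ℚ F = 4 * (3 * 5) → ¬ IsTotallyReal F → IsCyclic (F ≃ₐ[ℚ] F) →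
        ¬ ∀ σ σ' : F ≃ₐ[ℚ] F, σ ^ (3 : ℕ) = AlgEquiv.refl → σ' ^ (5 : ℕ) = AlgEquiv.refl → ∀ τ : F →+* ℂ,
          {φ : L →+* ℂ | φ.comp (algebraMap F L) = τ ∧ φ ∈ Φ.1}.ncard +
              {φ : L →+* ℂ | φ.comp (algebraMap F L) = τ.comp (σ * σ').toRingEquiv.toRingHom ∧ φ ∈ Φ.1}.ncard =
            {φ : L →+* ℂ | φ.comp (algebraMap F L) = τ.comp σ.toRingEquiv.toRingHom ∧ φ ∈ Φ.1}.ncard +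
              {φ : L →+* ℂ | φ.comp (algebraMap F L) = τ.comp σ'.toRingEquiv.toRingHom ∧ φ ∈ Φ.1}.ncard)
    (hA : IsCMTypeRealisation Φ A ι θ) (n : ℕ) :
    HodgeConjectureFor (⨁ fun _ : Fin n => A).dim (⨁ fun _ : Fin n => A).X :=
  haveI : Fact (Nat.Prime 3) := ⟨Nat.prime_three⟩
  haveI : Fact (Nat.Prime 5) := ⟨Nat.prime_five⟩
  hodgeConjectureFor_pow_of_forall_of_isCyclotomicExtension (N := 183) (by norm_num) (by decide) (by decide) (by decide)
    units_pow_sixty_oneHundredEightyThree hW hQ hLp hLp4 hLq hLq4 hS hS4 hA n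

/-- `u⁶⁰ = 1` for every unit of `ℤ/225`: `(ℤ/225)ˣ ≅ ℤ/6 × ℤ/20` (`225 = 3²·5²`; kernel decision on residues coprime to `225`).
[cite: Washington1997, Ch. 2 Thm. 2.5] -/
theorem units_pow_sixty_twoHundredTwentyFive (u : (ZMod 225)ˣ) : u ^ (4 * (3 * 5)) = 1 := by
  have h : ∀ a : ZMod 225, Nat.Coprime a.val 225 → a ^ 60 = 1 := by decide +kernel
  exact Units.ext (by rw [Units.val_pow_eq_pow_val, h _ (ZMod.val_coe_unit_coprime u), Units.val_one])

/-- **`ℚ(ζ_{225})` (degree `120`, `Gal ≅ ℤ/6 × ℤ/20`, exponent `60`): the rank formula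
`Rank(Φ) + b + 2e₄ + 2e₆ + 4e₁₂ + 4e₁₀ + 8e₂₀ + 8s₃₀ + 16s₆₀ = 61`** for every CM type — `b` Weil imaginary quadratic subfields, `e₄` cyclic quartic
CM subfields with half fibres, `e₆, e₁₀` (`e₁₂, e₂₀`, cyclic) CM subfields over which `Φ` is level of exponent `3` resp. `5`, `s₃₀` (`s₆₀`, cyclic) CM
subfields over which `Φ` is additively separable. [cite: Kubota1965, §4 Lemma 2] [cite: Hazama2003CyclicCM, Prop. 4.3 and Thm. 4.8] [cite: Dodson1984, §3.1.1 Theorem] -/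
theorem cmTypeRank_add_ncard_subfields_twoHundredTwentyFive [IsCyclotomicExtension {225} ℚ L] (Φ : CMType L) :
    cmTypeRank Φ + {F : IntermediateField ℚ L | Module.finrank ℚ F = 2 ∧ ¬ IsTotallyReal F ∧
        ∀ τ : F →+* ℂ, {φ : L →+* ℂ | φ.comp (algebraMap F L) = τ ∧ φ ∈ Φ.1}.ncard =
          {φ : L →+* ℂ | φ.comp (algebraMap F L) = τ ∧ φ ∉ Φ.1}.ncard}.ncard +
      2 * {F : IntermediateField ℚ L | Module.finrank ℚ F = 4 ∧ ¬ IsTotallyReal F ∧ IsCyclic (F ≃ₐ[ℚ] F) ∧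
        ∀ τ : F →+* ℂ, 2 * {φ : L →+* ℂ | φ.comp (algebraMap F L) = τ ∧ φ ∈ Φ.1}.ncard = Module.finrank F L}.ncard +
      2 * {F : IntermediateField ℚ L | Module.finrank ℚ F = 6 ∧ ¬ IsTotallyReal F ∧
        ∀ σ : F ≃ₐ[ℚ] F, σ ^ (3 : ℕ) = AlgEquiv.refl → ∀ τ : F →+* ℂ,
          {φ : L →+* ℂ | φ.comp (algebraMap F L) = τ.comp σ.toRingEquiv.toRingHom ∧ φ ∈ Φ.1}.ncard =
            {φ : L →+* ℂ | φ.comp (algebraMap F L) = τ ∧ φ ∈ Φ.1}.ncard}.ncard +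
      4 * {F : IntermediateField ℚ L | Module.finrank ℚ F = 12 ∧ ¬ IsTotallyReal F ∧ IsCyclic (F ≃ₐ[ℚ] F) ∧
        ∀ σ : F ≃ₐ[ℚ] F, σ ^ (3 : ℕ) = AlgEquiv.refl → ∀ τ : F →+* ℂ,
          {φ : L →+* ℂ | φ.comp (algebraMap F L) = τ.comp σ.toRingEquiv.toRingHom ∧ φ ∈ Φ.1}.ncard =
            {φ : L →+* ℂ | φ.comp (algebraMap F L) = τ ∧ φ ∈ Φ.1}.ncard}.ncard +
      4 * {F : IntermediateField ℚ L | Module.finrank ℚ F = 10 ∧ ¬ IsTotallyReal F ∧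
        ∀ σ : F ≃ₐ[ℚ] F, σ ^ (5 : ℕ) = AlgEquiv.refl → ∀ τ : F →+* ℂ,
          {φ : L →+* ℂ | φ.comp (algebraMap F L) = τ.comp σ.toRingEquiv.toRingHom ∧ φ ∈ Φ.1}.ncard =
            {φ : L →+* ℂ | φ.comp (algebraMap F L) = τ ∧ φ ∈ Φ.1}.ncard}.ncard +
      8 * {F : IntermediateField ℚ L | Module.finrank ℚ F = 20 ∧ ¬ IsTotallyReal F ∧ IsCyclic (F ≃ₐ[ℚ] F) ∧
        ∀ σ : F ≃ₐ[ℚ] F, σ ^ (5 : ℕ) = AlgEquiv.refl → ∀ τ : F →+* ℂ,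
          {φ : L →+* ℂ | φ.comp (algebraMap F L) = τ.comp σ.toRingEquiv.toRingHom ∧ φ ∈ Φ.1}.ncard =
            {φ : L →+* ℂ | φ.comp (algebraMap F L) = τ ∧ φ ∈ Φ.1}.ncard}.ncard +
      8 * {F : IntermediateField ℚ L | Module.finrank ℚ F = 30 ∧ ¬ IsTotallyReal F ∧
        ∀ σ σ' : F ≃ₐ[ℚ] F, σ ^ (3 : ℕ) = AlgEquiv.refl → σ' ^ (5 : ℕ) = AlgEquiv.refl → ∀ τ : F →+* ℂ,
          {φ : L →+* ℂ | φ.comp (algebraMap F L) = τ ∧ φ ∈ Φ.1}.ncard +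
              {φ : L →+* ℂ | φ.comp (algebraMap F L) = τ.comp (σ * σ').toRingEquiv.toRingHom ∧ φ ∈ Φ.1}.ncard =
            {φ : L →+* ℂ | φ.comp (algebraMap F L) = τ.comp σ.toRingEquiv.toRingHom ∧ φ ∈ Φ.1}.ncard +
              {φ : L →+* ℂ | φ.comp (algebraMap F L) = τ.comp σ'.toRingEquiv.toRingHom ∧ φ ∈ Φ.1}.ncard}.ncard +
      16 * {F : IntermediateField ℚ L | Module.finrank ℚ F = 60 ∧ ¬ IsTotallyReal F ∧ IsCyclic (F ≃ₐ[ℚ] F) ∧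
        ∀ σ σ' : F ≃ₐ[ℚ] F, σ ^ (3 : ℕ) = AlgEquiv.refl → σ' ^ (5 : ℕ) = AlgEquiv.refl → ∀ τ : F →+* ℂ,
          {φ : L →+* ℂ | φ.comp (algebraMap F L) = τ ∧ φ ∈ Φ.1}.ncard +
              {φ : L →+* ℂ | φ.comp (algebraMap F L) = τ.comp (σ * σ').toRingEquiv.toRingHom ∧ φ ∈ Φ.1}.ncard =
            {φ : L →+* ℂ | φ.comp (algebraMap F L) = τ.comp σ.toRingEquiv.toRingHom ∧ φ ∈ Φ.1}.ncard +
              {φ : L →+* ℂ | φ.comp (algebraMap F L) = τ.comp σ'.toRingEquiv.toRingHom ∧ φ ∈ Φ.1}.ncard}.ncard = 61 := by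
  haveI : Fact (Nat.Prime 3) := ⟨Nat.prime_three⟩
  haveI : Fact (Nat.Prime 5) := ⟨Nat.prime_five⟩
  have h := cmTypeRank_add_ncard_subfields_eq_of_isCyclotomicExtension (L := L) (N := 225) (by norm_num)
    (by decide : (3 : ℕ) ≠ 5) (by decide : (3 : ℕ) ≠ 2) (by decide : (5 : ℕ) ≠ 2) units_pow_sixty_twoHundredTwentyFive Φ
  have hN : Nat.totient 225 = 120 := by decide +kernel
  rw [hN] at h
  exact h

/-- **`ℚ(ζ_{225})`: THE HODGE CONJECTURE FOR ALL POWERS of every abelian variety with complex multiplication by `ℚ(ζ_{225})` (CM `60`-folds)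
whose type is off the eight lists** — UNCONDITIONAL. [cite: Gordon1999HodgeAVSurvey, Thm. 6.4 and §9.3] [cite: Kubota1965, §4 Lemma 2] -/
theorem hodgeConjectureFor_pow_of_forall_twoHundredTwentyFive [IsCyclotomicExtension {225} ℚ L]
    (hW : ∀ F : IntermediateField ℚ L, Module.finrank ℚ F = 2 → ¬ IsTotallyReal F →
        ¬ ∀ τ : F →+* ℂ, {φ : L →+* ℂ | φ.comp (algebraMap F L) = τ ∧ φ ∈ Φ.1}.ncard =
          {φ : L →+* ℂ | φ.comp (algebraMap F L) = τ ∧ φ ∉ Φ.1}.ncard)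
    (hQ : ∀ F : IntermediateField ℚ L, Module.finrank ℚ F = 4 → ¬ IsTotallyReal F → IsCyclic (F ≃ₐ[ℚ] F) →
        ¬ ∀ τ : F →+* ℂ, 2 * {φ : L →+* ℂ | φ.comp (algebraMap F L) = τ ∧ φ ∈ Φ.1}.ncard = Module.finrank F L)
    (hLp : ∀ F : IntermediateField ℚ L, Module.finrank ℚ F = 2 * 3 → ¬ IsTotallyReal F →
        ¬ ∀ σ : F ≃ₐ[ℚ] F, σ ^ (3 : ℕ) = AlgEquiv.refl → ∀ τ : F →+* ℂ,
          {φ : L →+* ℂ | φ.comp (algebraMap F L) = τ.comp σ.toRingEquiv.toRingHom ∧ φ ∈ Φ.1}.ncard =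
            {φ : L →+* ℂ | φ.comp (algebraMap F L) = τ ∧ φ ∈ Φ.1}.ncard)
    (hLp4 : ∀ F : IntermediateField ℚ L, Module.finrank ℚ F = 4 * 3 → ¬ IsTotallyReal F → IsCyclic (F ≃ₐ[ℚ] F) →
        ¬ ∀ σ : F ≃ₐ[ℚ] F, σ ^ (3 : ℕ) = AlgEquiv.refl → ∀ τ : F →+* ℂ,
          {φ : L →+* ℂ | φ.comp (algebraMap F L) = τ.comp σ.toRingEquiv.toRingHom ∧ φ ∈ Φ.1}.ncard =
            {φ : L →+* ℂ | φ.comp (algebraMap F L) = τ ∧ φ ∈ Φ.1}.ncard)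
    (hLq : ∀ F : IntermediateField ℚ L, Module.finrank ℚ F = 2 * 5 → ¬ IsTotallyReal F →
        ¬ ∀ σ : F ≃ₐ[ℚ] F, σ ^ (5 : ℕ) = AlgEquiv.refl → ∀ τ : F →+* ℂ,
          {φ : L →+* ℂ | φ.comp (algebraMap F L) = τ.comp σ.toRingEquiv.toRingHom ∧ φ ∈ Φ.1}.ncard =
            {φ : L →+* ℂ | φ.comp (algebraMap F L) = τ ∧ φ ∈ Φ.1}.ncard)
    (hLq4 : ∀ F : IntermediateField ℚ L, Module.finrank ℚ F = 4 * 5 → ¬ IsTotallyReal F → IsCyclic (F ≃ₐ[ℚ] F) →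
        ¬ ∀ σ : F ≃ₐ[ℚ] F, σ ^ (5 : ℕ) = AlgEquiv.refl → ∀ τ : F →+* ℂ,
          {φ : L →+* ℂ | φ.comp (algebraMap F L) = τ.comp σ.toRingEquiv.toRingHom ∧ φ ∈ Φ.1}.ncard =
            {φ : L →+* ℂ | φ.comp (algebraMap F L) = τ ∧ φ ∈ Φ.1}.ncard)
    (hS : ∀ F : IntermediateField ℚ L, Module.finrank ℚ F = 2 * (3 * 5) → ¬ IsTotallyReal F →
        ¬ ∀ σ σ' : F ≃ₐ[ℚ] F, σ ^ (3 : ℕ) = AlgEquiv.refl → σ' ^ (5 : ℕ) = AlgEquiv.refl → ∀ τ : F →+* ℂ,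
          {φ : L →+* ℂ | φ.comp (algebraMap F L) = τ ∧ φ ∈ Φ.1}.ncard +
              {φ : L →+* ℂ | φ.comp (algebraMap F L) = τ.comp (σ * σ').toRingEquiv.toRingHom ∧ φ ∈ Φ.1}.ncard =
            {φ : L →+* ℂ | φ.comp (algebraMap F L) = τ.comp σ.toRingEquiv.toRingHom ∧ φ ∈ Φ.1}.ncard +
              {φ : L →+* ℂ | φ.comp (algebraMap F L) = τ.comp σ'.toRingEquiv.toRingHom ∧ φ ∈ Φ.1}.ncard)
    (hS4 : ∀ F : IntermediateField ℚ L, Module.finrank ℚ F = 4 * (3 * 5) → ¬ IsTotallyReal F → IsCyclic (F ≃ₐ[ℚ] F) →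
        ¬ ∀ σ σ' : F ≃ₐ[ℚ] F, σ ^ (3 : ℕ) = AlgEquiv.refl → σ' ^ (5 : ℕ) = AlgEquiv.refl → ∀ τ : F →+* ℂ,
          {φ : L →+* ℂ | φ.comp (algebraMap F L) = τ ∧ φ ∈ Φ.1}.ncard +
              {φ : L →+* ℂ | φ.comp (algebraMap F L) = τ.comp (σ * σ').toRingEquiv.toRingHom ∧ φ ∈ Φ.1}.ncard =
            {φ : L →+* ℂ | φ.comp (algebraMap F L) = τ.comp σ.toRingEquiv.toRingHom ∧ φ ∈ Φ.1}.ncard +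
              {φ : L →+* ℂ | φ.comp (algebraMap F L) = τ.comp σ'.toRingEquiv.toRingHom ∧ φ ∈ Φ.1}.ncard)
    (hA : IsCMTypeRealisation Φ A ι θ) (n : ℕ) :
    HodgeConjectureFor (⨁ fun _ : Fin n => A).dim (⨁ fun _ : Fin n => A).X :=
  haveI : Fact (Nat.Prime 3) := ⟨Nat.prime_three⟩
  haveI : Fact (Nat.Prime 5) := ⟨Nat.prime_five⟩
  hodgeConjectureFor_pow_of_forall_of_isCyclotomicExtension (N := 225) (by norm_num) (by decide) (by decide) (by decide)
    units_pow_sixty_twoHundredTwentyFive hW hQ hLp hLp4 hLq hLq4 hS hS4 hA n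

/-- `u⁶⁰ = 1` for every unit of `ℤ/244`: `(ℤ/244)ˣ ≅ ℤ/2 × ℤ/60` (`244 = 4·61`; kernel decision on residues coprime to `244`).
[cite: Washington1997, Ch. 2 Thm. 2.5] -/
theorem units_pow_sixty_twoHundredFortyFour (u : (ZMod 244)ˣ) : u ^ (4 * (3 * 5)) = 1 := by
  have h : ∀ a : ZMod 244, Nat.Coprime a.val 244 → a ^ 60 = 1 := by decide +kernel
  exact Units.ext (by rw [Units.val_pow_eq_pow_val, h _ (ZMod.val_coe_unit_coprime u), Units.val_one])

/-- **`ℚ(ζ_{244})` (degree `120`, `Gal ≅ ℤ/2 × ℤ/60`, exponent `60`): the rank formula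
`Rank(Φ) + b + 2e₄ + 2e₆ + 4e₁₂ + 4e₁₀ + 8e₂₀ + 8s₃₀ + 16s₆₀ = 61`** for every CM type — `b` Weil imaginary quadratic subfields, `e₄` cyclic quartic
CM subfields with half fibres, `e₆, e₁₀` (`e₁₂, e₂₀`, cyclic) CM subfields over which `Φ` is level of exponent `3` resp. `5`, `s₃₀` (`s₆₀`, cyclic) CM
subfields over which `Φ` is additively separable. [cite: Kubota1965, §4 Lemma 2] [cite: Hazama2003CyclicCM, Prop. 4.3 and Thm. 4.8] [cite: Dodson1984, §3.1.1 Theorem] -/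
theorem cmTypeRank_add_ncard_subfields_twoHundredFortyFour [IsCyclotomicExtension {244} ℚ L] (Φ : CMType L) :
    cmTypeRank Φ + {F : IntermediateField ℚ L | Module.finrank ℚ F = 2 ∧ ¬ IsTotallyReal F ∧
        ∀ τ : F →+* ℂ, {φ : L →+* ℂ | φ.comp (algebraMap F L) = τ ∧ φ ∈ Φ.1}.ncard =
          {φ : L →+* ℂ | φ.comp (algebraMap F L) = τ ∧ φ ∉ Φ.1}.ncard}.ncard +
      2 * {F : IntermediateField ℚ L | Module.finrank ℚ F = 4 ∧ ¬ IsTotallyReal F ∧ IsCyclic (F ≃ₐ[ℚ] F) ∧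
        ∀ τ : F →+* ℂ, 2 * {φ : L →+* ℂ | φ.comp (algebraMap F L) = τ ∧ φ ∈ Φ.1}.ncard = Module.finrank F L}.ncard +
      2 * {F : IntermediateField ℚ L | Module.finrank ℚ F = 6 ∧ ¬ IsTotallyReal F ∧
        ∀ σ : F ≃ₐ[ℚ] F, σ ^ (3 : ℕ) = AlgEquiv.refl → ∀ τ : F →+* ℂ,
          {φ : L →+* ℂ | φ.comp (algebraMap F L) = τ.comp σ.toRingEquiv.toRingHom ∧ φ ∈ Φ.1}.ncard =
            {φ : L →+* ℂ | φ.comp (algebraMap F L) = τ ∧ φ ∈ Φ.1}.ncard}.ncard +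
      4 * {F : IntermediateField ℚ L | Module.finrank ℚ F = 12 ∧ ¬ IsTotallyReal F ∧ IsCyclic (F ≃ₐ[ℚ] F) ∧
        ∀ σ : F ≃ₐ[ℚ] F, σ ^ (3 : ℕ) = AlgEquiv.refl → ∀ τ : F →+* ℂ,
          {φ : L →+* ℂ | φ.comp (algebraMap F L) = τ.comp σ.toRingEquiv.toRingHom ∧ φ ∈ Φ.1}.ncard =
            {φ : L →+* ℂ | φ.comp (algebraMap F L) = τ ∧ φ ∈ Φ.1}.ncard}.ncard +
      4 * {F : IntermediateField ℚ L | Module.finrank ℚ F = 10 ∧ ¬ IsTotallyReal F ∧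
        ∀ σ : F ≃ₐ[ℚ] F, σ ^ (5 : ℕ) = AlgEquiv.refl → ∀ τ : F →+* ℂ,
          {φ : L →+* ℂ | φ.comp (algebraMap F L) = τ.comp σ.toRingEquiv.toRingHom ∧ φ ∈ Φ.1}.ncard =
            {φ : L →+* ℂ | φ.comp (algebraMap F L) = τ ∧ φ ∈ Φ.1}.ncard}.ncard +
      8 * {F : IntermediateField ℚ L | Module.finrank ℚ F = 20 ∧ ¬ IsTotallyReal F ∧ IsCyclic (F ≃ₐ[ℚ] F) ∧
        ∀ σ : F ≃ₐ[ℚ] F, σ ^ (5 : ℕ) = AlgEquiv.refl → ∀ τ : F →+* ℂ,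
          {φ : L →+* ℂ | φ.comp (algebraMap F L) = τ.comp σ.toRingEquiv.toRingHom ∧ φ ∈ Φ.1}.ncard =
            {φ : L →+* ℂ | φ.comp (algebraMap F L) = τ ∧ φ ∈ Φ.1}.ncard}.ncard +
      8 * {F : IntermediateField ℚ L | Module.finrank ℚ F = 30 ∧ ¬ IsTotallyReal F ∧
        ∀ σ σ' : F ≃ₐ[ℚ] F, σ ^ (3 : ℕ) = AlgEquiv.refl → σ' ^ (5 : ℕ) = AlgEquiv.refl → ∀ τ : F →+* ℂ,
          {φ : L →+* ℂ | φ.comp (algebraMap F L) = τ ∧ φ ∈ Φ.1}.ncard +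
              {φ : L →+* ℂ | φ.comp (algebraMap F L) = τ.comp (σ * σ').toRingEquiv.toRingHom ∧ φ ∈ Φ.1}.ncard =
            {φ : L →+* ℂ | φ.comp (algebraMap F L) = τ.comp σ.toRingEquiv.toRingHom ∧ φ ∈ Φ.1}.ncard +
              {φ : L →+* ℂ | φ.comp (algebraMap F L) = τ.comp σ'.toRingEquiv.toRingHom ∧ φ ∈ Φ.1}.ncard}.ncard +
      16 * {F : IntermediateField ℚ L | Module.finrank ℚ F = 60 ∧ ¬ IsTotallyReal F ∧ IsCyclic (F ≃ₐ[ℚ] F) ∧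
        ∀ σ σ' : F ≃ₐ[ℚ] F, σ ^ (3 : ℕ) = AlgEquiv.refl → σ' ^ (5 : ℕ) = AlgEquiv.refl → ∀ τ : F →+* ℂ,
          {φ : L →+* ℂ | φ.comp (algebraMap F L) = τ ∧ φ ∈ Φ.1}.ncard +
              {φ : L →+* ℂ | φ.comp (algebraMap F L) = τ.comp (σ * σ').toRingEquiv.toRingHom ∧ φ ∈ Φ.1}.ncard =
            {φ : L →+* ℂ | φ.comp (algebraMap F L) = τ.comp σ.toRingEquiv.toRingHom ∧ φ ∈ Φ.1}.ncard +
              {φ : L →+* ℂ | φ.comp (algebraMap F L) = τ.comp σ'.toRingEquiv.toRingHom ∧ φ ∈ Φ.1}.ncard}.ncard = 61 := by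
  haveI : Fact (Nat.Prime 3) := ⟨Nat.prime_three⟩
  haveI : Fact (Nat.Prime 5) := ⟨Nat.prime_five⟩
  have h := cmTypeRank_add_ncard_subfields_eq_of_isCyclotomicExtension (L := L) (N := 244) (by norm_num)
    (by decide : (3 : ℕ) ≠ 5) (by decide : (3 : ℕ) ≠ 2) (by decide : (5 : ℕ) ≠ 2) units_pow_sixty_twoHundredFortyFour Φ
  have hN : Nat.totient 244 = 120 := by decide +kernel
  rw [hN] at h
  exact h

/-- **`ℚ(ζ_{244})`: THE HODGE CONJECTURE FOR ALL POWERS of every abelian variety with complex multiplication by `ℚ(ζ_{244})` (CM `60`-folds)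
whose type is off the eight lists** — UNCONDITIONAL. [cite: Gordon1999HodgeAVSurvey, Thm. 6.4 and §9.3] [cite: Kubota1965, §4 Lemma 2] -/
theorem hodgeConjectureFor_pow_of_forall_twoHundredFortyFour [IsCyclotomicExtension {244} ℚ L]
    (hW : ∀ F : IntermediateField ℚ L, Module.finrank ℚ F = 2 → ¬ IsTotallyReal F →
        ¬ ∀ τ : F →+* ℂ, {φ : L →+* ℂ | φ.comp (algebraMap F L) = τ ∧ φ ∈ Φ.1}.ncard =
          {φ : L →+* ℂ | φ.comp (algebraMap F L) = τ ∧ φ ∉ Φ.1}.ncard)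
    (hQ : ∀ F : IntermediateField ℚ L, Module.finrank ℚ F = 4 → ¬ IsTotallyReal F → IsCyclic (F ≃ₐ[ℚ] F) →
        ¬ ∀ τ : F →+* ℂ, 2 * {φ : L →+* ℂ | φ.comp (algebraMap F L) = τ ∧ φ ∈ Φ.1}.ncard = Module.finrank F L)
    (hLp : ∀ F : IntermediateField ℚ L, Module.finrank ℚ F = 2 * 3 → ¬ IsTotallyReal F →
        ¬ ∀ σ : F ≃ₐ[ℚ] F, σ ^ (3 : ℕ) = AlgEquiv.refl → ∀ τ : F →+* ℂ,
          {φ : L →+* ℂ | φ.comp (algebraMap F L) = τ.comp σ.toRingEquiv.toRingHom ∧ φ ∈ Φ.1}.ncard =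
            {φ : L →+* ℂ | φ.comp (algebraMap F L) = τ ∧ φ ∈ Φ.1}.ncard)
    (hLp4 : ∀ F : IntermediateField ℚ L, Module.finrank ℚ F = 4 * 3 → ¬ IsTotallyReal F → IsCyclic (F ≃ₐ[ℚ] F) →
        ¬ ∀ σ : F ≃ₐ[ℚ] F, σ ^ (3 : ℕ) = AlgEquiv.refl → ∀ τ : F →+* ℂ,
          {φ : L →+* ℂ | φ.comp (algebraMap F L) = τ.comp σ.toRingEquiv.toRingHom ∧ φ ∈ Φ.1}.ncard =
            {φ : L →+* ℂ | φ.comp (algebraMap F L) = τ ∧ φ ∈ Φ.1}.ncard)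
    (hLq : ∀ F : IntermediateField ℚ L, Module.finrank ℚ F = 2 * 5 → ¬ IsTotallyReal F →
        ¬ ∀ σ : F ≃ₐ[ℚ] F, σ ^ (5 : ℕ) = AlgEquiv.refl → ∀ τ : F →+* ℂ,
          {φ : L →+* ℂ | φ.comp (algebraMap F L) = τ.comp σ.toRingEquiv.toRingHom ∧ φ ∈ Φ.1}.ncard =
            {φ : L →+* ℂ | φ.comp (algebraMap F L) = τ ∧ φ ∈ Φ.1}.ncard)
    (hLq4 : ∀ F : IntermediateField ℚ L, Module.finrank ℚ F = 4 * 5 → ¬ IsTotallyReal F → IsCyclic (F ≃ₐ[ℚ] F) →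
        ¬ ∀ σ : F ≃ₐ[ℚ] F, σ ^ (5 : ℕ) = AlgEquiv.refl → ∀ τ : F →+* ℂ,
          {φ : L →+* ℂ | φ.comp (algebraMap F L) = τ.comp σ.toRingEquiv.toRingHom ∧ φ ∈ Φ.1}.ncard =
            {φ : L →+* ℂ | φ.comp (algebraMap F L) = τ ∧ φ ∈ Φ.1}.ncard)
    (hS : ∀ F : IntermediateField ℚ L, Module.finrank ℚ F = 2 * (3 * 5) → ¬ IsTotallyReal F →
        ¬ ∀ σ σ' : F ≃ₐ[ℚ] F, σ ^ (3 : ℕ) = AlgEquiv.refl → σ' ^ (5 : ℕ) = AlgEquiv.refl → ∀ τ : F →+* ℂ,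
          {φ : L →+* ℂ | φ.comp (algebraMap F L) = τ ∧ φ ∈ Φ.1}.ncard +
              {φ : L →+* ℂ | φ.comp (algebraMap F L) = τ.comp (σ * σ').toRingEquiv.toRingHom ∧ φ ∈ Φ.1}.ncard =
            {φ : L →+* ℂ | φ.comp (algebraMap F L) = τ.comp σ.toRingEquiv.toRingHom ∧ φ ∈ Φ.1}.ncard +
              {φ : L →+* ℂ | φ.comp (algebraMap F L) = τ.comp σ'.toRingEquiv.toRingHom ∧ φ ∈ Φ.1}.ncard)
    (hS4 : ∀ F : IntermediateField ℚ L, Module.finrank ℚ F = 4 * (3 * 5) → ¬ IsTotallyReal F → IsCyclic (F ≃ₐ[ℚ] F) →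
        ¬ ∀ σ σ' : F ≃ₐ[ℚ] F, σ ^ (3 : ℕ) = AlgEquiv.refl → σ' ^ (5 : ℕ) = AlgEquiv.refl → ∀ τ : F →+* ℂ,
          {φ : L →+* ℂ | φ.comp (algebraMap F L) = τ ∧ φ ∈ Φ.1}.ncard +
              {φ : L →+* ℂ | φ.comp (algebraMap F L) = τ.comp (σ * σ').toRingEquiv.toRingHom ∧ φ ∈ Φ.1}.ncard =
            {φ : L →+* ℂ | φ.comp (algebraMap F L) = τ.comp σ.toRingEquiv.toRingHom ∧ φ ∈ Φ.1}.ncard +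
              {φ : L →+* ℂ | φ.comp (algebraMap F L) = τ.comp σ'.toRingEquiv.toRingHom ∧ φ ∈ Φ.1}.ncard)
    (hA : IsCMTypeRealisation Φ A ι θ) (n : ℕ) :
    HodgeConjectureFor (⨁ fun _ : Fin n => A).dim (⨁ fun _ : Fin n => A).X :=
  haveI : Fact (Nat.Prime 3) := ⟨Nat.prime_three⟩
  haveI : Fact (Nat.Prime 5) := ⟨Nat.prime_five⟩
  hodgeConjectureFor_pow_of_forall_of_isCyclotomicExtension (N := 244) (by norm_num) (by decide) (by decide) (by decide)
    units_pow_sixty_twoHundredFortyFour hW hQ hLp hLp4 hLq hLq4 hS hS4 hA n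

end Cyclotomic

end ExponentFourTimesTwoOddPrimes

end Literature.AlgebraicGeometry.Pohlmann1968

end
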